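import Mathlib
import HarnessLib
import Literature.Analysis.FluidPDE.VorticityCalculus
import Summits.NavierStokesRegularity.NavierStokesRegularity.Theses.PoloidalWindowDoor
import Summits.NavierStokesRegularity.NavierStokesRegularity.Theses.LoopPeriodRatchet
import Summits.NavierStokesRegularity.NavierStokesRegularity.Theorems.PoloidalWindowDoorPoloidalWindowRigidityWindow
import Summits.NavierStokesRegularity.NavierStokesRegularity.Theorems.SymmetryModuliCountSymmetricLiouville
import Summits.NavierStokesRegularity.NavierStokesRegularity.Theorems.PoloidalWindowDoorPoloidalWindowRigidityHotLoopsReduction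
import Summits.NavierStokesRegularity.NavierStokesRegularity.Theorems.PoloidalWindowDoorPoloidalWindowRigidityHotHullCompactness
import Summits.NavierStokesRegularity.NavierStokesRegularity.Theorems.PoloidalWindowDoorPoloidalWindowRigidityPoloidalExtremal
import Summits.NavierStokesRegularity.NavierStokesRegularity.Theorems.PoloidalWindowDoorPoloidalWindowRigidityPoloidalExtremalSelfRecurrent
import Summits.NavierStokesRegularity.NavierStokesRegularity.Theorems.PoloidalWindowDoorPoloidalWindowRigiditySymmetryGerms
import Summits.NavierStokesRegularity.NavierStokesRegularity.Theorems.PoloidalWindowDoorPoloidalWindowRigidityVerticalShearGerm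
import Summits.NavierStokesRegularity.NavierStokesRegularity.Theorems.PoloidalWindowDoorLrcModEntireFarThreadReduction
import Summits.NavierStokesRegularity.NavierStokesRegularity.Theorems.PoloidalWindowDoorLrcModEntireThreadDichotomy
import Summits.NavierStokesRegularity.NavierStokesRegularity.Theorems.PoloidalWindowDoorLrcModEntireThreadPins
import Summits.NavierStokesRegularity.NavierStokesRegularity.Theorems.PoloidalWindowDoorLrcModEntireIff
import Summits.NavierStokesRegularity.NavierStokesRegularity.Theorems.PoloidalWindowDoorLrcModEntireUntwistedGerm
import Summits.NavierStokesRegularity.NavierStokesRegularity.Theorems.PoloidalWindowDoorLrcModEntireTwistingTHLocalHypGerm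
import Summits.NavierStokesRegularity.NavierStokesRegularity.Theorems.PoloidalWindowDoorLrcModEntireTwistingTHLocalNonUmbilic
import Summits.NavierStokesRegularity.NavierStokesRegularity.Theorems.PoloidalWindowDoorLrcModEntireTwistingTHLocalGalilean
import Summits.NavierStokesRegularity.NavierStokesRegularity.Theorems.PoloidalWindowDoorLrcModEntireTwistingTHLocalNormalFormRS
import Summits.NavierStokesRegularity.NavierStokesRegularity.Theorems.SymmetricLiouville.Negative.SmallConstantGap
import Summits.NavierStokesRegularity.NavierStokesRegularity.Theorems.SymmetricLiouville.Negative.NonlinearLoadBearing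
import Summits.NavierStokesRegularity.NavierStokesRegularity.Theorems.PoloidalWindowDoorPoloidalWindowRigidityLeastPinAnisotropicGap
import Summits.NavierStokesRegularity.NavierStokesRegularity.Theorems.PoloidalWindowDoorPoloidalWindowRigidityLeastPinNoPinLoss
import Summits.NavierStokesRegularity.NavierStokesRegularity.Theorems.PoloidalWindowDoorPoloidalWindowRigidityEternalCoreParaboloidGap
import Summits.NavierStokesRegularity.NavierStokesRegularity.Theorems.PoloidalWindowDoorPoloidalWindowRigidityEternalCoreScalingCore
import Literature.Analysis.FluidPDE.TypeIAncientMildRescale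
import Literature.Analysis.FluidPDE.NSBoundedMildSmoothing
import Summits.NavierStokesRegularity.NavierStokesRegularity.Theorems.PoloidalWindowDoorPoloidalWindowRigidityHotSplitRidgeKernels
import Summits.NavierStokesRegularity.NavierStokesRegularity.Theorems.PoloidalWindowDoorPoloidalWindowRigidityStrata
import Summits.NavierStokesRegularity.NavierStokesRegularity.Theorems.PoloidalWindowDoorPoloidalWindowRigidityHotHullSlabUniform
import Literature.Analysis.FluidPDE.AxisymmetricEuler
import Summits.NavierStokesRegularity.NavierStokesRegularity.Theorems.SymmetryModuliCountAxisymEndLiouville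
import Summits.NavierStokesRegularity.NavierStokesRegularity.Theorems.PoloidalWindowDoorPoloidalWindowRigidityEternalWebVerticalCore
import Summits.NavierStokesRegularity.NavierStokesRegularity.Theorems.PoloidalWindowDoorPoloidalWindowRigidityPeriodic

/-!
# Crux `PoloidalWindowRigidity` (K2, stmt-NavierStokesRegularity-19708) + item `LrcModEntire` (stmt-20428) — LINE 30 `point_group` (v1.1: + `noPinnedScrewSoliton_of_class`, §35; sorries 3 = hand H1 + the two research cells)
# (IDEATOR seat ns-idea-8, generation 13; lens «barrier» — barrier-inversion: the CRYSTALLOGRAPHY of the pinned critical element)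

THESIS.  LINE 28 excluded near-one SCALING factors about a bounded centre, LINE 29 near-IDENTITY screw-scalings `(θ, λ) ≈ (0, 1)`.  This line bounds the
whole group of VERTICAL SIMILARITY symmetries `x ↦ c + λ R_θ (x − c) + h e₂` of a pinned peakless least-pin profile with ONE new lever: DIRICHLET'S
PIGEONHOLE on the circle (Mathlib `Real.exists_int_int_abs_mul_sub_le`) — every element has a POWER `g^k`, `k ≤ Q`, whose rotation part is within `2π/(Q+1)`
of a whole number of turns, so an ARBITRARY-ANGLE symmetry with a small non-compact part (shift `h/c_j → 0` under blow-down, or `|log λ| ≪ 1/Q`) yields a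
NEAR-IDENTITY element `≠ e`, and LINE 29's one-parameter extraction applies.  RESULTS (PROVED in-file, §38–§41): `not_helical_pinned` — NO helical symmetry
`(R_θ, h e₂)`, `h ≠ 0`, rational OR IRRATIONAL `θ` (unconditional: Pinned + Peakless + NoPinLoss; the tree settles finite turn order only:
`…Periodic.eq_zero_of_twistedPeriodic`, census `ScenarioCensus.RotationOrder.Row_AsqT`); `rotationFloor_pinned` + `rotation_rational_pinned` — rotational
symmetries about a bounded axis have angle `2πk/n` with `0 < |n| ≤ M(C,B)` (U3a only, H1-free; the irrational / non-cyclic case alone is tree-decided in the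
general class: census `Row_AirT` / `Row_AncT`, `CorkscrewProfileAngleTools.isAxisymmetric_of_equivariant_irrational`; the UNIFORM ORDER BOUND is new);
`rotatedNearOne_pinned` — no screw-scaling with `λ ≠ 1`, `|log λ| < ρ′(C,B)`, at ANY angle (from H1 + U3a; cf. Pineau–Vicol 2026 Thm 1.7 with decay, the tree's
`RellichScar…RdssAnyAngleNearOne` / `CorkscrewProfileNearIdentityRigidity.stub_angleTuning` in the apex / decaying classes with stubs).  The research cells are
RE-CUT as POINT-WEB / POINT-SYNDETIC (§42) carrying these data; LINE 29's cells follow by checked kernels (§43).  ANNEX (0 sorry, general class, separate file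
`Lines/point_group_centre.lean`): the commutator of two affine vertical similarities is a translation ⇒ all scalings `λ ≠ 1` of a live profile share ONE centre.
FILE LAYOUT.  §0–§37 = LINE 29 `Lines/near_identity.lean` (tree commit 9217e0e21450): STATEMENTS AND PROOFS VERBATIM up to (i) the textual abbreviation
`E₃ := EuclideanSpace ℝ (Fin 3)` (reducible `abbrev`, byte cap), (ii) docstrings abridged / omitted on inherited theorems (byte cap; read them in
`Lines/near_one.lean`, `Lines/near_identity.lean`), (iii) §18 U4b `verticalCore_holds` WIRED BY NAME to the landed tree theorem
`Theorems.PoloidalWindowDoorPoloidalWindowRigidityEternalWebVerticalCore.verticalCore` (p715529; statement verbatim), (iv) §35: LINE 29's proof of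
`nearIdentity_pinned` FACTORED through the new lemma `pinnedExtraction` (same argument; statement of `nearIdentity_pinned` verbatim) so that §40 reuses it
H1-free, (v) LINE 29's `noScrewSoliton_fast` (anchored class; unused downstream) omitted and its cell stubs `stub_cellScrewWeb` / `stub_cellScrewSyndetic` with
their stub compositions REMOVED — those cells are DERIVED here (§43).  NEW content: §38–§43.  Sorries = 3: `stub_noPinnedScrewSoliton` (hand H1, research;
fast half PROVED), `stub_cellPointWeb`, `stub_cellPointSyndetic`.
* HANDS wired by name: U3a `AnisotropicGap` (data), U3b `NoPinLoss` (binder), U2b (tree), U4b (tree).  H1 `NoPinnedScrewSoliton` stays a research hand.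
  Shared hypotheses `hS0 : S0Statement`, `hG : …LoopPeriodRatchet.FrequencyGrowthExponent` (wall ⟨27893⟩) as in every line of the column.
* LABELS: files-only line of a door route; no cell / crux / route item closed; 19708 / 20428 OPEN; NS regularity NOT proved.
-/
noncomputable section

set_option linter.dupNamespace false
set_option linter.unusedVariables false
set_option linter.unusedSectionVars false

namespace Summit.NavierStokesRegularity.NavierStokesRegularity.Cruxes.PoloidalWindowRigidity.PointGroup

open Set Function MeasureTheory Filter Topology Metric
open scoped InnerProductSpace RealInnerProductSpace Laplacian
open Literature.Analysis Literature.Analysis.FluidPDE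
open Summit.NavierStokesRegularity.NavierStokesRegularity.Theses.PoloidalWindowDoor
open Summit.NavierStokesRegularity.NavierStokesRegularity.Theorems

/-- `ℝ³` — a reducible textual abbreviation of `EuclideanSpace ℝ (Fin 3)` (byte cap; statements unchanged up to unfolding). -/
abbrev E₃ : Type := EuclideanSpace ℝ (Fin 3)

/-! ## §0 The column's objects, VERBATIM (hot_split v1.6 = hot_forest = hot_hull = uniform_return = eternal_core) -/

/-- **Pinned** — VERBATIM hot_split: Type-I decay, continuity, mild identity, div-free, … -/
def Pinned (C : ℝ) (v : ℝ → E₃ → E₃) : Prop :=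
  Literature.Analysis.FluidPDE.HasTypeITimeDecay C v ∧
  ContinuousOn (Function.uncurry v) (Set.Iio (0 : ℝ) ×ˢ Set.univ) ∧
  (∀ s t : ℝ, s < t → t < 0 → ∀ x, v t x =
    Literature.Analysis.UnboundedOperators.heatExtension (v s) (t - s) x -
      Literature.Analysis.FluidPDE.oseenDuhamel 1 s v v t x) ∧
  (∀ t < 0, Literature.Analysis.FluidPDE.VectorCalculus.IsDivFree (v t)) ∧
  (∀ s < 0, ∀ y, ⟪Literature.Analysis.FluidPDE.curl (v s) y, EuclideanSpace.single 2 1⟫_ℝ = 0) ∧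
  v (-1) 0 2 ≠ 0 ∧ (∀ t < 0, ∀ x, Real.sqrt (-t) * |v t x 2| ≤ |v (-1) 0 2|) ∧
  (∀ h : E₃, fderiv ℝ (v (-1)) 0 h 2 = 0) ∧
  (deriv (fun s => v s 0 2) (-1) = v (-1) 0 2 / 2 ∧ v (-1) 0 2 * (Δ (fun y => v (-1) y 2)) 0 ≤ 0)

/-- **ThickWindow** — VERBATIM hot_split. -/
def ThickWindow (v : ℝ → E₃ → E₃) (W : Set (ℝ × E₃)) : Prop :=
  IsOpen W ∧ W ⊆ Set.Iio (0 : ℝ) ×ˢ Set.univ ∧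
  (∀ z ∈ W, (Literature.Analysis.FluidPDE.curl (v z.1) z.2 ≠ 0 ∧
      (fderiv ℝ (v z.1) z.2 (EuclideanSpace.single 0 1) 2 ≠ 0 ∨ fderiv ℝ (v z.1) z.2 (EuclideanSpace.single 1 1) 2 ≠ 0) ∧
      (fderiv ℝ (v z.1) z.2 (EuclideanSpace.single 2 1) 0 ≠ 0 ∨ fderiv ℝ (v z.1) z.2 (EuclideanSpace.single 2 1) 1 ≠ 0)) ∧
    (fderiv ℝ (fun x => fderiv ℝ (v z.1) x (EuclideanSpace.single 2 1) 2) z.2 (EuclideanSpace.single 0 1) *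
          fderiv ℝ (v z.1) z.2 (EuclideanSpace.single 1 1) 2 -
        fderiv ℝ (fun x => fderiv ℝ (v z.1) x (EuclideanSpace.single 2 1) 2) z.2 (EuclideanSpace.single 1 1) *
          fderiv ℝ (v z.1) z.2 (EuclideanSpace.single 0 1) 2 ≠ 0)) ∧
  (∀ m : ℝ → ℝ → ℝ, ∀ W₁ : Set (ℝ × E₃), W₁ ⊆ W → IsOpen W₁ → W₁.Nonempty →
      ∃ z ∈ W₁, ∃ b : Fin 3, b ≠ 2 ∧
        fderiv ℝ (v z.1) z.2 (EuclideanSpace.single 2 1) b ≠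
          m z.1 (z.2 2) * fderiv ℝ (v z.1) z.2 (EuclideanSpace.single b 1) 2) ∧
  (∀ r : ℝ, 0 < r → (Metric.ball ((-1 : ℝ), (0 : E₃)) r ∩ W).Nonempty)

/-- **Peakless** — VERBATIM hot_split: no island bracket of `σ·v₂(s,·)` on any … -/
def Peakless (v : ℝ → E₃ → E₃) : Prop :=
  ∀ (s z₀ σ M : ℝ) (K O : Set (E₃)), s < 0 →
    ((σ = 1 ∨ σ = -1) ∧ IsCompact K ∧ K.Nonempty ∧ (∀ y ∈ K, y 2 = z₀ ∧ σ * v s y 2 = M) ∧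
      IsOpen O ∧ K ⊆ O ∧ (∀ y ∈ O, y 2 = z₀ → σ * v s y 2 ≤ M) ∧
      (∀ y ∈ O, y 2 = z₀ → σ * v s y 2 = M → y ∈ K)) → False

/-- The HOT SET of the hot-spot plane `P₀ = {y₂ = 0}` at time `−1` — VERBATIM … -/
def hotSet (v : ℝ → E₃ → E₃) : Set (E₃) :=
  {y | y 2 = 0 ∧ v (-1) y 2 = v (-1) 0 2}

/-- `ThickWindow` re-centred at an arbitrary space-time point `z₀` (the body of … -/
def ThickWindowAt (v : ℝ → E₃ → E₃) (W : Set (ℝ × E₃))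
    (z₀ : ℝ × E₃) : Prop :=
  IsOpen W ∧ W ⊆ Set.Iio (0 : ℝ) ×ˢ Set.univ ∧
    (∀ z ∈ W, (Literature.Analysis.FluidPDE.curl (v z.1) z.2 ≠ 0 ∧
        (fderiv ℝ (v z.1) z.2 (EuclideanSpace.single 0 1) 2 ≠ 0 ∨ fderiv ℝ (v z.1) z.2 (EuclideanSpace.single 1 1) 2 ≠ 0) ∧
        (fderiv ℝ (v z.1) z.2 (EuclideanSpace.single 2 1) 0 ≠ 0 ∨ fderiv ℝ (v z.1) z.2 (EuclideanSpace.single 2 1) 1 ≠ 0)) ∧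
      (fderiv ℝ (fun x => fderiv ℝ (v z.1) x (EuclideanSpace.single 2 1) 2) z.2 (EuclideanSpace.single 0 1) *
            fderiv ℝ (v z.1) z.2 (EuclideanSpace.single 1 1) 2 -
          fderiv ℝ (fun x => fderiv ℝ (v z.1) x (EuclideanSpace.single 2 1) 2) z.2 (EuclideanSpace.single 1 1) *
            fderiv ℝ (v z.1) z.2 (EuclideanSpace.single 0 1) 2 ≠ 0)) ∧
    (∀ m : ℝ → ℝ → ℝ, ∀ W₁ : Set (ℝ × E₃), W₁ ⊆ W → IsOpen W₁ → W₁.Nonempty →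
        ∃ z ∈ W₁, ∃ b : Fin 3, b ≠ 2 ∧
          fderiv ℝ (v z.1) z.2 (EuclideanSpace.single 2 1) b ≠
            m z.1 (z.2 2) * fderiv ℝ (v z.1) z.2 (EuclideanSpace.single b 1) 2) ∧
    (∀ r : ℝ, 0 < r → (Metric.ball z₀ r ∩ W).Nonempty)

/-! ## §1 Class bookkeeping (PROVED, as in LINE 22 / LINE 23) -/

theorem class_of_pinned {C : ℝ} {U : ℝ → E₃ → E₃} (hP : Pinned C U) : IsTypeIAncientMild C U :=
  PoloidalWindowDoorPoloidalWindowRigidityWindow.isTypeIAncientMild_of_class hP.1 hP.2.1 hP.2.2.1 hP.2.2.2.1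

theorem pinned_absurd_of_zero {C : ℝ} {U : ℝ → E₃ → E₃} (hP : Pinned C U)
    (hz : ∀ t < 0, ∀ x, U t x = 0) : False := by
  have hN : U (-1) 0 2 ≠ 0 := hP.2.2.2.2.2.1
  have h0 : U (-1) 0 = 0 := hz (-1) (by norm_num) 0
  exact hN (by rw [h0]; rfl)

theorem fderiv_coord_apply' {a : E₃ → E₃} {x : E₃}
    (ha : DifferentiableAt ℝ a x) (i : Fin 3) (h : E₃) :
    fderiv ℝ (fun y => a y i) x h = fderiv ℝ a x h i := by
  have hc := ((EuclideanSpace.proj (𝕜 := ℝ) i).hasFDerivAt.comp x ha.hasFDerivAt).fderiv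
  rw [show (fun y => a y i) = (EuclideanSpace.proj (𝕜 := ℝ) i) ∘ a from rfl, hc]
  rfl

/-! ## §2 R — VERTICAL RIGIDITY (PROVED BY NAME): the poloidal-axis component alone detects non-triviality -/

theorem verticalRigidity {C : ℝ} {v : ℝ → E₃ → E₃}
    (hrate : HasTypeITimeDecay C v) (hcont : ContinuousOn (Function.uncurry v) (Set.Iio (0 : ℝ) ×ˢ Set.univ))
    (hmild : ∀ s t : ℝ, s < t → t < 0 → ∀ x, v t x = UnboundedOperators.heatExtension (v s) (t - s) x - oseenDuhamel 1 s v v t x)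
    (hdiv : ∀ t < 0, VectorCalculus.IsDivFree (v t)) {s : ℝ} (hs : s < 0)
    (hpol : ∀ y, ⟪curl (v s) y, EuclideanSpace.single 2 1⟫_ℝ = 0) (h2 : ∀ y, v s y 2 = 0) :
    ∀ t < 0, ∀ x, v t x = 0 := by
  have hA : AnalyticOnNhd ℝ (v s) Set.univ :=
    (PoloidalWindowDoorPoloidalWindowRigidityWindow.isTypeIAncientMild_of_class hrate hcont hmild hdiv).analyticOnNhd_slice_univ hs
  refine PoloidalWindowDoorPoloidalWindowRigiditySymmetryGerms.eq_zero_of_horizontalGradient_eq_zero_on_open hrate hcont hmild hdiv hs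
    hpol isOpen_univ Set.univ_nonempty fun y _ => ?_
  rw [← fderiv_coord_apply' ((hA y (Set.mem_univ y)).differentiableAt) 2]
  have hz : (fun y => v s y 2) = fun _ => (0 : ℝ) := funext h2
  rw [hz]
  simp

theorem vertical_nonvanishing {C : ℝ} {v : ℝ → E₃ → E₃}
    (hrate : HasTypeITimeDecay C v) (hcont : ContinuousOn (Function.uncurry v) (Set.Iio (0 : ℝ) ×ˢ Set.univ))
    (hmild : ∀ s t : ℝ, s < t → t < 0 → ∀ x, v t x = UnboundedOperators.heatExtension (v s) (t - s) x - oseenDuhamel 1 s v v t x)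
    (hdiv : ∀ t < 0, VectorCalculus.IsDivFree (v t))
    (hpol : ∀ s < 0, ∀ y, ⟪curl (v s) y, EuclideanSpace.single 2 1⟫_ℝ = 0) (hne : ¬ ∀ t < 0, ∀ x, v t x = 0) :
    ∀ s < 0, ∃ y, v s y 2 ≠ 0 := by
  intro s hs
  by_contra h
  push Not at h
  exact hne (verticalRigidity hrate hcont hmild hdiv hs (hpol s hs) h)

/-! ## §3 U3a — the ANISOTROPIC GAP (hand, M) and the PIN LOWER BOUND (PROVED from it) -/

/-- **U3a `AnisotropicGap` (PROVABLE, M — hand target).** For every Type-I constant `C` … -/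
def AnisotropicGap : Prop :=
  ∀ C : ℝ, ∃ δ : ℝ, 0 < δ ∧ ∀ v : ℝ → E₃ → E₃, IsTypeIAncientMild C v →
    (∀ s < 0, ∀ y, ⟪curl (v s) y, EuclideanSpace.single 2 1⟫_ℝ = 0) →
    (∀ t < 0, ∀ x, Real.sqrt (-t) * |v t x 2| ≤ δ) → ∀ t < 0, ∀ x, v t x = 0

/-- **stub U3a — LANDED (v1.1)**: p709185 ACCEPTED … -/
theorem stub_anisotropicGap : AnisotropicGap :=
  Summit.NavierStokesRegularity.NavierStokesRegularity.Theorems.PoloidalWindowDoorPoloidalWindowRigidityLeastPinAnisotropicGap.anisotropicGap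

theorem pin_lower_bound (hAG : AnisotropicGap) (C : ℝ) :
    ∃ δ : ℝ, 0 < δ ∧ ∀ v : ℝ → E₃ → E₃, Pinned C v → δ ≤ |v (-1) 0 2| := by
  obtain ⟨δ, hδ, hgap⟩ := hAG C
  refine ⟨δ, hδ, fun v hP => ?_⟩
  by_contra hlt
  have hlt' : |v (-1) 0 2| < δ := lt_of_not_ge hlt
  exact pinned_absurd_of_zero hP
    (hgap v (class_of_pinned hP) hP.2.2.2.2.1 (fun t ht x => (hP.2.2.2.2.2.2.1 t ht x).trans hlt'.le))

/-! ## §4 COMPACTNESS of the pinned–peakless class WITH its nondegeneracy (PROVED; the tree's `classCompactness` with … -/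

/-- **`PinnedCompact`**: a sequence of pinned peakless class-`C` profiles whose pin … -/
def PinnedCompact : Prop :=
  ∀ (C δ : ℝ) (vs : ℕ → ℝ → E₃ → E₃), 0 < δ →
    (∀ k, Pinned C (vs k)) → (∀ k, Peakless (vs k)) → (∀ k, δ ≤ |vs k (-1) 0 2|) →
      ∃ (φ : ℕ → ℕ) (U : ℝ → E₃ → E₃), StrictMono φ ∧ Pinned C U ∧ Peakless U ∧
        (∀ t < 0, TendstoLocallyUniformly (fun j => vs (φ j) t) (U t) Filter.atTop) ∧
        TendstoLocallyUniformly (fun j => curl (vs (φ j) (-1))) (curl (U (-1))) Filter.atTop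

theorem pinnedCompact : PinnedCompact := by
  intro C δ vs hδ hP hK hNδ
  have hw : ∀ k, IsTypeIAncientMild C (vs k) := fun k => class_of_pinned (hP k)
  obtain ⟨φ, hφ, W, hW, hpt, hfd, htlu, htlufd⟩ := exists_tendsto_of_isTypeIAncientMild_seq C hw
  have hrate : HasTypeITimeDecay C W := hW.2.2.2
  have hcont : ContinuousOn (Function.uncurry W) (Set.Iio (0 : ℝ) ×ˢ Set.univ) := hW.1.continuousOn
  have hmild : ∀ s t : ℝ, s < t → t < 0 → ∀ x, W t x =
      UnboundedOperators.heatExtension (W s) (t - s) x - oseenDuhamel 1 s W W t x :=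
    fun s t hst ht x => hW.mild_eq_heatExtension hst ht x
  have hdiv : ∀ t < 0, VectorCalculus.IsDivFree (W t) := hW.2.1
  have hpol : ∀ s < 0, ∀ y, ⟪curl (W s) y, EuclideanSpace.single 2 1⟫_ℝ = 0 :=
    fun s hs y => PoloidalWindowDoorPoloidalWindowRigidityPoloidalExtremal.poloidal_of_tendsto (hfd s hs y)
      (fun j => (hP (φ j)).2.2.2.2.1 s hs y)
  have hc2 : Continuous fun x : E₃ => x 2 := by fun_prop
  have hval : ∀ t < 0, ∀ x, Tendsto (fun j => vs (φ j) t x 2) atTop (𝓝 (W t x 2)) :=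
    fun t ht x => (hc2.tendsto _).comp (hpt t ht x)
  have hNabs : Tendsto (fun j => |vs (φ j) (-1) 0 2|) atTop (𝓝 |W (-1) 0 2|) :=
    (continuous_abs.tendsto _).comp (hval (-1) (by norm_num) 0)
  have hNge : δ ≤ |W (-1) 0 2| := ge_of_tendsto hNabs (Eventually.of_forall fun j => hNδ (φ j))
  have hne : W (-1) 0 2 ≠ 0 := by
    intro h0
    rw [h0, abs_zero] at hNge
    exact absurd hNge (not_le.2 hδ)
  have hhot : ∀ t < 0, ∀ x, Real.sqrt (-t) * |W t x 2| ≤ |W (-1) 0 2| := by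
    intro t ht x
    have hlim : Tendsto (fun j => Real.sqrt (-t) * |vs (φ j) t x 2|) atTop (𝓝 (Real.sqrt (-t) * |W t x 2|)) :=
      ((continuous_const.mul continuous_abs).tendsto _).comp (hval t ht x)
    exact le_of_tendsto_of_tendsto hlim hNabs (Eventually.of_forall fun j => (hP (φ j)).2.2.2.2.2.2.1 t ht x)
  have hPW : Pinned C W :=
    ⟨hrate, hcont, hmild, hdiv, hpol, hne, hhot,
      PoloidalWindowDoorLrcModEntireThreadPins.threadPin_of_hotSpot hrate hcont hmild hhot,
      PoloidalWindowDoorLrcModEntireThreadPins.threadSignedPin C W hrate hcont hmild hdiv hne hhot⟩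
  have hKW : Peakless W :=
    PoloidalWindowDoorPoloidalWindowRigidityHotHullCompactness.peaklessClosed (fun j => vs (φ j)) W (fun j => hK (φ j))
      (fun j t ht => PoloidalWindowDoorPoloidalWindowRigidityHotHullCompactness.continuous_slice_of_class
        (hP (φ j)).1 (hP (φ j)).2.1 (hP (φ j)).2.2.1 (hP (φ j)).2.2.2.1 ht)
      (fun t ht => PoloidalWindowDoorPoloidalWindowRigidityHotHullCompactness.continuous_slice_of_class hrate hcont hmild hdiv ht)
      (fun t ht => htlu t ht)
  have hcurl : TendstoLocallyUniformly (fun j => curl (vs (φ j) (-1))) (curl (W (-1))) atTop := by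
    have e1 : (fun j => curl (vs (φ j) (-1))) = fun j => curlCLM ∘ fderiv ℝ (vs (φ j) (-1)) := by
      funext j x; exact curl_eq_curlCLM _ _
    have e2 : curl (W (-1)) = curlCLM ∘ fderiv ℝ (W (-1)) := by
      funext x; exact curl_eq_curlCLM _ _
    rw [e1, e2]
    exact curlCLM.uniformContinuous.comp_tendstoLocallyUniformly (htlufd (-1) (by norm_num))
  exact ⟨φ, W, hφ, hPW, hKW, fun t ht => htlu t ht, hcurl⟩

/-! ## §5 LEAST-PIN profiles exist (PROVED from U3a) -/

/-- **Least pin.**  `v` has the least pin value among all pinned peakless class-`C` profiles. -/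
def LeastPin (C : ℝ) (v : ℝ → E₃ → E₃) : Prop :=
  ∀ v' : ℝ → E₃ → E₃, Pinned C v' → Peakless v' → |v (-1) 0 2| ≤ |v' (-1) 0 2|

theorem exists_leastPin (hAG : AnisotropicGap) {C : ℝ} {v₀ : ℝ → E₃ → E₃}
    (hP₀ : Pinned C v₀) (hK₀ : Peakless v₀) :
    ∃ U : ℝ → E₃ → E₃, Pinned C U ∧ Peakless U ∧ LeastPin C U := by
  obtain ⟨δ, hδ, hδle⟩ := pin_lower_bound hAG C
  set S : Set ℝ := {r | ∃ v' : ℝ → E₃ → E₃, Pinned C v' ∧ Peakless v' ∧ r = |v' (-1) 0 2|}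
    with hS
  have hSne : S.Nonempty := ⟨_, v₀, hP₀, hK₀, rfl⟩
  have hSδ : ∀ r ∈ S, δ ≤ r := by
    rintro r ⟨v', hP', -, rfl⟩
    exact hδle v' hP'
  have hSbdd : BddBelow S := ⟨δ, hSδ⟩
  set m : ℝ := sInf S with hm
  have hmle : ∀ r ∈ S, m ≤ r := fun r hr => csInf_le hSbdd hr
  have hkpos : ∀ k : ℕ, (0 : ℝ) < 1 / ((k : ℝ) + 1) := fun k => by positivity
  have hseq : ∀ k : ℕ, ∃ r ∈ S, r < m + 1 / ((k : ℝ) + 1) := fun k =>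
    exists_lt_of_csInf_lt hSne (by linarith [hkpos k])
  choose r hrS hrlt using hseq
  have hvs : ∀ k, ∃ v' : ℝ → E₃ → E₃, Pinned C v' ∧ Peakless v' ∧ r k = |v' (-1) 0 2| :=
    fun k => hrS k
  choose vs hPk hKk hrk using hvs
  obtain ⟨φ, U, hφ, hPU, hKU, hconv, -⟩ :=
    pinnedCompact C δ vs hδ hPk hKk (fun k => (hrk k) ▸ hSδ _ (hrS k))
  have hc2 : Continuous fun x : E₃ => x 2 := by fun_prop
  have hval : Tendsto (fun j => |vs (φ j) (-1) 0 2|) atTop (𝓝 |U (-1) 0 2|) :=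
    (continuous_abs.tendsto _).comp ((hc2.tendsto _).comp
      (((hconv (-1) (by norm_num)).tendstoLocallyUniformlyOn (s := Set.univ)).tendsto_at (Set.mem_univ 0)))
  have hup : ∀ j : ℕ, |vs (φ j) (-1) 0 2| ≤ m + 1 / ((j : ℝ) + 1) := by
    intro j
    rw [← hrk (φ j)]
    refine (hrlt (φ j)).le.trans ?_
    have hj : (j : ℝ) ≤ ((φ j : ℕ) : ℝ) := by exact_mod_cast hφ.id_le j
    have hj1 : (j : ℝ) + 1 ≤ ((φ j : ℕ) : ℝ) + 1 := by linarith
    have hjpos : (0 : ℝ) < (j : ℝ) + 1 := by positivity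
    have hdiv' : 1 / (((φ j : ℕ) : ℝ) + 1) ≤ 1 / ((j : ℝ) + 1) := one_div_le_one_div_of_le hjpos hj1
    linarith
  have hlow : ∀ j : ℕ, m ≤ |vs (φ j) (-1) 0 2| := by
    intro j
    rw [← hrk (φ j)]
    exact hmle _ (hrS _)
  have hlim1 : Tendsto (fun j : ℕ => m + 1 / ((j : ℝ) + 1)) atTop (𝓝 m) := by
    have h0 : Tendsto (fun j : ℕ => 1 / ((j : ℝ) + 1)) atTop (𝓝 0) := tendsto_one_div_add_atTop_nhds_zero_nat
    have h1 := h0.const_add m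
    simpa using h1
  have hNm : |U (-1) 0 2| = m :=
    le_antisymm (le_of_tendsto_of_tendsto hval hlim1 (Eventually.of_forall hup)) (ge_of_tendsto hval (Eventually.of_forall hlow))
  refine ⟨U, hPU, hKU, fun v' hP' hK' => ?_⟩
  rw [hNm]
  exact hmle _ ⟨v', hP', hK', rfl⟩

theorem leastPin_hot_translate {C : ℝ} {v : ℝ → E₃ → E₃} (hL : LeastPin C v)
    {y : E₃} (hy : y ∈ hotSet v) : LeastPin C (fun t x => v t (x + y)) := by
  intro v' hP' hK'
  have h : (fun t x => v t (x + y)) (-1) 0 2 = v (-1) 0 2 := by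
    show v (-1) (0 + y) 2 = v (-1) 0 2
    rw [zero_add]
    exact hy.2
  rw [h]
  exact hL v' hP' hK'

/-! ## §6 U3b — NO-PIN-LOSS for least-pin profiles (hand, M) -/

/-- **No pin loss.** Every class-`C`, e₂-poloidal, peakless profile `V ≢ 0` dominated … -/
def NoPinLoss (C : ℝ) (v : ℝ → E₃ → E₃) : Prop :=
  ∀ V : ℝ → E₃ → E₃, IsTypeIAncientMild C V →
    (∀ s < 0, ∀ y, ⟪curl (V s) y, EuclideanSpace.single 2 1⟫_ℝ = 0) → Peakless V →
    (∀ t < 0, ∀ x, Real.sqrt (-t) * |V t x 2| ≤ |v (-1) 0 2|) → (¬ ∀ t < 0, ∀ x, V t x = 0) →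
    ∀ η > 0, ∃ t < 0, ∃ x, |v (-1) 0 2| - η < Real.sqrt (-t) * |V t x 2|

/-- **stub U3b `NoPinLoss` for least-pin profiles — LANDED (v1.1)**: p709332 ACCEPTED 08:29:04Z … -/
theorem stub_noPinLoss : AnisotropicGap → ∀ (C : ℝ) (v : ℝ → E₃ → E₃),
    Pinned C v → Peakless v → LeastPin C v → NoPinLoss C v :=
  Summit.NavierStokesRegularity.NavierStokesRegularity.Theorems.PoloidalWindowDoorPoloidalWindowRigidityLeastPinNoPinLoss.noPinLoss

theorem noPinLoss_self {C : ℝ} {v : ℝ → E₃ → E₃} (hP : Pinned C v) :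
    ∀ η > 0, ∃ t < 0, ∃ x, |v (-1) 0 2| - η < Real.sqrt (-t) * |v t x 2| := by
  intro η hη
  refine ⟨-1, by norm_num, 0, ?_⟩
  have h1 : Real.sqrt (-(-1 : ℝ)) = 1 := by norm_num
  rw [h1, one_mul]
  linarith

/-! ## §7 THICKNESS of the least-pin profile at its pin, mod the (TH)-germ = S0 — hot_hull v1.7 H2, VERBATIM (S0 … -/

/-- **S0 ((TH) column's `stub_localTHEmptyHypNUGRS`), as a statement** — VERBATIM the … -/
def S0Statement : Prop :=
    ∀ (u : ℝ → E₃ → E₃) (μ A : ℝ → ℝ → ℝ)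
      (U : Set (ℝ × E₃)) (p₀ : ℝ × E₃),
      IsOpen U → p₀ ∈ U →
      AnalyticOnNhd ℝ (Function.uncurry u) U →
      (∀ p ∈ U, AnalyticAt ℝ (Function.uncurry μ) (p.1, p.2 2)) →
      (∀ p ∈ U, AnalyticAt ℝ (Function.uncurry A) (p.1, p.2 2)) →
      (∀ p ∈ U, fderiv ℝ (u p.1) p.2 (EuclideanSpace.single 0 1) 1 = fderiv ℝ (u p.1) p.2 (EuclideanSpace.single 1 1) 0) →
      (∀ p ∈ U, fderiv ℝ (u p.1) p.2 (EuclideanSpace.single 0 1) 0 + fderiv ℝ (u p.1) p.2 (EuclideanSpace.single 1 1) 1 +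
        fderiv ℝ (u p.1) p.2 (EuclideanSpace.single 2 1) 2 = 0) →
      (∀ p ∈ U, ∀ b : Fin 3, b ≠ 2 →
        fderiv ℝ (u p.1) p.2 (EuclideanSpace.single 2 1) b =
          μ p.1 (p.2 2) * fderiv ℝ (u p.1) p.2 (EuclideanSpace.single b 1) 2) →
      (∀ p ∈ U,
        (1 - μ p.1 (p.2 2)) *
            (deriv (fun s => u s p.2 2) p.1 + fderiv ℝ (fun y => u p.1 y 2) p.2 (u p.1 p.2)
              - Δ (fun y => u p.1 y 2) p.2) =
          A p.1 (p.2 2) + (deriv (fun s => μ s (p.2 2)) p.1 - deriv (deriv (μ p.1)) (p.2 2)) * u p.1 p.2 2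
            + deriv (μ p.1) (p.2 2) / 2 * u p.1 p.2 2 ^ 2
            - 2 * deriv (μ p.1) (p.2 2) * fderiv ℝ (u p.1) p.2 (EuclideanSpace.single 2 1) 2) →
      fderiv ℝ (fun y => fderiv ℝ (u p₀.1) y (EuclideanSpace.single 2 1) 2) p₀.2 (EuclideanSpace.single 0 1) *
            fderiv ℝ (u p₀.1) p₀.2 (EuclideanSpace.single 1 1) 2 -
          fderiv ℝ (fun y => fderiv ℝ (u p₀.1) y (EuclideanSpace.single 2 1) 2) p₀.2 (EuclideanSpace.single 1 1) *
            fderiv ℝ (u p₀.1) p₀.2 (EuclideanSpace.single 0 1) 2 ≠ 0 →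
      μ p₀.1 (p₀.2 2) ≠ 0 → μ p₀.1 (p₀.2 2) ≠ 1 → deriv (μ p₀.1) (p₀.2 2) ≠ 0 →
      μ p₀.1 (p₀.2 2) < 0 →
      (fderiv ℝ (u p₀.1) p₀.2 (EuclideanSpace.single 0 1) 0 ≠ fderiv ℝ (u p₀.1) p₀.2 (EuclideanSpace.single 1 1) 1 ∨
        fderiv ℝ (u p₀.1) p₀.2 (EuclideanSpace.single 1 1) 0 ≠ 0) →
      u p₀.1 p₀.2 = 0 →
      fderiv ℝ (u p₀.1) p₀.2 (EuclideanSpace.single 0 1) 2 = 0 →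
      fderiv ℝ (u p₀.1) p₀.2 (EuclideanSpace.single 1 1) 2 = 1 → False

/-- **The (TH)-germ statement** — VERBATIM hot_hull v1.7 `THGerm` (the conclusion of … -/
def THGerm : Prop :=
  ∀ (C : ℝ) (v : ℝ → E₃ → E₃),
    Literature.Analysis.FluidPDE.HasTypeITimeDecay C v →
    ContinuousOn (Function.uncurry v) (Set.Iio (0 : ℝ) ×ˢ Set.univ) →
    (∀ s t : ℝ, s < t → t < 0 → ∀ x, v t x =
      Literature.Analysis.UnboundedOperators.heatExtension (v s) (t - s) x -
        Literature.Analysis.FluidPDE.oseenDuhamel 1 s v v t x) →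
    (∀ t < 0, Literature.Analysis.FluidPDE.VectorCalculus.IsDivFree (v t)) →
    (∀ s < 0, ∀ y, ⟪Literature.Analysis.FluidPDE.curl (v s) y, EuclideanSpace.single 2 1⟫_ℝ = 0) →
    ∀ W : Set (ℝ × E₃), IsOpen W → W.Nonempty → W ⊆ Set.Iio (0 : ℝ) ×ˢ Set.univ →
      (∀ z ∈ W, (Literature.Analysis.FluidPDE.curl (v z.1) z.2 ≠ 0 ∧
          (fderiv ℝ (v z.1) z.2 (EuclideanSpace.single 0 1) 2 ≠ 0 ∨ fderiv ℝ (v z.1) z.2 (EuclideanSpace.single 1 1) 2 ≠ 0) ∧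
          (fderiv ℝ (v z.1) z.2 (EuclideanSpace.single 2 1) 0 ≠ 0 ∨ fderiv ℝ (v z.1) z.2 (EuclideanSpace.single 2 1) 1 ≠ 0))) →
      (∀ m : ℝ → ℝ, ∀ W₁ : Set (ℝ × E₃), W₁ ⊆ W → IsOpen W₁ → W₁.Nonempty →
          ∃ z ∈ W₁, ∃ b : Fin 3, b ≠ 2 ∧
            fderiv ℝ (v z.1) z.2 (EuclideanSpace.single 2 1) b ≠
              m z.1 * fderiv ℝ (v z.1) z.2 (EuclideanSpace.single b 1) 2) →
      (∀ z ∈ W, (fderiv ℝ (fun x => fderiv ℝ (v z.1) x (EuclideanSpace.single 2 1) 2) z.2 (EuclideanSpace.single 0 1) *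
              fderiv ℝ (v z.1) z.2 (EuclideanSpace.single 1 1) 2 -
            fderiv ℝ (fun x => fderiv ℝ (v z.1) x (EuclideanSpace.single 2 1) 2) z.2 (EuclideanSpace.single 1 1) *
              fderiv ℝ (v z.1) z.2 (EuclideanSpace.single 0 1) 2 ≠ 0)) →
      (∃ m : ℝ → ℝ → ℝ, ∀ z ∈ W, ∀ b : Fin 3, b ≠ 2 →
          fderiv ℝ (v z.1) z.2 (EuclideanSpace.single 2 1) b =
            m z.1 (z.2 2) * fderiv ℝ (v z.1) z.2 (EuclideanSpace.single b 1) 2) →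
      ∃ s : ℝ, s < 0 ∧ ∃ U : Set (E₃), IsOpen U ∧ U.Nonempty ∧
        ((∃ e : E₃, e ≠ 0 ∧
            ∀ y ∈ U, fderiv ℝ (Literature.Analysis.FluidPDE.curl (v s)) y e = 0) ∨
         (∃ c : E₃, ∀ y ∈ U,
            Literature.Analysis.FluidPDE.rotGen (Literature.Analysis.FluidPDE.curl (v s) y) =
              fderiv ℝ (Literature.Analysis.FluidPDE.curl (v s)) y (Literature.Analysis.FluidPDE.rotGen (y - c))) ∨
         (∃ w : E₃ → E₃, AnalyticOnNhd ℝ w Set.univ ∧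
            ¬ BddAbove (Set.range fun y => ‖w y‖) ∧ ∀ y ∈ U, v s y = w y))

theorem thGerm_of_S0 (hS0 : S0Statement) : THGerm :=
  PoloidalWindowDoorLrcModEntireTwistingTHLocalHypGerm.stub_twistingTH_of_localEmptyHyp
    (PoloidalWindowDoorLrcModEntireTwistingTHLocalNonUmbilic.localTHEmptyHyp_of_localTHEmptyHypNonUmbilic
      (PoloidalWindowDoorLrcModEntireTwistingTHLocalGalilean.localTHEmptyHypNonUmbilic_of_galilean
        (PoloidalWindowDoorLrcModEntireTwistingTHLocalNormalFormRS.localTHEmptyHypNF_of_normalFormRS hS0)))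

/-- **H2 `ThickDense`**: given the (TH)-germ statement, EVERY space-time point `z₀` … -/
def ThickDense : Prop :=
  THGerm → ∀ (C : ℝ) (v : ℝ → E₃ → E₃), Pinned C v →
    ∀ z₀ : ℝ × E₃, z₀.1 < 0 → ∃ W : Set (ℝ × E₃), ThickWindowAt v W z₀

theorem thickDense_holds : ThickDense := by
  intro hTH C v hP z₀ hz₀
  obtain ⟨hrate, hcont, hmild, hdiv, hpol, hne, -, -, -⟩ := hP
  have habs : ¬ (∀ t < 0, ∀ x, v t x = 0) := fun h0 => hne (by rw [h0 (-1) (by norm_num) 0]; rfl)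
  have hgermAbs : ∀ W : Set (ℝ × E₃), W.Nonempty → W ⊆ Set.Iio (0 : ℝ) ×ˢ Set.univ →
      (∀ z ∈ W, Literature.Analysis.FluidPDE.curl (v z.1) z.2 ≠ 0 ∧
          (fderiv ℝ (v z.1) z.2 (EuclideanSpace.single 0 1) 2 ≠ 0 ∨ fderiv ℝ (v z.1) z.2 (EuclideanSpace.single 1 1) 2 ≠ 0) ∧
          (fderiv ℝ (v z.1) z.2 (EuclideanSpace.single 2 1) 0 ≠ 0 ∨ fderiv ℝ (v z.1) z.2 (EuclideanSpace.single 2 1) 1 ≠ 0)) →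
      (∃ s : ℝ, s < 0 ∧ ∃ U : Set (E₃), IsOpen U ∧ U.Nonempty ∧
        ((∃ e : E₃, e ≠ 0 ∧
            ∀ y ∈ U, fderiv ℝ (Literature.Analysis.FluidPDE.curl (v s)) y e = 0) ∨
         (∃ c : E₃, ∀ y ∈ U,
            Literature.Analysis.FluidPDE.rotGen (Literature.Analysis.FluidPDE.curl (v s) y) =
              fderiv ℝ (Literature.Analysis.FluidPDE.curl (v s)) y (Literature.Analysis.FluidPDE.rotGen (y - c))) ∨
         (∃ w : E₃ → E₃, AnalyticOnNhd ℝ w Set.univ ∧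
            ¬ BddAbove (Set.range fun y => ‖w y‖) ∧ ∀ y ∈ U, v s y = w y))) → False := by
    intro W hWne hWs hnd hgerm
    obtain ⟨z₁, hz₁⟩ := hWne
    obtain ⟨s, hs', U, hU, hUne, hg⟩ := hgerm
    exact PoloidalWindowDoorLrcModEntireIff.false_of_germ_of_nondegenerate hrate hcont hmild hdiv hpol
      (Set.mem_prod.1 (hWs hz₁)).1 (hnd z₁ hz₁).1 hs' hU hUne hg
  rcases PoloidalWindowDoorLrcModEntireThreadDichotomy.threadDichotomy C v hrate hcont hmild hdiv hpol z₀ hz₀ with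
    ⟨W, hW, hWs, hndtw, hthick, hacc⟩ | ⟨W, hW, hWne, hWs, hnd, htw0⟩ | ⟨W, hW, hWne, hWs, hnd, hpin', htw, hTH'⟩ |
    ⟨W, hW, hWne, hWs, m, hm⟩ | ⟨s, hs', U, hU, hUne, hdeg⟩
  · exact ⟨W, hW, hWs, hndtw, hthick, hacc⟩
  · exact (hgermAbs W hWne hWs hnd (PoloidalWindowDoorLrcModEntireUntwistedGerm.stub_untwistedGerm C v hrate hcont hmild hdiv hpol
      W hW hWne hWs hnd htw0)).elim
  · exact (hgermAbs W hWne hWs hnd (hTH C v hrate hcont hmild hdiv hpol W hW hWne hWs hnd hpin' htw hTH')).elim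
  · exact (habs (PoloidalWindowDoorLrcModEntireFarThreadReduction.eq_zero_of_local_timeOnlySlope hrate hcont hmild hdiv hpol
      hW hWne hWs hm)).elim
  · rcases hdeg with hcurl | hflat | hrig
    · exact (habs (PoloidalWindowDoorPoloidalWindowRigiditySymmetryGerms.eq_zero_of_curl_eq_zero_on_open hrate hcont hmild hdiv
        hs' hU hUne hcurl)).elim
    · exact (habs (PoloidalWindowDoorPoloidalWindowRigiditySymmetryGerms.eq_zero_of_horizontalGradient_eq_zero_on_open hrate hcont hmild hdiv
        hs' (hpol s hs') hU hUne fun y hy => (hflat y hy).1)).elim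
    · exact (habs (PoloidalWindowDoorPoloidalWindowRigidityVerticalShearGerm.eq_zero_of_verticalShear_eq_zero_on_open hrate hcont hmild hdiv
        hs' hU hUne hrig)).elim

theorem thickWindow_of_dense (hTD : ThickDense) (hTH : THGerm) {C : ℝ} {v : ℝ → E₃ → E₃}
    (hP : Pinned C v) : ∃ W : Set (ℝ × E₃), ThickWindow v W :=
  hTD hTH C v hP ((-1 : ℝ), (0 : E₃)) (by show (-1 : ℝ) < 0; norm_num)

/-! ## §8 The research cell LEAST-PIN (OPEN): HL3′'s binders + least pin + no-pin-loss + the gap as data -/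

/-- **Research cell LEAST-PIN (OPEN).** Kill a pinned, thick, peakless class-`C` … -/
def CellLeastPin : Prop :=
  AnisotropicGap →
  ∀ (C : ℝ) (v : ℝ → E₃ → E₃) (W : Set (ℝ × E₃)),
    Pinned C v → ThickWindow v W → Peakless v → LeastPin C v → NoPinLoss C v → False

/-! ## §9 Kernel (checked, no sorry): HL3′ ⇐ U3a ∧ U3b ∧ THGerm ∧ LEAST-PIN -/

/-- **HL3′** — VERBATIM the statement of hot_loops v4.3 `stub_peaklessEmpty` = hot_hull … -/
def HL3' : Prop :=
    ∀ (C : ℝ) (v : ℝ → E₃ → E₃),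
      Literature.Analysis.FluidPDE.HasTypeITimeDecay C v →
      ContinuousOn (Function.uncurry v) (Set.Iio (0 : ℝ) ×ˢ Set.univ) →
      (∀ s t : ℝ, s < t → t < 0 → ∀ x, v t x =
        Literature.Analysis.UnboundedOperators.heatExtension (v s) (t - s) x -
          Literature.Analysis.FluidPDE.oseenDuhamel 1 s v v t x) →
      (∀ t < 0, Literature.Analysis.FluidPDE.VectorCalculus.IsDivFree (v t)) →
      (∀ s < 0, ∀ y, ⟪Literature.Analysis.FluidPDE.curl (v s) y, EuclideanSpace.single 2 1⟫_ℝ = 0) →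
      v (-1) 0 2 ≠ 0 → (∀ t < 0, ∀ x, Real.sqrt (-t) * |v t x 2| ≤ |v (-1) 0 2|) →
      (∀ h : E₃, fderiv ℝ (v (-1)) 0 h 2 = 0) →
      (deriv (fun s => v s 0 2) (-1) = v (-1) 0 2 / 2 ∧ v (-1) 0 2 * (Δ (fun y => v (-1) y 2)) 0 ≤ 0) →
      ∀ W : Set (ℝ × E₃), IsOpen W → W ⊆ Set.Iio (0 : ℝ) ×ˢ Set.univ →
        (∀ z ∈ W, (Literature.Analysis.FluidPDE.curl (v z.1) z.2 ≠ 0 ∧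
            (fderiv ℝ (v z.1) z.2 (EuclideanSpace.single 0 1) 2 ≠ 0 ∨ fderiv ℝ (v z.1) z.2 (EuclideanSpace.single 1 1) 2 ≠ 0) ∧
            (fderiv ℝ (v z.1) z.2 (EuclideanSpace.single 2 1) 0 ≠ 0 ∨ fderiv ℝ (v z.1) z.2 (EuclideanSpace.single 2 1) 1 ≠ 0)) ∧
          (fderiv ℝ (fun x => fderiv ℝ (v z.1) x (EuclideanSpace.single 2 1) 2) z.2 (EuclideanSpace.single 0 1) *
                fderiv ℝ (v z.1) z.2 (EuclideanSpace.single 1 1) 2 -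
              fderiv ℝ (fun x => fderiv ℝ (v z.1) x (EuclideanSpace.single 2 1) 2) z.2 (EuclideanSpace.single 1 1) *
                fderiv ℝ (v z.1) z.2 (EuclideanSpace.single 0 1) 2 ≠ 0)) →
        (∀ m : ℝ → ℝ → ℝ, ∀ W₁ : Set (ℝ × E₃), W₁ ⊆ W → IsOpen W₁ → W₁.Nonempty →
            ∃ z ∈ W₁, ∃ b : Fin 3, b ≠ 2 ∧
              fderiv ℝ (v z.1) z.2 (EuclideanSpace.single 2 1) b ≠
                m z.1 (z.2 2) * fderiv ℝ (v z.1) z.2 (EuclideanSpace.single b 1) 2) →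
        (∀ r : ℝ, 0 < r → (Metric.ball ((-1 : ℝ), (0 : E₃)) r ∩ W).Nonempty) →
        (∀ (s z₀ σ M : ℝ) (K O : Set (E₃)), s < 0 →
          ((σ = 1 ∨ σ = -1) ∧ IsCompact K ∧ K.Nonempty ∧ (∀ y ∈ K, y 2 = z₀ ∧ σ * v s y 2 = M) ∧
            IsOpen O ∧ K ⊆ O ∧ (∀ y ∈ O, y 2 = z₀ → σ * v s y 2 ≤ M) ∧
            (∀ y ∈ O, y 2 = z₀ → σ * v s y 2 = M → y ∈ K)) → False) →
        False

theorem hl3_of_leastPin (hAG : AnisotropicGap)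
    (hNPL : ∀ (C : ℝ) (v : ℝ → E₃ → E₃), Pinned C v → Peakless v → LeastPin C v → NoPinLoss C v)
    (hTH : THGerm) (hcell : CellLeastPin) : HL3' := by
  intro C v hrate hcont hmild hdiv hpol hne hext hgrad hpins W hWo hWs hnd hsl hacc hpeak
  have hP : Pinned C v := ⟨hrate, hcont, hmild, hdiv, hpol, hne, hext, hgrad, hpins⟩
  have hK : Peakless v := hpeak
  obtain ⟨U, hPU, hKU, hLU⟩ := exists_leastPin hAG hP hK
  obtain ⟨W', hW'⟩ := thickWindow_of_dense thickDense_holds hTH hPU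
  exact hcell hAG C U W' hPU hW' hKU hLU (hNPL C U hPU hKU hLU)

theorem hl3_of_stubs (hTH : THGerm) (hcell : CellLeastPin) : HL3' :=
  hl3_of_leastPin stub_anisotropicGap (stub_noPinLoss stub_anisotropicGap) hTH hcell

/-! ## §10 Compositions to the crux items BY NAME (CONDITIONAL on S0, the wall ⟨27893⟩, U3a, U3b and the cell; no … -/

theorem PoloidalWindowRigidity_of_leastPin (hS0 : S0Statement)
    (hG : Summit.NavierStokesRegularity.NavierStokesRegularity.Theses.LoopPeriodRatchet.FrequencyGrowthExponent)
    (hAG : AnisotropicGap)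
    (hNPL : ∀ (C : ℝ) (v : ℝ → E₃ → E₃), Pinned C v → Peakless v → LeastPin C v → NoPinLoss C v)
    (hcell : CellLeastPin) :
    Summit.NavierStokesRegularity.NavierStokesRegularity.Theses.PoloidalWindowDoor.PoloidalWindowRigidity :=
  PoloidalWindowDoorPoloidalWindowRigidityHotLoopsReduction.poloidalWindowRigidity_of_NUGRS_of_growth_of_peakless hS0 hG
    (hl3_of_leastPin hAG hNPL (thGerm_of_S0 hS0) hcell)

theorem LrcModEntire_of_leastPin (hS0 : S0Statement)
    (hG : Summit.NavierStokesRegularity.NavierStokesRegularity.Theses.LoopPeriodRatchet.FrequencyGrowthExponent)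
    (hAG : AnisotropicGap)
    (hNPL : ∀ (C : ℝ) (v : ℝ → E₃ → E₃), Pinned C v → Peakless v → LeastPin C v → NoPinLoss C v)
    (hcell : CellLeastPin) :
    Summit.NavierStokesRegularity.NavierStokesRegularity.Theses.PoloidalWindowDoor.LrcModEntire :=
  PoloidalWindowDoorPoloidalWindowRigidityHotLoopsReduction.lrcModEntire_of_NUGRS_of_growth_of_peakless hS0 hG
    (hl3_of_leastPin hAG hNPL (thGerm_of_S0 hS0) hcell)

theorem PoloidalWindowRigidity_of_stubs (hS0 : S0Statement)
    (hG : Summit.NavierStokesRegularity.NavierStokesRegularity.Theses.LoopPeriodRatchet.FrequencyGrowthExponent) (hcell : CellLeastPin) :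
    Summit.NavierStokesRegularity.NavierStokesRegularity.Theses.PoloidalWindowDoor.PoloidalWindowRigidity :=
  PoloidalWindowRigidity_of_leastPin hS0 hG stub_anisotropicGap (stub_noPinLoss stub_anisotropicGap) hcell

theorem LrcModEntire_of_stubs (hS0 : S0Statement)
    (hG : Summit.NavierStokesRegularity.NavierStokesRegularity.Theses.LoopPeriodRatchet.FrequencyGrowthExponent) (hcell : CellLeastPin) :
    Summit.NavierStokesRegularity.NavierStokesRegularity.Theses.PoloidalWindowDoor.LrcModEntire :=
  LrcModEntire_of_leastPin hS0 hG stub_anisotropicGap (stub_noPinLoss stub_anisotropicGap) hcell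

/-! ## §11 LINE 25 — THE TIME-SHIFT LEVER (PROVED): forward time shifts stay in the class and CONTRACT the … -/

theorem isTypeIAncientMild_timeShift {C : ℝ} {V : ℝ → E₃ → E₃} (h : IsTypeIAncientMild C V)
    {s₁ : ℝ} (hs₁ : s₁ ≤ 0) : IsTypeIAncientMild C (fun t => V (t + s₁)) := by
  have hC0 : 0 ≤ C := h.nonneg
  refine ⟨?_, fun t ht => h.2.1 (t + s₁) (by linarith), fun s t hst ht x => ?_, fun t ht x => ?_⟩
  · have hφ : ContDiff ℝ ((⊤ : ℕ∞) : WithTop ℕ∞) (fun p : ℝ × E₃ => (p.1 + s₁, p.2)) := by fun_prop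
    have hmaps : Set.MapsTo (fun p : ℝ × E₃ => (p.1 + s₁, p.2)) (Set.Iio (0 : ℝ) ×ˢ Set.univ)
        (Set.Iio (0 : ℝ) ×ˢ Set.univ) := by
      intro p hp
      have h1 : p.1 < 0 := (Set.mem_prod.1 hp).1
      exact Set.mk_mem_prod (show p.1 + s₁ < 0 by linarith) (Set.mem_univ _)
    exact (h.1.comp hφ.contDiffOn hmaps).congr fun p _ => rfl
  · have hm := h.2.2.1 (s + s₁) (t + s₁) (by linarith) (by linarith) x
    rw [oseenDuhamel_translate 1 s s₁ V V t x]
    simpa only [add_sub_add_right_eq_sub] using hm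
  · have hts : t + s₁ < 0 := by linarith
    refine (h.2.2.2 (t + s₁) hts x).trans ?_
    exact div_le_div_of_nonneg_left hC0 (Real.sqrt_pos.2 (neg_pos.2 ht)) (Real.sqrt_le_sqrt (by linarith))

theorem pastPin {C : ℝ} {v : ℝ → E₃ → E₃} (hN : v (-1) 0 2 ≠ 0) (hNPL : NoPinLoss C v)
    {V : ℝ → E₃ → E₃} (hV : IsTypeIAncientMild C V)
    (hpol : ∀ s < 0, ∀ y, ⟪curl (V s) y, EuclideanSpace.single 2 1⟫_ℝ = 0) (hK : Peakless V)
    (hdom : ∀ t < 0, ∀ x, Real.sqrt (-t) * |V t x 2| ≤ |v (-1) 0 2|) (hnz : ¬ ∀ t < 0, ∀ x, V t x = 0) :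
    ∀ η > 0, ∀ T < 0, ∃ s < T, ∃ x, |v (-1) 0 2| - η < Real.sqrt (-s) * |V s x 2| := by
  intro η hη T hT
  have hm0 : 0 < |v (-1) 0 2| := abs_pos.2 hN
  push Not at hnz
  obtain ⟨t₀, ht₀, x₀, hx₀⟩ := hnz
  have hs₁0 : t₀ / 2 < 0 := by linarith
  have hV'c : IsTypeIAncientMild C (fun t => V (t + t₀ / 2)) := isTypeIAncientMild_timeShift hV hs₁0.le
  have hpol' : ∀ s < 0, ∀ y, ⟪curl ((fun t => V (t + t₀ / 2)) s) y, EuclideanSpace.single 2 1⟫_ℝ = 0 :=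
    fun s hs y => hpol (s + t₀ / 2) (by linarith) y
  have hK' : Peakless (fun t => V (t + t₀ / 2)) :=
    fun s z₀ σ M K O hs hcfg => hK (s + t₀ / 2) z₀ σ M K O (by linarith) hcfg
  have hdom' : ∀ t < 0, ∀ x, Real.sqrt (-t) * |(fun t => V (t + t₀ / 2)) t x 2| ≤ |v (-1) 0 2| := by
    intro t ht x
    have hts : t + t₀ / 2 < 0 := by linarith
    have h1 := hdom (t + t₀ / 2) hts x
    have h2 : Real.sqrt (-t) ≤ Real.sqrt (-(t + t₀ / 2)) := Real.sqrt_le_sqrt (by linarith)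
    calc Real.sqrt (-t) * |(fun t => V (t + t₀ / 2)) t x 2| = Real.sqrt (-t) * |V (t + t₀ / 2) x 2| := rfl
      _ ≤ Real.sqrt (-(t + t₀ / 2)) * |V (t + t₀ / 2) x 2| := mul_le_mul_of_nonneg_right h2 (abs_nonneg _)
      _ ≤ |v (-1) 0 2| := h1
  have hnz' : ¬ ∀ t < 0, ∀ x, (fun t => V (t + t₀ / 2)) t x = 0 := by
    intro h0
    have h1 : V (t₀ - t₀ / 2 + t₀ / 2) x₀ = 0 := h0 (t₀ - t₀ / 2) (by linarith) x₀
    rw [sub_add_cancel] at h1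
    exact hx₀ h1
  have hq : 0 < |v (-1) 0 2| * (-(t₀ / 2)) / (2 * (-T)) := div_pos (mul_pos hm0 (by linarith)) (by linarith)
  set η' : ℝ := min η (min (|v (-1) 0 2| / 2) (|v (-1) 0 2| * (-(t₀ / 2)) / (2 * (-T)))) with hη'
  have hη'0 : 0 < η' := lt_min hη (lt_min (by linarith) hq)
  have hη'η : η' ≤ η := min_le_left _ _
  have hη'm : η' ≤ |v (-1) 0 2| / 2 := (min_le_right _ _).trans (min_le_left _ _)
  have hη'T : η' ≤ |v (-1) 0 2| * (-(t₀ / 2)) / (2 * (-T)) := (min_le_right _ _).trans (min_le_right _ _)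
  obtain ⟨t, ht, x, hx⟩ := hNPL (fun t => V (t + t₀ / 2)) hV'c hpol' hK' hdom' hnz' η' hη'0
  have hx' : |v (-1) 0 2| - η' < Real.sqrt (-t) * |V (t + t₀ / 2) x 2| := hx
  have hts : t + t₀ / 2 < 0 := by linarith
  refine ⟨t + t₀ / 2, ?_, x, ?_⟩
  · -- the time estimate
    have hd := hdom (t + t₀ / 2) hts x
    have hsq_t : 0 ≤ Real.sqrt (-t) := Real.sqrt_nonneg _
    have hsq_s : 0 < Real.sqrt (-(t + t₀ / 2)) := Real.sqrt_pos.2 (by linarith)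
    have key : (|v (-1) 0 2| - η') * Real.sqrt (-(t + t₀ / 2)) < |v (-1) 0 2| * Real.sqrt (-t) := by
      have h1 : (|v (-1) 0 2| - η') * Real.sqrt (-(t + t₀ / 2)) <
          Real.sqrt (-t) * |V (t + t₀ / 2) x 2| * Real.sqrt (-(t + t₀ / 2)) :=
        mul_lt_mul_of_pos_right hx' hsq_s
      have h2 : Real.sqrt (-t) * |V (t + t₀ / 2) x 2| * Real.sqrt (-(t + t₀ / 2)) ≤ Real.sqrt (-t) * |v (-1) 0 2| := by
        rw [mul_assoc, mul_comm (|V (t + t₀ / 2) x 2|)]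
        exact mul_le_mul_of_nonneg_left hd hsq_t
      linarith
    have hpos : 0 ≤ (|v (-1) 0 2| - η') * Real.sqrt (-(t + t₀ / 2)) := mul_nonneg (by linarith) hsq_s.le
    have key2 := mul_self_lt_mul_self hpos key
    have e1 : Real.sqrt (-(t + t₀ / 2)) * Real.sqrt (-(t + t₀ / 2)) = -(t + t₀ / 2) := Real.mul_self_sqrt (by linarith)
    have e2 : Real.sqrt (-t) * Real.sqrt (-t) = -t := Real.mul_self_sqrt (by linarith)
    have key3 : (|v (-1) 0 2| - η') ^ 2 * (-(t + t₀ / 2)) < |v (-1) 0 2| ^ 2 * (-t) := by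
      have e3 : (|v (-1) 0 2| - η') * Real.sqrt (-(t + t₀ / 2)) * ((|v (-1) 0 2| - η') * Real.sqrt (-(t + t₀ / 2))) =
          (|v (-1) 0 2| - η') ^ 2 * (Real.sqrt (-(t + t₀ / 2)) * Real.sqrt (-(t + t₀ / 2))) := by ring
      have e4 : |v (-1) 0 2| * Real.sqrt (-t) * (|v (-1) 0 2| * Real.sqrt (-t)) =
          |v (-1) 0 2| ^ 2 * (Real.sqrt (-t) * Real.sqrt (-t)) := by ring
      rw [e3, e4, e1, e2] at key2
      exact key2
    have hX : 0 < -(t + t₀ / 2) := by linarith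
    have k4 : |v (-1) 0 2| ^ 2 * (-(t₀ / 2)) < 2 * |v (-1) 0 2| * η' * (-(t + t₀ / 2)) := by
      nlinarith [key3, mul_nonneg (sq_nonneg η') hX.le]
    have hT' : η' * (2 * (-T)) ≤ |v (-1) 0 2| * (-(t₀ / 2)) := (le_div_iff₀ (by linarith)).1 hη'T
    have k5 : 2 * |v (-1) 0 2| * η' * (-T) ≤ |v (-1) 0 2| ^ 2 * (-(t₀ / 2)) := by nlinarith [hT', hm0]
    have k6 : 2 * |v (-1) 0 2| * η' * (-T) < 2 * |v (-1) 0 2| * η' * (-(t + t₀ / 2)) := lt_of_le_of_lt k5 k4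
    have hmη : 0 < 2 * |v (-1) 0 2| * η' := mul_pos (mul_pos two_pos hm0) hη'0
    have k7 : -T < -(t + t₀ / 2) := lt_of_mul_lt_mul_left k6 hmη.le
    linarith
  · have h2 : Real.sqrt (-t) ≤ Real.sqrt (-(t + t₀ / 2)) := Real.sqrt_le_sqrt (by linarith)
    calc |v (-1) 0 2| - η ≤ |v (-1) 0 2| - η' := by linarith
      _ < Real.sqrt (-t) * |V (t + t₀ / 2) x 2| := hx'
      _ ≤ Real.sqrt (-(t + t₀ / 2)) * |V (t + t₀ / 2) x 2| := mul_le_mul_of_nonneg_right h2 (abs_nonneg _)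

theorem pastPin_self {C : ℝ} {v : ℝ → E₃ → E₃} (hP : Pinned C v) (hK : Peakless v) (hNPL : NoPinLoss C v) :
    ∀ η > 0, ∀ T < 0, ∃ s < T, ∃ x, |v (-1) 0 2| - η < Real.sqrt (-s) * |v s x 2| :=
  pastPin hP.2.2.2.2.2.1 hNPL (class_of_pinned hP) hP.2.2.2.2.1 hK hP.2.2.2.2.2.2.1 (fun hz => pinned_absurd_of_zero hP hz)

/-! ## §12 ETERNAL PIN IN SCALE WINDOWS (PROVED from U3b + U2b + compactness): every far-past scale window of bounded … -/

/-- **EternalCore ε₀ R₀ T₀ U** — VERBATIM LINE 23 `eternal_core`: every backward scale … -/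
def EternalCore (ε₀ R₀ T₀ : ℝ) (U : ℝ → E₃ → E₃) : Prop :=
  ∀ t₀ : ℝ, t₀ < T₀ → ∃ r ∈ Set.Icc (4 * t₀) t₀, ∃ y : E₃,
    ‖y‖ ≤ R₀ * Real.sqrt (-r) ∧ ε₀ ≤ Real.sqrt (-r) * ‖U r y‖

/-- **U2b `ParaboloidGap`** — VERBATIM LINE 23 `eternal_core` (LANDED: p707892 … -/
def ParaboloidGap : Prop :=
  ∀ C : ℝ, ∃ ε₁ : ℝ, 0 < ε₁ ∧ ∀ ε : ℝ, 0 < ε → ε ≤ ε₁ → ∃ R₁ : ℝ, 0 < R₁ ∧ ∀ R : ℝ, R₁ ≤ R →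
    ∀ (U : ℝ → E₃ → E₃), IsTypeIAncientMild C U → ∀ t₀ : ℝ, t₀ < 0 →
      (∀ r ∈ Set.Icc (4 * t₀) t₀, ∀ y : E₃, ‖y‖ ≤ R * Real.sqrt (-r) → Real.sqrt (-r) * ‖U r y‖ ≤ ε) →
      ∀ s : ℝ, t₀ ≤ s → s < 0 → ∀ x : E₃, ‖x‖ ≤ R / 4 * Real.sqrt (-s) →
        Real.sqrt (-s) * ‖U s x‖ ≤ 2 * ε

theorem paraboloidGap : ParaboloidGap :=
  Summit.NavierStokesRegularity.NavierStokesRegularity.Theorems.PoloidalWindowDoorPoloidalWindowRigidityEternalCoreParaboloidGap.paraboloidGap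

theorem absN_le_norm (U : ℝ → E₃ → E₃) : |U (-1) 0 2| ≤ ‖U (-1) 0‖ := by
  have h := EuclideanSpace.norm_eq (U (-1) 0)
  have h2 : |U (-1) 0 2| ^ 2 ≤ ∑ i, |U (-1) 0 i| ^ 2 :=
    Finset.single_le_sum (f := fun i => |U (-1) 0 i| ^ 2) (fun i _ => by positivity) (Finset.mem_univ (2 : Fin 3))
  rw [h]
  have h4 : Real.sqrt (|U (-1) 0 2| ^ 2) = |U (-1) 0 2| := Real.sqrt_sq (abs_nonneg _)
  calc |U (-1) 0 2| = Real.sqrt (|U (-1) 0 2| ^ 2) := h4.symm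
    _ ≤ Real.sqrt (∑ i, |U (-1) 0 i| ^ 2) := Real.sqrt_le_sqrt h2
    _ = Real.sqrt (∑ i, ‖U (-1) 0 i‖ ^ 2) := by simp [Real.norm_eq_abs]

theorem notSmallWindow_of_pinned (hG : ParaboloidGap) {C : ℝ} {U : ℝ → E₃ → E₃} (hP : Pinned C U) :
    ∃ ε₀ : ℝ, 0 < ε₀ ∧ ∃ R₀ : ℝ, 0 < R₀ ∧ ∀ t₀ : ℝ, t₀ ≤ -1 →
      ¬ (∀ r ∈ Set.Icc (4 * t₀) t₀, ∀ y : E₃, ‖y‖ ≤ R₀ * Real.sqrt (-r) → Real.sqrt (-r) * ‖U r y‖ ≤ ε₀) := by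
  obtain ⟨ε₁, hε₁, hg⟩ := hG C
  have hN : U (-1) 0 2 ≠ 0 := hP.2.2.2.2.2.1
  have ha : 0 < |U (-1) 0 2| := abs_pos.2 hN
  set ε : ℝ := min ε₁ (|U (-1) 0 2| / 4) with hεdef
  have hε : 0 < ε := lt_min hε₁ (by positivity)
  have hεle : ε ≤ ε₁ := min_le_left _ _
  have hεa : ε ≤ |U (-1) 0 2| / 4 := min_le_right _ _
  obtain ⟨R₁, hR₁, hR⟩ := hg ε hε hεle
  refine ⟨ε, hε, R₁, hR₁, fun t₀ ht₀ hsmall => ?_⟩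
  have ht₀' : t₀ < 0 := by linarith
  have h := hR R₁ le_rfl U (class_of_pinned hP) t₀ ht₀' hsmall (-1) ht₀ (by norm_num) 0
    (by rw [norm_zero]; positivity)
  have h1 : Real.sqrt (-(-1 : ℝ)) = 1 := by norm_num
  rw [h1, one_mul] at h
  have h2 := absN_le_norm U
  linarith

theorem eternalCore_of_pinned (hG : ParaboloidGap) {C : ℝ} {U : ℝ → E₃ → E₃} (hP : Pinned C U) :
    ∃ ε₀ : ℝ, 0 < ε₀ ∧ ∃ R₀ : ℝ, 0 < R₀ ∧ EternalCore ε₀ R₀ (-1) U := by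
  obtain ⟨ε₀, hε₀, R₀, hR₀, hwin⟩ := notSmallWindow_of_pinned hG hP
  refine ⟨ε₀, hε₀, R₀, hR₀, fun t₀ ht₀ => ?_⟩
  by_contra hcon
  push Not at hcon
  exact hwin t₀ ht₀.le fun r hr y hy => (hcon r hr y hy).le

/-- **ScaleWindowPin v** — ETERNAL PIN IN SCALE WINDOWS (critic W1's «eternal pin», sup … -/
def ScaleWindowPin (v : ℝ → E₃ → E₃) : Prop :=
  ∀ η : ℝ, 0 < η → ∃ Λ : ℝ, 1 ≤ Λ ∧ ∀ t₀ : ℝ, t₀ ≤ -1 →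
    ∃ t ∈ Set.Icc (Λ * t₀) t₀, ∃ x : E₃,
      ‖x‖ ≤ Λ * Real.sqrt (-t) ∧ |v (-1) 0 2| - η < Real.sqrt (-t) * |v t x 2|

theorem scaleWindowPin_of_noPinLoss {C : ℝ} {v : ℝ → E₃ → E₃} (hP : Pinned C v) (hK : Peakless v)
    (hNPL : NoPinLoss C v) : ScaleWindowPin v := by
  intro η hη
  by_contra hcon
  push Not at hcon
  have hN : v (-1) 0 2 ≠ 0 := hP.2.2.2.2.2.1
  have hcl : IsTypeIAncientMild C v := class_of_pinned hP
  have hΛ : ∀ n : ℕ, (1 : ℝ) ≤ (n : ℝ) + 1 := fun n => by have := n.cast_nonneg (α := ℝ); linarith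
  choose t₀ ht₀ hfree using fun n : ℕ => hcon ((n : ℝ) + 1) (hΛ n)
  have hc0 : ∀ n, 0 < Real.sqrt (-t₀ n) := fun n => Real.sqrt_pos.2 (by linarith [ht₀ n])
  have hc1 : ∀ n, 1 ≤ Real.sqrt (-t₀ n) := fun n => by
    rw [show (1 : ℝ) = Real.sqrt 1 from Real.sqrt_one.symm]
    exact Real.sqrt_le_sqrt (by linarith [ht₀ n])
  have hcsq : ∀ n, Real.sqrt (-t₀ n) ^ 2 = -t₀ n := fun n => Real.sq_sqrt (by linarith [ht₀ n])
  set vs : ℕ → ℝ → E₃ → E₃ := fun n => nsRescale (Real.sqrt (-t₀ n)) v with hvs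
  have hw : ∀ n, IsTypeIAncientMild C (vs n) := fun n => hcl.nsRescale (hc0 n)
  have hfree' : ∀ n : ℕ, ∀ t : ℝ, -((n : ℝ) + 1) ≤ t → t ≤ -1 → ∀ x : E₃, ‖x‖ ≤ ((n : ℝ) + 1) * Real.sqrt (-t) →
      Real.sqrt (-t) * |vs n t x 2| ≤ |v (-1) 0 2| - η := by
    intro n t ht1 ht2 x hx
    have hmem : Real.sqrt (-t₀ n) ^ 2 * t ∈ Set.Icc (((n : ℝ) + 1) * t₀ n) (t₀ n) := by
      rw [hcsq, Set.mem_Icc]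
      have h1 : 0 ≤ (t + ((n : ℝ) + 1)) * (-t₀ n) := mul_nonneg (by linarith) (by linarith [ht₀ n])
      have h2 : 0 ≤ (-1 - t) * (-t₀ n) := mul_nonneg (by linarith) (by linarith [ht₀ n])
      constructor <;> nlinarith [h1, h2]
    have hxs : ‖Real.sqrt (-t₀ n) • x‖ ≤ ((n : ℝ) + 1) * Real.sqrt (-(Real.sqrt (-t₀ n) ^ 2 * t)) := by
      rw [PoloidalWindowDoorPoloidalWindowRigidityEternalCoreScalingCore.sqrt_neg_sq_mul (hc0 n).le, norm_smul, Real.norm_eq_abs,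
        abs_of_pos (hc0 n)]
      calc Real.sqrt (-t₀ n) * ‖x‖ ≤ Real.sqrt (-t₀ n) * (((n : ℝ) + 1) * Real.sqrt (-t)) := mul_le_mul_of_nonneg_left hx (hc0 n).le
        _ = ((n : ℝ) + 1) * (Real.sqrt (-t₀ n) * Real.sqrt (-t)) := by ring
    have key := hfree n (Real.sqrt (-t₀ n) ^ 2 * t) hmem (Real.sqrt (-t₀ n) • x) hxs
    rw [PoloidalWindowDoorPoloidalWindowRigidityEternalCoreScalingCore.sqrt_neg_sq_mul (hc0 n).le] at key
    have e : Real.sqrt (-t) * |vs n t x 2| = Real.sqrt (-t₀ n) * Real.sqrt (-t) * |v (Real.sqrt (-t₀ n) ^ 2 * t) (Real.sqrt (-t₀ n) • x) 2| := by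
      simp only [hvs, nsRescale_apply, PiLp.smul_apply, smul_eq_mul, abs_mul, abs_of_pos (hc0 n)]
      ring
    rw [e]
    exact key
  obtain ⟨φ, hφ, V, hV, hpt, hfd, htlu, -⟩ := exists_tendsto_of_isTypeIAncientMild_seq C hw
  have hpolv : ∀ s < 0, ∀ y, ⟪curl (v s) y, EuclideanSpace.single 2 1⟫_ℝ = 0 := hP.2.2.2.2.1
  have hpolV : ∀ s < 0, ∀ y, ⟪curl (V s) y, EuclideanSpace.single 2 1⟫_ℝ = 0 :=
    fun s hs y => PoloidalWindowDoorPoloidalWindowRigidityPoloidalExtremal.poloidal_of_tendsto (hfd s hs y)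
      (fun j => PoloidalWindowDoorPoloidalWindowRigidityPoloidalExtremal.poloidal_nsRescale hpolv (hc0 (φ j)) s hs y)
  have hKV : Peakless V :=
    PoloidalWindowDoorPoloidalWindowRigidityHotHullCompactness.peaklessClosed (fun j => vs (φ j)) V
      (fun j => PoloidalWindowDoorPoloidalWindowRigidityLeastPinNoPinLoss.peakless_nsRescale hK (hc0 (φ j)))
      (fun j t ht => ((hw (φ j)).contDiff_slice ht).continuous) (fun t ht => (hV.contDiff_slice ht).continuous) (fun t ht => htlu t ht)
  have hc2 : Continuous fun x : E₃ => x 2 := by fun_prop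
  have hval : ∀ t < 0, ∀ x, Tendsto (fun j => vs (φ j) t x 2) atTop (𝓝 (V t x 2)) :=
    fun t ht x => (hc2.tendsto _).comp (hpt t ht x)
  have hdomV : ∀ t < 0, ∀ x, Real.sqrt (-t) * |V t x 2| ≤ |v (-1) 0 2| := fun t ht x =>
    le_of_tendsto (((continuous_const.mul continuous_abs).tendsto _).comp (hval t ht x))
      (Eventually.of_forall fun j =>
        PoloidalWindowDoorPoloidalWindowRigidityEternalCoreScalingCore.extremal_nsRescale hP.2.2.2.2.2.2.1 (hc0 (φ j)) t ht x)
  obtain ⟨ε₀, hε₀, R₀, hR₀, hcore⟩ := eternalCore_of_pinned paraboloidGap hP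
  have hcoreV := PoloidalWindowDoorPoloidalWindowRigidityEternalCoreScalingCore.eternalCore_of_limit C ε₀ R₀ (-1) (by norm_num)
    (fun j => hw (φ j)) hV hpt
    (fun t₁ ht₁ => Eventually.of_forall fun j =>
      PoloidalWindowDoorPoloidalWindowRigidityEternalCoreScalingCore.eternalCore_nsRescale hcore (hc0 (φ j)) t₁
        (by
          have h1 : 0 ≤ (Real.sqrt (-t₀ (φ j)) ^ 2 - 1) * (-1 - t₁) :=
            mul_nonneg (by nlinarith [hc1 (φ j)]) (by linarith)
          nlinarith [h1, hc1 (φ j)]))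
  have hnzV : ¬ ∀ t < 0, ∀ x, V t x = 0 := by
    intro h0
    obtain ⟨r, hr, y, -, hε⟩ := hcoreV (-2) (by norm_num)
    have hr0 : r < 0 := by linarith [hr.2]
    rw [h0 r hr0 y, norm_zero, mul_zero] at hε
    linarith
  have hfreeV : ∀ t : ℝ, t ≤ -1 → ∀ x : E₃, Real.sqrt (-t) * |V t x 2| ≤ |v (-1) 0 2| - η := by
    intro t ht x
    have ht0 : t < 0 := by linarith
    have hsq0 : 0 < Real.sqrt (-t) := Real.sqrt_pos.2 (by linarith)
    refine le_of_tendsto (((continuous_const.mul continuous_abs).tendsto _).comp (hval t ht0 x)) ?_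
    obtain ⟨N₀, hN₀⟩ := exists_nat_ge (max (-t) (‖x‖ / Real.sqrt (-t)))
    refine eventually_atTop.2 ⟨N₀, fun j hj => ?_⟩
    have hφj : (N₀ : ℝ) ≤ (φ j : ℝ) := by exact_mod_cast hj.trans (hφ.id_le j)
    refine hfree' (φ j) t ?_ ht x ?_
    · linarith [le_max_left (-t) (‖x‖ / Real.sqrt (-t))]
    · have h1 : ‖x‖ / Real.sqrt (-t) ≤ (φ j : ℝ) + 1 := by linarith [le_max_right (-t) (‖x‖ / Real.sqrt (-t))]
      rwa [div_le_iff₀ hsq0] at h1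
  obtain ⟨s, hs, x, hx⟩ := pastPin hN hNPL hV hpolV hKV hdomV hnzV η hη (-1) (by norm_num)
  have := hfreeV s hs.le x
  linarith

theorem nearPinnedBlowDowns {C : ℝ} {v : ℝ → E₃ → E₃} (hP : Pinned C v) (hK : Peakless v)
    (hNPL : NoPinLoss C v) :
    ∀ η : ℝ, 0 < η → ∃ Λ : ℝ, 1 ≤ Λ ∧ ∀ t₀ : ℝ, t₀ ≤ -1 → ∃ t ∈ Set.Icc (Λ * t₀) t₀, ∃ y : E₃,
      ‖y‖ ≤ Λ ∧ |v (-1) 0 2| - η < |nsRescale (Real.sqrt (-t)) v (-1) y 2| := by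
  intro η hη
  obtain ⟨Λ, hΛ, hwin⟩ := scaleWindowPin_of_noPinLoss hP hK hNPL η hη
  refine ⟨Λ, hΛ, fun t₀ ht₀ => ?_⟩
  obtain ⟨t, ht, x, hx, hpin⟩ := hwin t₀ ht₀
  have ht1 : t ≤ -1 := ht.2.trans ht₀
  have hc : 0 < Real.sqrt (-t) := Real.sqrt_pos.2 (by linarith)
  refine ⟨t, ht, (Real.sqrt (-t))⁻¹ • x, ?_, ?_⟩
  · rw [norm_smul, norm_inv, Real.norm_eq_abs, abs_of_pos hc, inv_mul_le_iff₀ hc, mul_comm]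
    exact hx
  · have h2 : Real.sqrt (-t) ^ 2 * (-1) = t := by rw [Real.sq_sqrt (by linarith)]; ring
    have h3 : Real.sqrt (-t) • ((Real.sqrt (-t))⁻¹ • x) = x := by rw [smul_smul, mul_inv_cancel₀ hc.ne', one_smul]
    rw [nsRescale_apply, h3, h2, PiLp.smul_apply, smul_eq_mul, abs_mul, abs_of_pos hc]
    exact hpin

theorem nearPinnedBlowDownLimit {C : ℝ} {v : ℝ → E₃ → E₃} (hP : Pinned C v) (hK : Peakless v)
    (hNPL : NoPinLoss C v) :
    ∀ η : ℝ, 0 < η → ∃ Λ : ℝ, 1 ≤ Λ ∧ ∃ V : ℝ → E₃ → E₃,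
      IsTypeIAncientMild C V ∧ (∀ s < 0, ∀ y, ⟪curl (V s) y, EuclideanSpace.single 2 1⟫_ℝ = 0) ∧ Peakless V ∧
      (∀ t < 0, ∀ x, Real.sqrt (-t) * |V t x 2| ≤ |v (-1) 0 2|) ∧
      (∃ y : E₃, ‖y‖ ≤ Λ ∧ |v (-1) 0 2| - η ≤ |V (-1) y 2|) ∧
      ∃ c : ℕ → ℝ, (∀ j, 1 ≤ c j) ∧ Tendsto c atTop atTop ∧ ∀ t < 0, ∀ x, Tendsto (fun j => nsRescale (c j) v t x) atTop (𝓝 (V t x)) := by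
  intro η hη
  obtain ⟨Λ, hΛ, hwin⟩ := nearPinnedBlowDowns hP hK hNPL η hη
  refine ⟨Λ, hΛ, ?_⟩
  have hcl : IsTypeIAncientMild C v := class_of_pinned hP
  choose t ht y hy hpin using fun n : ℕ => hwin (-((n : ℝ) + 1)) (by linarith [n.cast_nonneg (α := ℝ)])
  obtain ⟨yb, hybmem, ψ, hψ, hyψ⟩ := tendsto_subseq_of_bounded (Metric.isBounded_closedBall (x := (0 : E₃)) (r := Λ))
    (x := y) (fun n => mem_closedBall_zero_iff.2 (hy n))
  have hybnorm : ‖yb‖ ≤ Λ := by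
    rw [Metric.isClosed_closedBall.closure_eq] at hybmem
    exact mem_closedBall_zero_iff.1 hybmem
  have ht1 : ∀ n, t (ψ n) ≤ -1 := fun n => (ht (ψ n)).2.trans (by linarith [(ψ n).cast_nonneg (α := ℝ)])
  have htn : ∀ n : ℕ, (n : ℝ) + 1 ≤ -t (ψ n) := fun n => by
    have h1 := (ht (ψ n)).2
    have h2 : (n : ℝ) ≤ (ψ n : ℝ) := by exact_mod_cast hψ.id_le n
    linarith
  set c : ℕ → ℝ := fun n => Real.sqrt (-t (ψ n)) with hc
  have hc0 : ∀ n, 0 < c n := fun n => Real.sqrt_pos.2 (by linarith [ht1 n])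
  have hc1 : ∀ n, 1 ≤ c n := fun n => by
    rw [show (1 : ℝ) = Real.sqrt 1 from Real.sqrt_one.symm]
    exact Real.sqrt_le_sqrt (by linarith [ht1 n])
  have hcTop : Tendsto c atTop atTop := by
    have h1 : Tendsto (fun n : ℕ => Real.sqrt ((n : ℝ) + 1)) atTop atTop :=
      Real.tendsto_sqrt_atTop.comp (tendsto_atTop_add_const_right _ 1 tendsto_natCast_atTop_atTop)
    exact tendsto_atTop_mono (fun n => Real.sqrt_le_sqrt (htn n)) h1
  set w : ℕ → ℝ → E₃ → E₃ := fun n => nsRescale (c n) v with hw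
  have hwc : ∀ n, IsTypeIAncientMild C (w n) := fun n => hcl.nsRescale (hc0 n)
  obtain ⟨φ, hφ, V, hV, hpt, hfd, htlu, -⟩ := exists_tendsto_of_isTypeIAncientMild_seq C hwc
  have hpolv : ∀ s < 0, ∀ y, ⟪curl (v s) y, EuclideanSpace.single 2 1⟫_ℝ = 0 := hP.2.2.2.2.1
  have hpolV : ∀ s < 0, ∀ y, ⟪curl (V s) y, EuclideanSpace.single 2 1⟫_ℝ = 0 :=
    fun s hs y => PoloidalWindowDoorPoloidalWindowRigidityPoloidalExtremal.poloidal_of_tendsto (hfd s hs y)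
      (fun j => PoloidalWindowDoorPoloidalWindowRigidityPoloidalExtremal.poloidal_nsRescale hpolv (hc0 (φ j)) s hs y)
  have hKV : Peakless V :=
    PoloidalWindowDoorPoloidalWindowRigidityHotHullCompactness.peaklessClosed (fun j => w (φ j)) V
      (fun j => PoloidalWindowDoorPoloidalWindowRigidityLeastPinNoPinLoss.peakless_nsRescale hK (hc0 (φ j)))
      (fun j t ht => ((hwc (φ j)).contDiff_slice ht).continuous) (fun t ht => (hV.contDiff_slice ht).continuous) (fun t ht => htlu t ht)
  have hc2 : Continuous fun x : E₃ => x 2 := by fun_prop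
  have hdomV : ∀ t < 0, ∀ x, Real.sqrt (-t) * |V t x 2| ≤ |v (-1) 0 2| := fun t ht x =>
    le_of_tendsto (((continuous_const.mul continuous_abs).tendsto _).comp ((hc2.tendsto _).comp (hpt t ht x)))
      (Eventually.of_forall fun j =>
        PoloidalWindowDoorPoloidalWindowRigidityEternalCoreScalingCore.extremal_nsRescale hP.2.2.2.2.2.2.1 (hc0 (φ j)) t ht x)
  have hg : Tendsto (fun j => y (ψ (φ j))) atTop (𝓝 yb) := hyψ.comp hφ.tendsto_atTop
  have hcontV : ContinuousAt (V (-1)) yb := ((hV.contDiff_slice (by norm_num)).continuous).continuousAt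
  have hlim : Tendsto (fun j => w (φ j) (-1) (y (ψ (φ j)))) atTop (𝓝 (V (-1) yb)) := (htlu (-1) (by norm_num)).tendsto_comp hcontV hg
  have hlim2 : Tendsto (fun j => |w (φ j) (-1) (y (ψ (φ j))) 2|) atTop (𝓝 |V (-1) yb 2|) :=
    (continuous_abs.tendsto _).comp ((hc2.tendsto _).comp hlim)
  have hpinV : |v (-1) 0 2| - η ≤ |V (-1) yb 2| :=
    ge_of_tendsto hlim2 (Eventually.of_forall fun j => (hpin (ψ (φ j))).le)
  exact ⟨V, hV, hpolV, hKV, hdomV, ⟨yb, hybnorm, hpinV⟩, fun j => c (φ j), fun j => hc1 (φ j), hcTop.comp hφ.tendsto_atTop,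
    fun t ht x => hpt t ht x⟩

/-! ## §13 LINE 25's cell ETERNAL-PIN, VERBATIM (here NOT a sorry: it is DERIVED from the two cells of LINE 26 in §20) -/

/-- **PastPin C v** — the PAST-PIN LAW (PROVED in §11 from `NoPinLoss C v`) as a … -/
def PastPin (C : ℝ) (v : ℝ → E₃ → E₃) : Prop :=
  ∀ V : ℝ → E₃ → E₃, IsTypeIAncientMild C V →
    (∀ s < 0, ∀ y, ⟪curl (V s) y, EuclideanSpace.single 2 1⟫_ℝ = 0) → Peakless V →
    (∀ t < 0, ∀ x, Real.sqrt (-t) * |V t x 2| ≤ |v (-1) 0 2|) → (¬ ∀ t < 0, ∀ x, V t x = 0) →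
    ∀ η > 0, ∀ T < 0, ∃ s < T, ∃ x, |v (-1) 0 2| - η < Real.sqrt (-s) * |V s x 2|

/-- **Research cell ETERNAL-PIN (OPEN).** Kill a pinned, thick, peakless class-`C` … -/
def CellEternalPin : Prop :=
  AnisotropicGap →
  ∀ (C : ℝ) (v : ℝ → E₃ → E₃) (W : Set (ℝ × E₃)),
    Pinned C v → ThickWindow v W → Peakless v → LeastPin C v → NoPinLoss C v → PastPin C v → ScaleWindowPin v → False

theorem cellLeastPin_of_eternalPin (hcell : CellEternalPin) : CellLeastPin := by
  intro hAG C v W hP hW hK hL hNPL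
  exact hcell hAG C v W hP hW hK hL hNPL
    (fun V hV hpol hKV hdom hnz => pastPin hP.2.2.2.2.2.1 hNPL hV hpol hKV hdom hnz)
    (scaleWindowPin_of_noPinLoss hP hK hNPL)

theorem hl3_of_eternalPin (hTH : THGerm) (hcell : CellEternalPin) : HL3' :=
  hl3_of_stubs hTH (cellLeastPin_of_eternalPin hcell)

/-! ## §14 Compositions to the crux items BY NAME (CONDITIONAL on S0, the wall ⟨27893⟩ and the cell ETERNAL-PIN; no … -/

theorem PoloidalWindowRigidity_of_eternalPin (hS0 : S0Statement)
    (hG : Summit.NavierStokesRegularity.NavierStokesRegularity.Theses.LoopPeriodRatchet.FrequencyGrowthExponent) (hcell : CellEternalPin) :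
    Summit.NavierStokesRegularity.NavierStokesRegularity.Theses.PoloidalWindowDoor.PoloidalWindowRigidity :=
  PoloidalWindowRigidity_of_stubs hS0 hG (cellLeastPin_of_eternalPin hcell)

theorem LrcModEntire_of_eternalPin (hS0 : S0Statement)
    (hG : Summit.NavierStokesRegularity.NavierStokesRegularity.Theses.LoopPeriodRatchet.FrequencyGrowthExponent) (hcell : CellEternalPin) :
    Summit.NavierStokesRegularity.NavierStokesRegularity.Theses.PoloidalWindowDoor.LrcModEntire :=
  LrcModEntire_of_stubs hS0 hG (cellLeastPin_of_eternalPin hcell)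

/-! ## §15 LINE 26 `eternal_web` — THE PARABOLOID PIN VALUE of the least-pin critical element and the ETERNAL-WEB / … -/

theorem abs_apply_two_le_norm (a : E₃) : |a 2| ≤ ‖a‖ := by
  have h := EuclideanSpace.norm_eq a
  have h2 : |a 2| ^ 2 ≤ ∑ i, |a i| ^ 2 :=
    Finset.single_le_sum (f := fun i => |a i| ^ 2) (fun i _ => by positivity) (Finset.mem_univ (2 : Fin 3))
  rw [h]
  calc |a 2| = Real.sqrt (|a 2| ^ 2) := (Real.sqrt_sq (abs_nonneg _)).symm
    _ ≤ Real.sqrt (∑ i, |a i| ^ 2) := Real.sqrt_le_sqrt h2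
    _ = Real.sqrt (∑ i, ‖a i‖ ^ 2) := by simp [Real.norm_eq_abs]

theorem abs_apply_two_sub_le_dist (a b : E₃) : |a 2 - b 2| ≤ dist a b := by
  have e : a 2 - b 2 = (a - b) 2 := by simp
  rw [dist_eq_norm, e]
  exact abs_apply_two_le_norm _

/-- **AsymptoticallyPinned A v** — the paraboloid pin value of aperture `A` tends to … -/
def AsymptoticallyPinned (A : ℝ) (v : ℝ → E₃ → E₃) : Prop :=
  ∀ η : ℝ, 0 < η → ∃ T : ℝ, T < 0 ∧ ∀ t : ℝ, t < T → ∃ x : E₃,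
    ‖x‖ ≤ A * Real.sqrt (-t) ∧ |v (-1) 0 2| - η < Real.sqrt (-t) * |v t x 2|

/-- **Breathing v** — in EVERY paraboloid the pin value DIPS by a definite amount at … -/
def Breathing (v : ℝ → E₃ → E₃) : Prop :=
  ∀ A : ℝ, 0 < A → ∃ η : ℝ, 0 < η ∧ ∀ T : ℝ, T < 0 → ∃ t : ℝ, t < T ∧ ∀ x : E₃,
    ‖x‖ ≤ A * Real.sqrt (-t) → Real.sqrt (-t) * |v t x 2| ≤ |v (-1) 0 2| - η

theorem dichotomy (v : ℝ → E₃ → E₃) :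
    (∃ A : ℝ, 0 < A ∧ AsymptoticallyPinned A v) ∨ Breathing v := by
  by_cases h : ∃ A : ℝ, 0 < A ∧ AsymptoticallyPinned A v
  · exact Or.inl h
  · refine Or.inr fun A hA => ?_
    by_contra hcon
    refine h ⟨A, hA, fun η hη => ?_⟩
    by_contra hcon2
    refine hcon ⟨η, hη, fun T hT => ?_⟩
    by_contra hcon3
    refine hcon2 ⟨T, hT, fun t ht => ?_⟩
    by_contra hcon4
    refine hcon3 ⟨t, ht, fun x hx => ?_⟩
    by_contra hcon5
    exact hcon4 ⟨x, hx, lt_of_not_ge hcon5⟩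

/-! ## §16 RE-CENTRED BLOW-DOWNS ARE PINNED (PROVED) and the predicate ETERNALLY PINNED -/

theorem peakless_recentre {V : ℝ → E₃ → E₃} (hK : Peakless V) {c : ℝ} (hc : 0 < c)
    (x : E₃) : Peakless (nsRescale c (fun s y => V s (x + y))) := by
  have e : (fun t y => V t (y + x)) = fun t y => V t (x + y) := by
    funext t y; rw [add_comm]
  have h1 := PoloidalWindowDoorPoloidalWindowRigidityHotHullCompactness.peakless_translate hK x
  rw [e] at h1
  exact PoloidalWindowDoorPoloidalWindowRigidityLeastPinNoPinLoss.peakless_nsRescale h1 hc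

theorem pinned_recentre {C m : ℝ} {V : ℝ → E₃ → E₃} (hV : IsTypeIAncientMild C V)
    (hpol : ∀ s < 0, ∀ y, ⟪curl (V s) y, EuclideanSpace.single 2 1⟫_ℝ = 0)
    (hdom : ∀ s < 0, ∀ y, Real.sqrt (-s) * |V s y 2| ≤ m) (hm : 0 < m) {t : ℝ} (ht : t < 0) {x : E₃}
    (hval : Real.sqrt (-t) * |V t x 2| = m) :
    Pinned C (nsRescale (Real.sqrt (-t)) (fun s y => V s (x + y))) ∧ |nsRescale (Real.sqrt (-t)) (fun s y => V s (x + y)) (-1) 0 2| = m := by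
  set c : ℝ := Real.sqrt (-t) with hc
  have hc0 : 0 < c := Real.sqrt_pos.2 (neg_pos.2 ht)
  set U : ℝ → E₃ → E₃ := nsRescale c (fun s y => V s (x + y)) with hUdef
  have hU : IsTypeIAncientMild C U := isTypeIAncientMild_nsRescale (isTypeIAncientMild_translate hV x) hc0
  have hrate : HasTypeITimeDecay C U := hU.2.2.2
  have hcont : ContinuousOn (Function.uncurry U) (Set.Iio (0 : ℝ) ×ˢ Set.univ) := hU.1.continuousOn
  have hmild : ∀ s t : ℝ, s < t → t < 0 → ∀ x, U t x =
      UnboundedOperators.heatExtension (U s) (t - s) x - oseenDuhamel 1 s U U t x :=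
    fun s t hst ht x => hU.mild_eq_heatExtension hst ht x
  have hdiv : ∀ t < 0, VectorCalculus.IsDivFree (U t) := hU.2.1
  have hpolU : ∀ s < 0, ∀ y, ⟪curl (U s) y, EuclideanSpace.single 2 1⟫_ℝ = 0 :=
    PoloidalWindowDoorPoloidalWindowRigidityPoloidalExtremal.poloidal_nsRescale
      (PoloidalWindowDoorPoloidalWindowRigidityPoloidalExtremal.poloidal_translate hpol x) hc0
  have hdomT : ∀ s < 0, ∀ y, Real.sqrt (-s) * |(fun s y => V s (x + y)) s y 2| ≤ m := fun s hs y => hdom s hs (x + y)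
  have hdomU : ∀ s < 0, ∀ y, Real.sqrt (-s) * |U s y 2| ≤ m := fun s hs y =>
    PoloidalWindowDoorPoloidalWindowRigidityEternalCoreScalingCore.extremal_nsRescale hdomT hc0 s hs y
  have hval0 : U (-1) 0 2 = c * V t x 2 := by
    have h1 : c ^ 2 * (-1 : ℝ) = t := by rw [hc, Real.sq_sqrt (neg_nonneg.2 ht.le)]; ring
    simp only [hUdef, nsRescale_apply, smul_zero, add_zero, h1, PiLp.smul_apply, smul_eq_mul]
  have habs : |U (-1) 0 2| = m := by rw [hval0, abs_mul, abs_of_pos hc0]; exact hval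
  have hne : U (-1) 0 2 ≠ 0 := by
    intro h0; rw [h0, abs_zero] at habs; exact absurd habs hm.ne
  have hhot : ∀ s < 0, ∀ y, Real.sqrt (-s) * |U s y 2| ≤ |U (-1) 0 2| := fun s hs y => habs ▸ hdomU s hs y
  exact ⟨⟨hrate, hcont, hmild, hdiv, hpolU, hne, hhot,
      PoloidalWindowDoorLrcModEntireThreadPins.threadPin_of_hotSpot hrate hcont hmild hhot,
      PoloidalWindowDoorLrcModEntireThreadPins.threadSignedPin C U hrate hcont hmild hdiv hne hhot⟩, habs⟩

/-- **EternallyPinned A C v** — the pin is REALISED AT EVERY PAST TIME inside the … -/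
def EternallyPinned (A C : ℝ) (v : ℝ → E₃ → E₃) : Prop :=
  ∀ t : ℝ, t ≤ -1 → ∃ x : E₃, ‖x‖ ≤ A * Real.sqrt (-t) ∧ Real.sqrt (-t) * |v t x 2| = |v (-1) 0 2| ∧
    Pinned C (nsRescale (Real.sqrt (-t)) (fun s y => v s (x + y)))

/-! ## §17 THE ETERNAL-WEB EXTRACTION (PROVED): asymptotically pinned ⇒ a blow-down limit pinned at EVERY past time -/

theorem eternalWebExtraction {C A : ℝ} {v : ℝ → E₃ → E₃} (hP : Pinned C v) (hK : Peakless v)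
    (hA : 0 < A) (hAP : AsymptoticallyPinned A v) :
    ∃ W : ℝ → E₃ → E₃,
      Pinned C W ∧ Peakless W ∧ |W (-1) 0 2| = |v (-1) 0 2| ∧ EternallyPinned (2 * A) C W := by
  have hcl : IsTypeIAncientMild C v := class_of_pinned hP
  have hN : v (-1) 0 2 ≠ 0 := hP.2.2.2.2.2.1
  have hm0 : 0 < |v (-1) 0 2| := abs_pos.2 hN
  have hpolv : ∀ s < 0, ∀ y, ⟪curl (v s) y, EuclideanSpace.single 2 1⟫_ℝ = 0 := hP.2.2.2.2.1
  have hdomv : ∀ t < 0, ∀ x, Real.sqrt (-t) * |v t x 2| ≤ |v (-1) 0 2| := hP.2.2.2.2.2.2.1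
  set c : ℕ → ℝ := fun n => (n : ℝ) + 1 with hc
  have hc0 : ∀ n, 0 < c n := fun n => by simp only [hc]; positivity
  have hcTop : Tendsto c atTop atTop := tendsto_atTop_add_const_right _ 1 tendsto_natCast_atTop_atTop
  set w : ℕ → ℝ → E₃ → E₃ := fun n => nsRescale (c n) v with hw
  have hwc : ∀ n, IsTypeIAncientMild C (w n) := fun n => hcl.nsRescale (hc0 n)
  obtain ⟨φ, hφ, V, hV, hpt, hfd, htlu, -⟩ := exists_tendsto_of_isTypeIAncientMild_seq C hwc
  have hpolV : ∀ s < 0, ∀ y, ⟪curl (V s) y, EuclideanSpace.single 2 1⟫_ℝ = 0 :=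
    fun s hs y => PoloidalWindowDoorPoloidalWindowRigidityPoloidalExtremal.poloidal_of_tendsto (hfd s hs y)
      (fun j => PoloidalWindowDoorPoloidalWindowRigidityPoloidalExtremal.poloidal_nsRescale hpolv (hc0 (φ j)) s hs y)
  have hKV : Peakless V :=
    PoloidalWindowDoorPoloidalWindowRigidityHotHullCompactness.peaklessClosed (fun j => w (φ j)) V
      (fun j => PoloidalWindowDoorPoloidalWindowRigidityLeastPinNoPinLoss.peakless_nsRescale hK (hc0 (φ j)))
      (fun j t ht => ((hwc (φ j)).contDiff_slice ht).continuous) (fun t ht => (hV.contDiff_slice ht).continuous) (fun t ht => htlu t ht)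
  have hc2 : Continuous fun x : E₃ => x 2 := by fun_prop
  have hdomV : ∀ t < 0, ∀ x, Real.sqrt (-t) * |V t x 2| ≤ |v (-1) 0 2| := fun t ht x =>
    le_of_tendsto (((continuous_const.mul continuous_abs).tendsto _).comp ((hc2.tendsto _).comp (hpt t ht x)))
      (Eventually.of_forall fun j =>
        PoloidalWindowDoorPoloidalWindowRigidityEternalCoreScalingCore.extremal_nsRescale hdomv (hc0 (φ j)) t ht x)
  have hkey : ∀ t < 0, ∃ x : E₃, ‖x‖ ≤ A * Real.sqrt (-t) ∧ Real.sqrt (-t) * |V t x 2| = |v (-1) 0 2| := by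
    intro t ht
    have hst : 0 < Real.sqrt (-t) := Real.sqrt_pos.2 (neg_pos.2 ht)
    set K : Set (E₃) := Metric.closedBall 0 (A * Real.sqrt (-t)) with hKdef
    have hKc : IsCompact K := isCompact_closedBall _ _
    have hKne : K.Nonempty := ⟨0, Metric.mem_closedBall_self (by positivity)⟩
    set f : E₃ → ℝ := fun y => Real.sqrt (-t) * |V t y 2| with hf
    have hfc : Continuous f := continuous_const.mul (continuous_abs.comp (hc2.comp (hV.contDiff_slice ht).continuous))
    obtain ⟨xs, hxsK, hmax⟩ := hKc.exists_isMaxOn hKne hfc.continuousOn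
    have hxs_norm : ‖xs‖ ≤ A * Real.sqrt (-t) := mem_closedBall_zero_iff.1 hxsK
    refine ⟨xs, hxs_norm, le_antisymm (hdomV t ht xs) ?_⟩
    by_contra hlt
    push Not at hlt
    set η : ℝ := (|v (-1) 0 2| - Real.sqrt (-t) * |V t xs 2|) / 3 with hη
    have hη0 : 0 < η := by
      have : 0 < |v (-1) 0 2| - Real.sqrt (-t) * |V t xs 2| := sub_pos.2 hlt
      rw [hη]; positivity
    obtain ⟨T, hT, hAPT⟩ := hAP η hη0
    have hunif : TendstoUniformlyOn (fun j => w (φ j) t) (V t) atTop K :=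
      (tendstoLocallyUniformlyOn_iff_tendstoUniformlyOn_of_compact hKc).1 (htlu t ht).tendstoLocallyUniformlyOn
    have hev1 : ∀ᶠ j in atTop, ∀ y ∈ K, dist (V t y) (w (φ j) t y) < η / Real.sqrt (-t) :=
      Metric.tendstoUniformlyOn_iff.1 hunif _ (div_pos hη0 hst)
    have hcφ : Tendsto (fun j => c (φ j)) atTop atTop := hcTop.comp hφ.tendsto_atTop
    have hev2 : ∀ᶠ j in atTop, c (φ j) ^ 2 * t < T := by
      filter_upwards [hcφ.eventually_gt_atTop (Real.sqrt (T / t))] with j hj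
      have hpos : 0 < T / t := div_pos_of_neg_of_neg hT ht
      have hs0 : 0 ≤ Real.sqrt (T / t) := Real.sqrt_nonneg _
      have h2 : T / t < c (φ j) ^ 2 := by
        calc T / t = Real.sqrt (T / t) ^ 2 := (Real.sq_sqrt hpos.le).symm
          _ < c (φ j) ^ 2 := by nlinarith [hj, hs0]
      have h3 : c (φ j) ^ 2 * t < T := (div_lt_iff_of_neg ht).1 h2
      exact h3
    obtain ⟨j, hj1, hj2⟩ := (hev1.and hev2).exists
    have hcj : 0 < c (φ j) := hc0 _
    obtain ⟨x, hxA, hxpin⟩ := hAPT (c (φ j) ^ 2 * t) hj2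
    have hsq : Real.sqrt (-(c (φ j) ^ 2 * t)) = c (φ j) * Real.sqrt (-t) :=
      PoloidalWindowDoorPoloidalWindowRigidityEternalCoreScalingCore.sqrt_neg_sq_mul hcj.le
    set y : E₃ := (c (φ j))⁻¹ • x with hy
    have hyK : y ∈ K := by
      rw [hKdef, mem_closedBall_zero_iff, hy, norm_smul, norm_inv, Real.norm_eq_abs, abs_of_pos hcj, inv_mul_le_iff₀ hcj]
      rw [hsq] at hxA
      calc ‖x‖ ≤ A * (c (φ j) * Real.sqrt (-t)) := hxA
        _ = c (φ j) * (A * Real.sqrt (-t)) := by ring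
    have h3 : c (φ j) • y = x := by rw [hy, smul_smul, mul_inv_cancel₀ hcj.ne', one_smul]
    have hwy : w (φ j) t y 2 = c (φ j) * v (c (φ j) ^ 2 * t) x 2 := by
      simp only [hw, nsRescale_apply, h3, PiLp.smul_apply, smul_eq_mul]
    have hwval : |v (-1) 0 2| - η < Real.sqrt (-t) * |w (φ j) t y 2| := by
      rw [hwy, abs_mul, abs_of_pos hcj, ← mul_assoc, mul_comm (Real.sqrt (-t)) (c (φ j)), ← hsq]
      exact hxpin
    have hd : dist (V t y) (w (φ j) t y) < η / Real.sqrt (-t) := hj1 y hyK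
    have hcomp : |V t y 2 - w (φ j) t y 2| < η / Real.sqrt (-t) := (abs_apply_two_sub_le_dist _ _).trans_lt hd
    have h2 : Real.sqrt (-t) * |V t y 2 - w (φ j) t y 2| < η := by
      have h := mul_lt_mul_of_pos_left hcomp hst
      have e : Real.sqrt (-t) * (η / Real.sqrt (-t)) = η := by field_simp
      rwa [e] at h
    have h1 : |w (φ j) t y 2| ≤ |V t y 2| + |V t y 2 - w (φ j) t y 2| := by
      have := abs_sub_abs_le_abs_sub (w (φ j) t y 2) (V t y 2)
      rw [abs_sub_comm] at this
      linarith
    have hVy : |v (-1) 0 2| - 2 * η < f y := by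
      have h4 : Real.sqrt (-t) * |w (φ j) t y 2| ≤ Real.sqrt (-t) * |V t y 2| + Real.sqrt (-t) * |V t y 2 - w (φ j) t y 2| := by
        have := mul_le_mul_of_nonneg_left h1 hst.le
        rwa [mul_add] at this
      show |v (-1) 0 2| - 2 * η < Real.sqrt (-t) * |V t y 2|
      linarith
    have hfy : f y ≤ f xs := hmax hyK
    have hfxs : f xs = |v (-1) 0 2| - 3 * η := by
      show Real.sqrt (-t) * |V t xs 2| = |v (-1) 0 2| - 3 * ((|v (-1) 0 2| - Real.sqrt (-t) * |V t xs 2|) / 3)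
      ring
    linarith
  obtain ⟨y₀, hy₀A, hy₀val⟩ := hkey (-1) (by norm_num)
  have hs1 : Real.sqrt (-(-1 : ℝ)) = 1 := by norm_num
  rw [hs1, mul_one] at hy₀A
  rw [hs1, one_mul] at hy₀val
  have hy₀val' : Real.sqrt (-(-1 : ℝ)) * |V (-1) y₀ 2| = |v (-1) 0 2| := by rw [hs1, one_mul]; exact hy₀val
  obtain ⟨hPW1, habs1⟩ := pinned_recentre hV hpolV hdomV hm0 (by norm_num : (-1 : ℝ) < 0) hy₀val'
  set W : ℝ → E₃ → E₃ := fun s y => V s (y₀ + y) with hWdef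
  have hWeq : nsRescale (Real.sqrt (-(-1 : ℝ))) (fun s y => V s (y₀ + y)) = W := by rw [hs1, nsRescale_one]
  rw [hWeq] at hPW1 habs1
  have hKW1 : Peakless W := by
    have h := peakless_recentre hKV (by norm_num : (0 : ℝ) < 1) y₀
    rwa [nsRescale_one] at h
  refine ⟨W, hPW1, hKW1, habs1, fun t ht => ?_⟩
  have ht0 : t < 0 := by linarith
  obtain ⟨xs, hxsA, hxsval⟩ := hkey t ht0
  have hst1 : 1 ≤ Real.sqrt (-t) := by
    rw [show (1 : ℝ) = Real.sqrt 1 from Real.sqrt_one.symm]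
    exact Real.sqrt_le_sqrt (by linarith)
  refine ⟨xs - y₀, ?_, ?_, ?_⟩
  · calc ‖xs - y₀‖ ≤ ‖xs‖ + ‖y₀‖ := norm_sub_le _ _
      _ ≤ A * Real.sqrt (-t) + A := add_le_add hxsA hy₀A
      _ ≤ 2 * A * Real.sqrt (-t) := by nlinarith [hA, hst1]
  · have e : W t (xs - y₀) = V t xs := by simp only [hWdef, add_sub_cancel]
    rw [e, habs1]; exact hxsval
  · have hpolW : ∀ s < 0, ∀ y, ⟪curl (W s) y, EuclideanSpace.single 2 1⟫_ℝ = 0 :=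
      PoloidalWindowDoorPoloidalWindowRigidityPoloidalExtremal.poloidal_translate hpolV y₀
    have hdomW : ∀ s < 0, ∀ y, Real.sqrt (-s) * |W s y 2| ≤ |v (-1) 0 2| := fun s hs y => hdomV s hs (y₀ + y)
    have hvalW : Real.sqrt (-t) * |W t (xs - y₀) 2| = |v (-1) 0 2| := by
      have e : W t (xs - y₀) = V t xs := by simp only [hWdef, add_sub_cancel]
      rw [e]; exact hxsval
    exact (pinned_recentre (isTypeIAncientMild_translate hV y₀) hpolW hdomW hm0 ht0 hvalW).1

theorem eternalWeb_unbounded {A C : ℝ} {v : ℝ → E₃ → E₃} (hK : Peakless v) (hE : EternallyPinned A C v) :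
    ∀ t : ℝ, t ≤ -1 → ∃ x : E₃, ‖x‖ ≤ A * Real.sqrt (-t) ∧ Real.sqrt (-t) * |v t x 2| = |v (-1) 0 2| ∧
      ¬ Bornology.IsBounded (connectedComponentIn
        {y : E₃ | y 2 = 0 ∧ nsRescale (Real.sqrt (-t)) (fun s y => v s (x + y)) (-1) y 2 =
          nsRescale (Real.sqrt (-t)) (fun s y => v s (x + y)) (-1) 0 2} 0) := by
  intro t ht
  obtain ⟨x, hxA, hval, hPU⟩ := hE t ht
  have hc0 : 0 < Real.sqrt (-t) := Real.sqrt_pos.2 (by linarith)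
  exact ⟨x, hxA, hval, PoloidalWindowDoorPoloidalWindowRigidityHotSplitRidgeKernels.hotSpot_component_unbounded hPU (peakless_recentre hK hc0 x)⟩

/-! ## §18 Hand U4b — the VERTICAL CORE (quantitative unique continuation along the poloidal axis; PROVABLE, M) and … -/

/-- **U4b `VerticalCore` (PROVABLE, M — hand target).** For every Type-I constant `C`, … -/
def VerticalCore : Prop :=
  ∀ C ε₀ A : ℝ, 0 < ε₀ → 0 < A → ∃ δ : ℝ, 0 < δ ∧
    ∀ U : ℝ → E₃ → E₃, IsTypeIAncientMild C U →
      (∀ s < 0, ∀ y, ⟪curl (U s) y, EuclideanSpace.single 2 1⟫_ℝ = 0) →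
      ∀ r : ℝ, r < 0 → ∀ y : E₃, ε₀ ≤ Real.sqrt (-r) * ‖U r y‖ →
        ∃ x : E₃, ‖x - y‖ ≤ A * Real.sqrt (-r) ∧ δ ≤ Real.sqrt (-r) * |U r x 2|

/-- **U4b — PROVED; WIRED BY NAME** to the landed tree theorem … -/
theorem verticalCore_holds : VerticalCore := PoloidalWindowDoorPoloidalWindowRigidityEternalWebVerticalCore.verticalCore

/-- **U4b `VerticalCore`** under its LINE 26 name (kept so that every downstream kernel … -/
theorem stub_verticalCore : VerticalCore := verticalCore_holds

theorem verticalEternalCore_of_pinned (hG : ParaboloidGap) (hVC : VerticalCore) {C : ℝ} {U : ℝ → E₃ → E₃}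
    (hP : Pinned C U) :
    ∃ δ : ℝ, 0 < δ ∧ ∃ R : ℝ, 0 < R ∧ ∀ t₀ : ℝ, t₀ < -1 → ∃ r ∈ Set.Icc (4 * t₀) t₀, ∃ x : E₃,
      ‖x‖ ≤ R * Real.sqrt (-r) ∧ δ ≤ Real.sqrt (-r) * |U r x 2| := by
  obtain ⟨ε₀, hε₀, R₀, hR₀, hcore⟩ := eternalCore_of_pinned hG hP
  obtain ⟨δ, hδ, hvc⟩ := hVC C ε₀ 1 hε₀ one_pos
  refine ⟨δ, hδ, R₀ + 1, by linarith, fun t₀ ht₀ => ?_⟩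
  obtain ⟨r, hr, y, hy, hspeed⟩ := hcore t₀ ht₀
  have hr0 : r < 0 := by linarith [hr.2]
  obtain ⟨x, hxy, hval⟩ := hvc U (class_of_pinned hP) hP.2.2.2.2.1 r hr0 y hspeed
  refine ⟨r, hr, x, ?_, hval⟩
  calc ‖x‖ = ‖(x - y) + y‖ := by rw [sub_add_cancel]
    _ ≤ ‖x - y‖ + ‖y‖ := norm_add_le _ _
    _ ≤ 1 * Real.sqrt (-r) + R₀ * Real.sqrt (-r) := add_le_add hxy hy
    _ = (R₀ + 1) * Real.sqrt (-r) := by ring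

/-! ## §19 The two research cells of LINE 26 (OPEN): ETERNAL-WEB and BREATHING — together they ARE the cell … -/

/-- **Research cell ETERNAL-WEB (OPEN).** Kill a least-pin critical element (all of … -/
def CellEternalWeb : Prop :=
  AnisotropicGap →
  ∀ (C A : ℝ) (v : ℝ → E₃ → E₃) (W : Set (ℝ × E₃)),
    Pinned C v → ThickWindow v W → Peakless v → LeastPin C v → NoPinLoss C v → PastPin C v → ScaleWindowPin v →
    0 < A → EternallyPinned A C v → False

/-- **Research cell BREATHING (OPEN).** Kill a least-pin critical element (all of LINE … -/
def CellBreathing : Prop :=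
  AnisotropicGap → VerticalCore →
  ∀ (C : ℝ) (v : ℝ → E₃ → E₃) (W : Set (ℝ × E₃)),
    Pinned C v → ThickWindow v W → Peakless v → LeastPin C v → NoPinLoss C v → PastPin C v → ScaleWindowPin v →
    Breathing v → False

/-! ## §20 Kernel (checked, no sorry): cell ETERNAL-PIN ⇐ THGerm ∧ U4b ∧ ETERNAL-WEB ∧ BREATHING -/

theorem cellEternalPin_of_cells (hTH : THGerm) (hVC : VerticalCore) (hweb : CellEternalWeb) (hbr : CellBreathing) : CellEternalPin := by
  intro hAG C v W hP hW hK hL hNPL hPP hSWP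
  rcases dichotomy v with ⟨A, hA, hAP⟩ | hB
  · obtain ⟨W', hPW', hKW', habs, hEP⟩ := eternalWebExtraction hP hK hA hAP
    have hLW' : LeastPin C W' := fun v'' hP'' hK'' => habs ▸ hL v'' hP'' hK''
    have hNPLW' : NoPinLoss C W' := stub_noPinLoss hAG C W' hPW' hKW' hLW'
    have hPPW' : PastPin C W' := fun V hV hpol hKV hdom hnz => pastPin hPW'.2.2.2.2.2.1 hNPLW' hV hpol hKV hdom hnz
    have hSWPW' : ScaleWindowPin W' := scaleWindowPin_of_noPinLoss hPW' hKW' hNPLW'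
    obtain ⟨W'', hW''⟩ := thickWindow_of_dense thickDense_holds hTH hPW'
    exact hweb hAG C (2 * A) W' W'' hPW' hW'' hKW' hLW' hNPLW' hPPW' hSWPW' (by linarith) hEP
  · exact hbr hAG hVC C v W hP hW hK hL hNPL hPP hSWP hB

theorem cellEternalPin_of_cellsStub (hTH : THGerm) (hweb : CellEternalWeb) (hbr : CellBreathing) : CellEternalPin :=
  cellEternalPin_of_cells hTH stub_verticalCore hweb hbr

/-! ## §21 Compositions to the crux items BY NAME (CONDITIONAL on S0, the wall ⟨27893⟩, the hand U4b and the two … -/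

theorem PoloidalWindowRigidity_of_cells (hS0 : S0Statement)
    (hG : Summit.NavierStokesRegularity.NavierStokesRegularity.Theses.LoopPeriodRatchet.FrequencyGrowthExponent)
    (hVC : VerticalCore) (hweb : CellEternalWeb) (hbr : CellBreathing) :
    Summit.NavierStokesRegularity.NavierStokesRegularity.Theses.PoloidalWindowDoor.PoloidalWindowRigidity :=
  PoloidalWindowRigidity_of_eternalPin hS0 hG (cellEternalPin_of_cells (thGerm_of_S0 hS0) hVC hweb hbr)

theorem LrcModEntire_of_cells (hS0 : S0Statement)
    (hG : Summit.NavierStokesRegularity.NavierStokesRegularity.Theses.LoopPeriodRatchet.FrequencyGrowthExponent)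
    (hVC : VerticalCore) (hweb : CellEternalWeb) (hbr : CellBreathing) :
    Summit.NavierStokesRegularity.NavierStokesRegularity.Theses.PoloidalWindowDoor.LrcModEntire :=
  LrcModEntire_of_eternalPin hS0 hG (cellEternalPin_of_cells (thGerm_of_S0 hS0) hVC hweb hbr)

/-! ## §22 SYNDETIC BREATHING (NEW): cold times with bounded log-gaps and a uniform defect; it implies LINE 26's … -/

/-- **SyndeticBreathing v** — for every aperture `A > 0` there are a level `β < |N|` … -/
def SyndeticBreathing (v : ℝ → E₃ → E₃) : Prop :=
  ∀ A : ℝ, 0 < A → ∃ β : ℝ, β < |v (-1) 0 2| ∧ ∃ Λ : ℝ, 1 ≤ Λ ∧ ∀ t₀ : ℝ, t₀ ≤ -1 →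
    ∃ t ∈ Set.Icc (Λ * t₀) t₀, ∀ x : E₃, ‖x‖ ≤ A * Real.sqrt (-t) → Real.sqrt (-t) * |v t x 2| ≤ β

theorem breathing_of_syndetic {v : ℝ → E₃ → E₃} (h : SyndeticBreathing v) : Breathing v := by
  intro A hA
  obtain ⟨β, hβ, Λ, hΛ, hwin⟩ := h A hA
  refine ⟨|v (-1) 0 2| - β, by linarith, fun T hT => ?_⟩
  obtain ⟨t, ht, hcold⟩ := hwin (min T (-1) - 1) (by have := min_le_right T (-1); linarith)
  refine ⟨t, ?_, fun x hx => ?_⟩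
  · have h1 : t ≤ min T (-1) - 1 := ht.2
    have h2 : min T (-1) ≤ T := min_le_left _ _
    linarith
  · have := hcold x hx
    linarith

theorem warmWindows_of_not_syndetic {v : ℝ → E₃ → E₃} (h : ¬ SyndeticBreathing v) :
    ∃ A : ℝ, 0 < A ∧ ∀ β : ℝ, β < |v (-1) 0 2| → ∀ Λ : ℝ, 1 ≤ Λ → ∃ t₀ : ℝ, t₀ ≤ -1 ∧
      ∀ t ∈ Set.Icc (Λ * t₀) t₀, ∃ x : E₃, ‖x‖ ≤ A * Real.sqrt (-t) ∧ β < Real.sqrt (-t) * |v t x 2| := by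
  by_contra hcon
  apply h
  intro A hA
  by_contra h1
  apply hcon
  refine ⟨A, hA, fun β hβ Λ hΛ => ?_⟩
  by_contra h2
  apply h1
  refine ⟨β, hβ, Λ, hΛ, fun t₀ ht₀ => ?_⟩
  by_contra h3
  apply h2
  refine ⟨t₀, ht₀, fun t ht => ?_⟩
  by_contra h4
  apply h3
  refine ⟨t, ht, fun x hx => ?_⟩
  by_contra h5
  exact h4 ⟨x, hx, not_le.1 h5⟩

/-! ## §23 THE SECOND EXTRACTION (PROVED): non-syndetic breathing ⇒ the blow-down hull contains an ETERNALLY PINNED … -/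

theorem eternalWeb_of_not_syndetic {C : ℝ} {v : ℝ → E₃ → E₃} (hP : Pinned C v) (hK : Peakless v)
    (hns : ¬ SyndeticBreathing v) :
    ∃ A : ℝ, 0 < A ∧ ∃ W : ℝ → E₃ → E₃,
      Pinned C W ∧ Peakless W ∧ |W (-1) 0 2| = |v (-1) 0 2| ∧ EternallyPinned (2 * A) C W := by
  have hcl : IsTypeIAncientMild C v := class_of_pinned hP
  have hN : v (-1) 0 2 ≠ 0 := hP.2.2.2.2.2.1
  have hm0 : 0 < |v (-1) 0 2| := abs_pos.2 hN
  have hpolv : ∀ s < 0, ∀ y, ⟪curl (v s) y, EuclideanSpace.single 2 1⟫_ℝ = 0 := hP.2.2.2.2.1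
  have hdomv : ∀ t < 0, ∀ x, Real.sqrt (-t) * |v t x 2| ≤ |v (-1) 0 2| := hP.2.2.2.2.2.2.1
  obtain ⟨A, hA, hwarmA⟩ := warmWindows_of_not_syndetic hns
  have hβ : ∀ k : ℕ, |v (-1) 0 2| - 1 / ((k : ℝ) + 1) < |v (-1) 0 2| := fun k => by
    have : 0 < 1 / ((k : ℝ) + 1) := by positivity
    linarith
  have hΛ : ∀ k : ℕ, (1 : ℝ) ≤ (k : ℝ) + 1 := fun k => by
    have : (0 : ℝ) ≤ k := Nat.cast_nonneg k
    linarith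
  choose t0 ht0 hwarm using fun k : ℕ => hwarmA _ (hβ k) _ (hΛ k)
  set c : ℕ → ℝ := fun k => Real.sqrt (-(t0 k)) with hc
  have hc0 : ∀ k, 0 < c k := fun k => Real.sqrt_pos.2 (by linarith [ht0 k])
  have hcsq : ∀ k, c k ^ 2 = -(t0 k) := fun k => Real.sq_sqrt (by linarith [ht0 k])
  set w : ℕ → ℝ → E₃ → E₃ := fun k => nsRescale (c k) v with hw
  have hwc : ∀ k, IsTypeIAncientMild C (w k) := fun k => hcl.nsRescale (hc0 k)
  obtain ⟨φ, hφ, V, hV, hpt, hfd, htlu, -⟩ := exists_tendsto_of_isTypeIAncientMild_seq C hwc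
  have hpolV : ∀ s < 0, ∀ y, ⟪curl (V s) y, EuclideanSpace.single 2 1⟫_ℝ = 0 :=
    fun s hs y => PoloidalWindowDoorPoloidalWindowRigidityPoloidalExtremal.poloidal_of_tendsto (hfd s hs y)
      (fun j => PoloidalWindowDoorPoloidalWindowRigidityPoloidalExtremal.poloidal_nsRescale hpolv (hc0 (φ j)) s hs y)
  have hKV : Peakless V :=
    PoloidalWindowDoorPoloidalWindowRigidityHotHullCompactness.peaklessClosed (fun j => w (φ j)) V
      (fun j => PoloidalWindowDoorPoloidalWindowRigidityLeastPinNoPinLoss.peakless_nsRescale hK (hc0 (φ j)))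
      (fun j t ht => ((hwc (φ j)).contDiff_slice ht).continuous) (fun t ht => (hV.contDiff_slice ht).continuous) (fun t ht => htlu t ht)
  have hc2 : Continuous fun x : E₃ => x 2 := by fun_prop
  have hdomV : ∀ t < 0, ∀ x, Real.sqrt (-t) * |V t x 2| ≤ |v (-1) 0 2| := fun t ht x =>
    le_of_tendsto (((continuous_const.mul continuous_abs).tendsto _).comp ((hc2.tendsto _).comp (hpt t ht x)))
      (Eventually.of_forall fun j =>
        PoloidalWindowDoorPoloidalWindowRigidityEternalCoreScalingCore.extremal_nsRescale hdomv (hc0 (φ j)) t ht x)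
  have hkey : ∀ t : ℝ, t ≤ -1 → ∃ x : E₃, ‖x‖ ≤ A * Real.sqrt (-t) ∧ Real.sqrt (-t) * |V t x 2| = |v (-1) 0 2| := by
    intro t ht1
    have ht : t < 0 := by linarith
    have hst : 0 < Real.sqrt (-t) := Real.sqrt_pos.2 (neg_pos.2 ht)
    set K : Set (E₃) := Metric.closedBall 0 (A * Real.sqrt (-t)) with hKdef
    have hKc : IsCompact K := isCompact_closedBall _ _
    have hKne : K.Nonempty := ⟨0, Metric.mem_closedBall_self (by positivity)⟩
    set f : E₃ → ℝ := fun y => Real.sqrt (-t) * |V t y 2| with hf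
    have hfc : Continuous f := continuous_const.mul (continuous_abs.comp (hc2.comp (hV.contDiff_slice ht).continuous))
    obtain ⟨xs, hxsK, hmax⟩ := hKc.exists_isMaxOn hKne hfc.continuousOn
    have hxs_norm : ‖xs‖ ≤ A * Real.sqrt (-t) := mem_closedBall_zero_iff.1 hxsK
    refine ⟨xs, hxs_norm, le_antisymm (hdomV t ht xs) ?_⟩
    by_contra hlt
    push Not at hlt
    set η : ℝ := (|v (-1) 0 2| - Real.sqrt (-t) * |V t xs 2|) / 3 with hη
    have hη0 : 0 < η := by
      have : 0 < |v (-1) 0 2| - Real.sqrt (-t) * |V t xs 2| := sub_pos.2 hlt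
      rw [hη]; positivity
    have hunif : TendstoUniformlyOn (fun j => w (φ j) t) (V t) atTop K :=
      (tendstoLocallyUniformlyOn_iff_tendstoUniformlyOn_of_compact hKc).1 (htlu t ht).tendstoLocallyUniformlyOn
    have hev1 : ∀ᶠ j in atTop, ∀ y ∈ K, dist (V t y) (w (φ j) t y) < η / Real.sqrt (-t) :=
      Metric.tendstoUniformlyOn_iff.1 hunif _ (div_pos hη0 hst)
    have hφr : Tendsto (fun j => ((φ j : ℕ) : ℝ) + 1) atTop atTop :=
      tendsto_atTop_add_const_right _ 1 (tendsto_natCast_atTop_atTop.comp hφ.tendsto_atTop)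
    have hev2 : ∀ᶠ j in atTop, -t ≤ ((φ j : ℕ) : ℝ) + 1 := hφr.eventually_ge_atTop (-t)
    have hev3 : ∀ᶠ j in atTop, 1 / (((φ j : ℕ) : ℝ) + 1) < η := by
      filter_upwards [hφr.eventually_gt_atTop (1 / η)] with j hj
      have hpos : 0 < ((φ j : ℕ) : ℝ) + 1 := by positivity
      exact (one_div_lt hη0 hpos).1 hj
    obtain ⟨j, hj1, hj2, hj3⟩ := (hev1.and (hev2.and hev3)).exists
    have hcj : 0 < c (φ j) := hc0 _
    have ha : 0 < -(t0 (φ j)) := by linarith [ht0 (φ j)]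
    have hwin : c (φ j) ^ 2 * t ∈ Set.Icc ((((φ j : ℕ) : ℝ) + 1) * t0 (φ j)) (t0 (φ j)) := by
      rw [hcsq]
      constructor
      · nlinarith [mul_nonneg (sub_nonneg.2 hj2) ha.le]
      · nlinarith [mul_nonneg (show (0 : ℝ) ≤ -1 - t by linarith) ha.le]
    obtain ⟨x, hxA, hxpin⟩ := hwarm (φ j) _ hwin
    have hsq : Real.sqrt (-(c (φ j) ^ 2 * t)) = c (φ j) * Real.sqrt (-t) :=
      PoloidalWindowDoorPoloidalWindowRigidityEternalCoreScalingCore.sqrt_neg_sq_mul hcj.le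
    set y : E₃ := (c (φ j))⁻¹ • x with hy
    have hyK : y ∈ K := by
      rw [hKdef, mem_closedBall_zero_iff, hy, norm_smul, norm_inv, Real.norm_eq_abs, abs_of_pos hcj, inv_mul_le_iff₀ hcj]
      rw [hsq] at hxA
      calc ‖x‖ ≤ A * (c (φ j) * Real.sqrt (-t)) := hxA
        _ = c (φ j) * (A * Real.sqrt (-t)) := by ring
    have h3 : c (φ j) • y = x := by rw [hy, smul_smul, mul_inv_cancel₀ hcj.ne', one_smul]
    have hwy : w (φ j) t y 2 = c (φ j) * v (c (φ j) ^ 2 * t) x 2 := by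
      simp only [hw, nsRescale_apply, h3, PiLp.smul_apply, smul_eq_mul]
    have hwval : |v (-1) 0 2| - η < Real.sqrt (-t) * |w (φ j) t y 2| := by
      rw [hwy, abs_mul, abs_of_pos hcj, ← mul_assoc, mul_comm (Real.sqrt (-t)) (c (φ j)), ← hsq]
      linarith [hxpin, hj3]
    have hd : dist (V t y) (w (φ j) t y) < η / Real.sqrt (-t) := hj1 y hyK
    have hcomp : |V t y 2 - w (φ j) t y 2| < η / Real.sqrt (-t) := (abs_apply_two_sub_le_dist _ _).trans_lt hd
    have h2 : Real.sqrt (-t) * |V t y 2 - w (φ j) t y 2| < η := by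
      have h := mul_lt_mul_of_pos_left hcomp hst
      have e : Real.sqrt (-t) * (η / Real.sqrt (-t)) = η := by field_simp
      rwa [e] at h
    have h1 : |w (φ j) t y 2| ≤ |V t y 2| + |V t y 2 - w (φ j) t y 2| := by
      have := abs_sub_abs_le_abs_sub (w (φ j) t y 2) (V t y 2)
      rw [abs_sub_comm] at this
      linarith
    have hVy : |v (-1) 0 2| - 2 * η < f y := by
      have h4 : Real.sqrt (-t) * |w (φ j) t y 2| ≤ Real.sqrt (-t) * |V t y 2| + Real.sqrt (-t) * |V t y 2 - w (φ j) t y 2| := by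
        have := mul_le_mul_of_nonneg_left h1 hst.le
        rwa [mul_add] at this
      show |v (-1) 0 2| - 2 * η < Real.sqrt (-t) * |V t y 2|
      linarith
    have hfy : f y ≤ f xs := hmax hyK
    have hfxs : f xs = |v (-1) 0 2| - 3 * η := by
      show Real.sqrt (-t) * |V t xs 2| = |v (-1) 0 2| - 3 * ((|v (-1) 0 2| - Real.sqrt (-t) * |V t xs 2|) / 3)
      ring
    linarith
  obtain ⟨y₀, hy₀A, hy₀val⟩ := hkey (-1) le_rfl
  have hs1 : Real.sqrt (-(-1 : ℝ)) = 1 := by norm_num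
  rw [hs1, mul_one] at hy₀A
  rw [hs1, one_mul] at hy₀val
  have hy₀val' : Real.sqrt (-(-1 : ℝ)) * |V (-1) y₀ 2| = |v (-1) 0 2| := by rw [hs1, one_mul]; exact hy₀val
  obtain ⟨hPW1, habs1⟩ := pinned_recentre hV hpolV hdomV hm0 (by norm_num : (-1 : ℝ) < 0) hy₀val'
  set W : ℝ → E₃ → E₃ := fun s y => V s (y₀ + y) with hWdef
  have hWeq : nsRescale (Real.sqrt (-(-1 : ℝ))) (fun s y => V s (y₀ + y)) = W := by rw [hs1, nsRescale_one]
  rw [hWeq] at hPW1 habs1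
  have hKW1 : Peakless W := by
    have h := peakless_recentre hKV (by norm_num : (0 : ℝ) < 1) y₀
    rwa [nsRescale_one] at h
  refine ⟨A, hA, W, hPW1, hKW1, habs1, fun t ht => ?_⟩
  have ht0 : t < 0 := by linarith
  obtain ⟨xs, hxsA, hxsval⟩ := hkey t ht
  have hst1 : 1 ≤ Real.sqrt (-t) := by
    rw [show (1 : ℝ) = Real.sqrt 1 from Real.sqrt_one.symm]
    exact Real.sqrt_le_sqrt (by linarith)
  refine ⟨xs - y₀, ?_, ?_, ?_⟩
  · calc ‖xs - y₀‖ ≤ ‖xs‖ + ‖y₀‖ := norm_sub_le _ _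
      _ ≤ A * Real.sqrt (-t) + A := add_le_add hxsA hy₀A
      _ ≤ 2 * A * Real.sqrt (-t) := by nlinarith [hA, hst1]
  · have e : W t (xs - y₀) = V t xs := by simp only [hWdef, add_sub_cancel]
    rw [e, habs1]; exact hxsval
  · have hpolW : ∀ s < 0, ∀ y, ⟪curl (W s) y, EuclideanSpace.single 2 1⟫_ℝ = 0 :=
      PoloidalWindowDoorPoloidalWindowRigidityPoloidalExtremal.poloidal_translate hpolV y₀
    have hdomW : ∀ s < 0, ∀ y, Real.sqrt (-s) * |W s y 2| ≤ |v (-1) 0 2| := fun s hs y => hdomV s hs (y₀ + y)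
    have hvalW : Real.sqrt (-t) * |W t (xs - y₀) 2| = |v (-1) 0 2| := by
      have e : W t (xs - y₀) = V t xs := by simp only [hWdef, add_sub_cancel]
      rw [e]; exact hxsval
    exact (pinned_recentre (isTypeIAncientMild_translate hV y₀) hpolW hdomW hm0 ht0 hvalW).1

theorem syndetic_or_eternalWeb {C : ℝ} {v : ℝ → E₃ → E₃} (hP : Pinned C v) (hK : Peakless v) :
    SyndeticBreathing v ∨ ∃ A : ℝ, 0 < A ∧ ∃ W : ℝ → E₃ → E₃,
      Pinned C W ∧ Peakless W ∧ |W (-1) 0 2| = |v (-1) 0 2| ∧ EternallyPinned (2 * A) C W := by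
  by_cases h : SyndeticBreathing v
  · exact Or.inl h
  · exact Or.inr (eternalWeb_of_not_syndetic hP hK h)

theorem syndetic_portrait {v : ℝ → E₃ → E₃} (hS : SyndeticBreathing v) (hSWP : ScaleWindowPin v)
    {A η : ℝ} (hA : 0 < A) (hη : 0 < η) :
    ∃ β : ℝ, β < |v (-1) 0 2| ∧ ∃ Λ : ℝ, 1 ≤ Λ ∧ ∀ t₀ : ℝ, t₀ ≤ -1 →
      (∃ t ∈ Set.Icc (Λ * t₀) t₀, ∀ x : E₃, ‖x‖ ≤ A * Real.sqrt (-t) → Real.sqrt (-t) * |v t x 2| ≤ β) ∧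
      (∃ t ∈ Set.Icc (Λ * t₀) t₀, ∃ x : E₃, ‖x‖ ≤ Λ * Real.sqrt (-t) ∧ |v (-1) 0 2| - η < Real.sqrt (-t) * |v t x 2|) := by
  obtain ⟨β, hβ, Λ, hΛ, hcold⟩ := hS A hA
  obtain ⟨Λ', hΛ', hhot⟩ := hSWP η hη
  refine ⟨β, hβ, max Λ Λ', le_max_of_le_left hΛ, fun t₀ ht₀ => ⟨?_, ?_⟩⟩
  · obtain ⟨t, ht, hc⟩ := hcold t₀ ht₀
    refine ⟨t, ⟨?_, ht.2⟩, hc⟩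
    have h1 : Λ * t₀ ≤ t := ht.1
    have h2 : max Λ Λ' * t₀ ≤ Λ * t₀ := by nlinarith [le_max_left Λ Λ', ht₀]
    linarith
  · obtain ⟨t, ht, x, hx, hv⟩ := hhot t₀ ht₀
    refine ⟨t, ⟨?_, ht.2⟩, x, ?_, hv⟩
    · have h1 : Λ' * t₀ ≤ t := ht.1
      have h2 : max Λ Λ' * t₀ ≤ Λ' * t₀ := by nlinarith [le_max_right Λ Λ', ht₀]
      linarith
    · exact hx.trans (mul_le_mul_of_nonneg_right (le_max_right Λ Λ') (Real.sqrt_nonneg _))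

/-! ## §24 The research cell SYNDETIC-BREATHING (OPEN, NEW — supersedes LINE 26's cell BREATHING) and the kernels … -/

/-- **Research cell SYNDETIC-BREATHING (OPEN).** Kill a least-pin critical element of … -/
def CellSyndeticBreathing : Prop :=
  AnisotropicGap → VerticalCore →
  ∀ (C : ℝ) (v : ℝ → E₃ → E₃) (W : Set (ℝ × E₃)),
    Pinned C v → ThickWindow v W → Peakless v → LeastPin C v → NoPinLoss C v → PastPin C v → ScaleWindowPin v →
    SyndeticBreathing v → False

theorem cellBreathing_of_syndetic (hTH : THGerm) (hweb : CellEternalWeb) (hsb : CellSyndeticBreathing) : CellBreathing := by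
  intro hAG hVC C v W hP hW hK hL hNPL hPP hSWP _hB
  by_cases hS : SyndeticBreathing v
  · exact hsb hAG hVC C v W hP hW hK hL hNPL hPP hSWP hS
  · obtain ⟨A, hA, W', hPW', hKW', habs, hEP⟩ := eternalWeb_of_not_syndetic hP hK hS
    have hLW' : LeastPin C W' := fun v'' hP'' hK'' => habs ▸ hL v'' hP'' hK''
    have hNPLW' : NoPinLoss C W' := stub_noPinLoss hAG C W' hPW' hKW' hLW'
    have hPPW' : PastPin C W' := fun V hV hpol hKV hdom hnz => pastPin hPW'.2.2.2.2.2.1 hNPLW' hV hpol hKV hdom hnz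
    have hSWPW' : ScaleWindowPin W' := scaleWindowPin_of_noPinLoss hPW' hKW' hNPLW'
    obtain ⟨W'', hW''⟩ := thickWindow_of_dense thickDense_holds hTH hPW'
    exact hweb hAG C (2 * A) W' W'' hPW' hW'' hKW' hLW' hNPLW' hPPW' hSWPW' (by linarith) hEP

theorem cellEternalPin_of_webCells (hTH : THGerm) (hVC : VerticalCore) (hweb : CellEternalWeb) (hsb : CellSyndeticBreathing) : CellEternalPin :=
  cellEternalPin_of_cells hTH hVC hweb (cellBreathing_of_syndetic hTH hweb hsb)

theorem cellEternalPin_of_webCellsStub (hTH : THGerm) (hweb : CellEternalWeb) (hsb : CellSyndeticBreathing) : CellEternalPin :=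
  cellEternalPin_of_webCells hTH stub_verticalCore hweb hsb

/-! ## §25 Compositions to the crux items BY NAME (CONDITIONAL on S0, the wall ⟨27893⟩, the hand U4b and the two … -/

theorem PoloidalWindowRigidity_of_webCells (hS0 : S0Statement)
    (hG : Summit.NavierStokesRegularity.NavierStokesRegularity.Theses.LoopPeriodRatchet.FrequencyGrowthExponent)
    (hVC : VerticalCore) (hweb : CellEternalWeb) (hsb : CellSyndeticBreathing) :
    Summit.NavierStokesRegularity.NavierStokesRegularity.Theses.PoloidalWindowDoor.PoloidalWindowRigidity :=
  PoloidalWindowRigidity_of_eternalPin hS0 hG (cellEternalPin_of_webCells (thGerm_of_S0 hS0) hVC hweb hsb)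

theorem LrcModEntire_of_webCells (hS0 : S0Statement)
    (hG : Summit.NavierStokesRegularity.NavierStokesRegularity.Theses.LoopPeriodRatchet.FrequencyGrowthExponent)
    (hVC : VerticalCore) (hweb : CellEternalWeb) (hsb : CellSyndeticBreathing) :
    Summit.NavierStokesRegularity.NavierStokesRegularity.Theses.PoloidalWindowDoor.LrcModEntire :=
  LrcModEntire_of_eternalPin hS0 hG (cellEternalPin_of_webCells (thGerm_of_S0 hS0) hVC hweb hsb)

/-! ## §26 LINE 28 `near_one` — DISCRETE SELF-SIMILARITY ABOUT THE BLOW-UP POINT: the objects and their algebra (NEW) -/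

/-- **`IsDss lam v`** — `v` is backward DISCRETELY SELF-SIMILAR with factor `lam` about … -/
def IsDss (lam : ℝ) (v : ℝ → E₃ → E₃) : Prop :=
  ∀ t < 0, ∀ x, v t x = lam • v (lam ^ 2 * t) (lam • x)

/-- **`IsDssAbout c lam v`** — DSS with factor `lam` about the space–time point `(0,` … -/
def IsDssAbout (c : E₃) (lam : ℝ) (v : ℝ → E₃ → E₃) : Prop :=
  ∀ t < 0, ∀ x, v t x = lam • v (lam ^ 2 * t) (c + lam • (x - c))

theorem isDssAbout_zero_iff {lam : ℝ} {v : ℝ → E₃ → E₃} : IsDssAbout 0 lam v ↔ IsDss lam v := by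
  simp [IsDssAbout, IsDss]

theorem isDss_translate_of_isDssAbout {c : E₃} {lam : ℝ} {v : ℝ → E₃ → E₃}
    (h : IsDssAbout c lam v) : IsDss lam (fun t x => v t (x + c)) := by
  intro t ht x
  show v t (x + c) = lam • v (lam ^ 2 * t) (lam • x + c)
  rw [h t ht (x + c), add_sub_cancel_right, add_comm]

theorem isDssAbout_of_isDss_translate {c : E₃} {lam : ℝ} {v : ℝ → E₃ → E₃}
    (h : IsDss lam (fun t x => v t (x + c))) : IsDssAbout c lam v := by
  intro t ht x
  have key : v t (x - c + c) = lam • v (lam ^ 2 * t) (lam • (x - c) + c) := h t ht (x - c)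
  rw [sub_add_cancel] at key
  rw [key, add_comm]

theorem isDssAbout_iff_translate {c : E₃} {lam : ℝ} {v : ℝ → E₃ → E₃} :
    IsDssAbout c lam v ↔ IsDss lam (fun t x => v t (x + c)) :=
  ⟨isDss_translate_of_isDssAbout, isDssAbout_of_isDss_translate⟩

theorem isDss_one (v : ℝ → E₃ → E₃) : IsDss 1 v := fun t _ x => by simp

theorem IsDss.mul {a b : ℝ} {v : ℝ → E₃ → E₃} (hva : IsDss a v) (ha : 0 < a) (hvb : IsDss b v) :
    IsDss (a * b) v := by
  intro t ht x
  have hat : a ^ 2 * t < 0 := mul_neg_of_pos_of_neg (pow_pos ha 2) ht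
  rw [hva t ht x, hvb (a ^ 2 * t) hat (a • x), smul_smul, smul_smul]
  have e1 : b ^ 2 * (a ^ 2 * t) = (a * b) ^ 2 * t := by ring
  rw [e1, mul_comm b a]

theorem IsDss.inv {a : ℝ} {v : ℝ → E₃ → E₃} (hv : IsDss a v) (ha : 0 < a) : IsDss a⁻¹ v := by
  intro t ht x
  have hat : a⁻¹ ^ 2 * t < 0 := mul_neg_of_pos_of_neg (pow_pos (inv_pos.2 ha) 2) ht
  have key := hv (a⁻¹ ^ 2 * t) hat (a⁻¹ • x)
  have e1 : a ^ 2 * (a⁻¹ ^ 2 * t) = t := by field_simp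
  rw [e1, smul_smul, mul_inv_cancel₀ ha.ne', one_smul] at key
  rw [key, smul_smul, inv_mul_cancel₀ ha.ne', one_smul]

theorem IsDss.pow {a : ℝ} {v : ℝ → E₃ → E₃} (hv : IsDss a v) (ha : 0 < a) : ∀ k : ℕ, IsDss (a ^ k) v
  | 0 => by simpa using isDss_one v
  | k + 1 => by
      rw [pow_succ]
      exact (IsDss.pow hv ha k).mul (pow_pos ha k) hv

theorem IsDss.zpow {a : ℝ} {v : ℝ → E₃ → E₃} (hv : IsDss a v) (ha : 0 < a) : ∀ k : ℤ, IsDss (a ^ k) v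
  | (n : ℕ) => by
      rw [zpow_natCast]
      exact hv.pow ha n
  | Int.negSucc n => by
      rw [zpow_negSucc]
      exact (hv.pow ha (n + 1)).inv (pow_pos ha _)

theorem isDss_of_tendsto {v : ℝ → E₃ → E₃}
    (hcont : ContinuousOn (Function.uncurry v) (Set.Iio (0 : ℝ) ×ˢ Set.univ)) {c : ℕ → ℝ} {c₀ : ℝ} (hc₀ : 0 < c₀)
    (hlim : Tendsto c atTop (𝓝 c₀)) (hd : ∀ n, IsDss (c n) v) : IsDss c₀ v := by
  intro t ht x
  have hpt : ContinuousAt (Function.uncurry v) (c₀ ^ 2 * t, c₀ • x) :=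
    hcont.continuousAt ((isOpen_Iio.prod isOpen_univ).mem_nhds
      (Set.mem_prod.2 ⟨mul_neg_of_pos_of_neg (pow_pos hc₀ 2) ht, Set.mem_univ _⟩))
  have h1 : Tendsto (fun n => ((c n) ^ 2 * t, c n • x)) atTop (𝓝 (c₀ ^ 2 * t, c₀ • x)) :=
    ((hlim.pow 2).mul_const t).prodMk_nhds (hlim.smul_const x)
  have h2 : Tendsto (fun n => v ((c n) ^ 2 * t) (c n • x)) atTop (𝓝 (v (c₀ ^ 2 * t) (c₀ • x))) := hpt.tendsto.comp h1
  have h3 : Tendsto (fun n => c n • v ((c n) ^ 2 * t) (c n • x)) atTop (𝓝 (c₀ • v (c₀ ^ 2 * t) (c₀ • x))) := hlim.smul h2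
  have h4 : (fun n => c n • v ((c n) ^ 2 * t) (c n • x)) = fun _ => v t x := funext fun n => (hd n t ht x).symm
  rw [h4, tendsto_const_nhds_iff] at h3
  exact h3

/-! ## §27 THE NEAR-ONE FLOOR WITHOUT SPATIAL DECAY (PROVED): Chae–Wolf's Step 2 in the mild Type-I class, the decay … -/

theorem scaleInvariant_of_limit (C : ℝ) {vs : ℕ → ℝ → E₃ → E₃}
    {U : ℝ → E₃ → E₃} {lams : ℕ → ℝ}
    (hrate : ∀ j, HasTypeITimeDecay C (vs j)) (hcont : ∀ j, ContinuousOn (Function.uncurry (vs j)) (Set.Iio (0 : ℝ) ×ˢ Set.univ))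
    (hmild : ∀ j, ∀ s t : ℝ, s < t → t < 0 → ∀ x, vs j t x =
      UnboundedOperators.heatExtension (vs j s) (t - s) x - oseenDuhamel 1 s (vs j) (vs j) t x)
    (hdiv : ∀ j, ∀ t < 0, VectorCalculus.IsDivFree (vs j t))
    (hconv : ∀ t < 0, ∀ x, Tendsto (fun j => vs j t x) atTop (𝓝 (U t x)))
    (hdss : ∀ j, IsDss (lams j) (vs j)) (hgt : ∀ j, 1 < lams j) (hlim : Tendsto lams atTop (𝓝 1)) :
    ∀ mu : ℝ, 0 < mu → IsDss mu U := by
  classical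
  have stepA : ∀ mu : ℝ, 1 ≤ mu → IsDss mu U := by
    intro mu hmu t ht x
    have hmu0 : 0 < mu := by linarith
    have hex : ∀ j, ∃ k : ℕ, mu < lams j ^ (k + 1) := fun j => by
      obtain ⟨n, hn⟩ := pow_unbounded_of_one_lt mu (hgt j)
      exact ⟨n, hn.trans_le (pow_le_pow_right₀ (hgt j).le (Nat.le_succ n))⟩
    let k : ℕ → ℕ := fun j => Nat.find (hex j)
    have hk1 : ∀ j, mu < lams j ^ (k j + 1) := fun j => Nat.find_spec (hex j)
    have hk2 : ∀ j, lams j ^ (k j) ≤ mu := by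
      intro j
      rcases Nat.eq_zero_or_pos (k j) with h0 | hpos
      · rw [h0, pow_zero]; exact hmu
      · have hmin : ¬ (mu < lams j ^ (k j - 1 + 1)) := Nat.find_min (hex j) (Nat.sub_lt hpos Nat.one_pos)
        rw [Nat.sub_add_cancel hpos] at hmin
        exact not_lt.1 hmin
    set mus : ℕ → ℝ := fun j => lams j ^ (k j) with hmus
    have hl0 : ∀ j, 0 < lams j := fun j => by linarith [hgt j]
    have hmus_le : ∀ j, mus j ≤ mu := hk2
    have hmus_ge : ∀ j, mu / lams j ≤ mus j := by
      intro j
      rw [div_le_iff₀ (hl0 j)]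
      have := hk1 j
      rw [pow_succ] at this
      exact this.le
    have hmus_lim : Tendsto mus atTop (𝓝 mu) := by
      have h1 : Tendsto (fun j => mu / lams j) atTop (𝓝 mu) := by
        have h := (tendsto_const_nhds (x := mu)).div hlim one_ne_zero
        rw [div_one] at h
        exact h
      exact tendsto_of_tendsto_of_tendsto_of_le_of_le h1 tendsto_const_nhds hmus_ge hmus_le
    have hd : ∀ j, IsDss (mus j) (vs j) := fun j => (hdss j).pow (hl0 j) (k j)
    set T : ℝ := mu ^ 2 * t with hT
    have hT0 : T < 0 := mul_neg_of_pos_of_neg (pow_pos hmu0 2) ht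
    set R : ℝ := max 1 (max (-T) (4 / (-T))) with hR
    have hR1 : 1 ≤ R := le_max_left _ _
    have hRT : -R ≤ T := by have := le_max_left (-T) (4 / (-T)); have := le_max_right 1 (max (-T) (4 / (-T))); linarith
    have hRinv : T / 4 ≤ -R⁻¹ := by
      have h4 : 4 / (-T) ≤ R := (le_max_right _ _).trans (le_max_right _ _)
      have hR0 : 0 < R := by linarith
      have h5 : R⁻¹ ≤ (-T) / 4 := by
        rw [inv_le_comm₀ hR0 (by linarith), inv_div]
        exact h4
      linarith
    obtain ⟨M, hM0, hM⟩ := PoloidalWindowDoorPoloidalWindowRigidityHotHullSlabUniform.exists_uniform_slab_modulus C hR1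
    have hTmem : T ∈ Set.Icc (-R) (-R⁻¹) := ⟨hRT, by linarith⟩
    have hev : ∀ᶠ j in atTop, mu / 2 < mus j := hmus_lim.eventually (lt_mem_nhds (by linarith))
    have hmem : ∀ᶠ j in atTop, mus j ^ 2 * t ∈ Set.Icc (-R) (-R⁻¹) := by
      filter_upwards [hev] with j hj
      have hmj0 : 0 < mus j := by linarith
      have hsq_le : mus j ^ 2 ≤ mu ^ 2 := pow_le_pow_left₀ hmj0.le (hmus_le j) 2
      have hsq_ge : (mu / 2) ^ 2 ≤ mus j ^ 2 := pow_le_pow_left₀ (by linarith) hj.le 2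
      constructor
      · nlinarith
      · nlinarith
    have hAB : Tendsto (fun j => vs j (mus j ^ 2 * t) (mus j • x) - vs j T (mu • x)) atTop (𝓝 0) := by
      have hbound : ∀ᶠ j in atTop, ‖vs j (mus j ^ 2 * t) (mus j • x) - vs j T (mu • x)‖ ≤
          M * (|mus j ^ 2 * t - T| + ‖mus j • x - mu • x‖) := by
        filter_upwards [hmem] with j hj
        exact hM (hrate j) (hcont j) (hmild j) (hdiv j) _ hj _ hTmem _ _
      have hlim0 : Tendsto (fun j => M * (|mus j ^ 2 * t - T| + ‖mus j • x - mu • x‖)) atTop (𝓝 0) := by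
        have h1 : Tendsto (fun j => mus j ^ 2 * t - T) atTop (𝓝 (mu ^ 2 * t - T)) := ((hmus_lim.pow 2).mul_const t).sub_const T
        have h2 : Tendsto (fun j => mus j • x - mu • x) atTop (𝓝 (mu • x - mu • x)) := (hmus_lim.smul_const x).sub_const (mu • x)
        have h3 := (h1.abs.add h2.norm).const_mul M
        simpa [hT] using h3
      exact squeeze_zero_norm' hbound hlim0
    have hB : Tendsto (fun j => vs j T (mu • x)) atTop (𝓝 (U T (mu • x))) := hconv T hT0 (mu • x)
    have hA : Tendsto (fun j => vs j (mus j ^ 2 * t) (mus j • x)) atTop (𝓝 (U T (mu • x))) := by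
      have h := hAB.add hB
      simp only [sub_add_cancel, zero_add] at h
      exact h
    have h5 : Tendsto (fun j => vs j t x) atTop (𝓝 (mu • U T (mu • x))) := by
      have e : (fun j => vs j t x) = fun j => mus j • vs j (mus j ^ 2 * t) (mus j • x) := funext fun j => hd j t ht x
      rw [e]
      exact hmus_lim.smul hA
    exact tendsto_nhds_unique (hconv t ht x) h5
  intro mu hmu
  by_cases h1 : 1 ≤ mu
  · exact stepA mu h1
  · have hinv : 1 ≤ mu⁻¹ := (one_le_inv₀ hmu).2 (not_le.1 h1).le
    have := (stepA mu⁻¹ hinv).inv (inv_pos.2 hmu)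
    rwa [inv_inv] at this

theorem nearOne_anchor (C A a : ℝ) (ha : 0 < a) :
    ∃ lamStar : ℝ, 1 < lamStar ∧ ∀ (v : ℝ → E₃ → E₃) (lam : ℝ) (x₀ : E₃),
      HasTypeITimeDecay C v → ContinuousOn (Function.uncurry v) (Set.Iio (0 : ℝ) ×ˢ Set.univ) →
      (∀ s t : ℝ, s < t → t < 0 → ∀ x, v t x = UnboundedOperators.heatExtension (v s) (t - s) x - oseenDuhamel 1 s v v t x) →
      (∀ t < 0, VectorCalculus.IsDivFree (v t)) →
      ‖x₀‖ ≤ A → a ≤ ‖v (-1) x₀‖ → 1 < lam → lam < lamStar → IsDss lam v → False := by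
  by_contra hcon
  have hseq : ∀ n : ℕ, ∃ (v : ℝ → E₃ → E₃) (lam : ℝ) (x₀ : E₃),
      HasTypeITimeDecay C v ∧ ContinuousOn (Function.uncurry v) (Set.Iio (0 : ℝ) ×ˢ Set.univ) ∧
      (∀ s t : ℝ, s < t → t < 0 → ∀ x, v t x = UnboundedOperators.heatExtension (v s) (t - s) x - oseenDuhamel 1 s v v t x) ∧
      (∀ t < 0, VectorCalculus.IsDivFree (v t)) ∧
      ‖x₀‖ ≤ A ∧ a ≤ ‖v (-1) x₀‖ ∧ 1 < lam ∧ lam < 1 + 1 / ((n : ℝ) + 1) ∧ IsDss lam v := by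
    intro n
    by_contra hn
    push Not at hn
    have hpos : (1 : ℝ) < 1 + 1 / ((n : ℝ) + 1) := by
      have : (0 : ℝ) < 1 / ((n : ℝ) + 1) := by positivity
      linarith
    exact hcon ⟨1 + 1 / ((n : ℝ) + 1), hpos, fun v lam x₀ h1 h2 h3 h4 h5 h6 h7 h8 h9 => hn v lam x₀ h1 h2 h3 h4 h5 h6 h7 h8 h9⟩
  choose vs lams xs hrate hcont hmild hdiv hxs hanc hgt hlt hdss using hseq
  have hw : ∀ n, IsTypeIAncientMild C (vs n) := fun n =>
    PoloidalWindowDoorPoloidalWindowRigidityWindow.isTypeIAncientMild_of_class (hrate n) (hcont n) (hmild n) (hdiv n)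
  obtain ⟨φ, hφ, W, hW, hpt, hfd, htlu, htlufd⟩ := exists_tendsto_of_isTypeIAncientMild_seq C hw
  obtain ⟨xinf, hxinf, ψ, hψ, hxlim⟩ :=
    (isCompact_closedBall (0 : E₃) A).tendsto_subseq (fun n => mem_closedBall_zero_iff.2 (hxs (φ n)))
  have hrateW : HasTypeITimeDecay C W := hW.2.2.2
  have hcontW : ContinuousOn (Function.uncurry W) (Set.Iio (0 : ℝ) ×ˢ Set.univ) := hW.1.continuousOn
  have hmildW : ∀ s t : ℝ, s < t → t < 0 → ∀ x, W t x =
      UnboundedOperators.heatExtension (W s) (t - s) x - oseenDuhamel 1 s W W t x :=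
    fun s t hst ht x => hW.mild_eq_heatExtension hst ht x
  have hdivW : ∀ t < 0, VectorCalculus.IsDivFree (W t) := hW.2.1
  have hsub : Tendsto (fun j => φ (ψ j)) atTop atTop := (hφ.comp hψ).tendsto_atTop
  have hl1 : Tendsto (fun j => lams (φ (ψ j))) atTop (𝓝 1) := by
    have h0 : Tendsto (fun j => 1 + 1 / (((φ (ψ j) : ℕ) : ℝ) + 1)) atTop (𝓝 (1 + 0)) :=
      tendsto_const_nhds.add (tendsto_one_div_add_atTop_nhds_zero_nat.comp hsub)
    rw [add_zero] at h0
    exact tendsto_of_tendsto_of_tendsto_of_le_of_le tendsto_const_nhds h0 (fun j => (hgt _).le) (fun j => (hlt _).le)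
  have hsc : ∀ mu : ℝ, 0 < mu → IsDss mu W :=
    scaleInvariant_of_limit C (vs := fun j => vs (φ (ψ j))) (lams := fun j => lams (φ (ψ j)))
      (fun j => hrate _) (fun j => hcont _) (fun j => hmild _) (fun j => hdiv _)
      (fun t ht x => (hpt t ht x).comp hψ.tendsto_atTop) (fun j => hdss _) (fun j => hgt _) hl1
  have hW0 : ∀ t < 0, ∀ x, W t x = 0 :=
    PoloidalWindowDoorPoloidalWindowRigidityStrata.eq_zero_of_scaleInvariant hrateW hcontW hmildW hdivW
      (fun lam hlam s hs y => (hsc lam hlam s hs y).symm)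
  obtain ⟨M, hM0, hM⟩ := PoloidalWindowDoorPoloidalWindowRigidityHotHullSlabUniform.exists_uniform_slab_modulus C (le_refl (1 : ℝ))
  have hm1 : (-1 : ℝ) ∈ Set.Icc (-(1 : ℝ)) (-(1 : ℝ)⁻¹) := by norm_num
  have hdiff : Tendsto (fun j => vs (φ (ψ j)) (-1) (xs (φ (ψ j))) - vs (φ (ψ j)) (-1) xinf) atTop (𝓝 0) := by
    have hbound : ∀ j, ‖vs (φ (ψ j)) (-1) (xs (φ (ψ j))) - vs (φ (ψ j)) (-1) xinf‖ ≤ M * (|(-1 : ℝ) - (-1)| + ‖xs (φ (ψ j)) - xinf‖) :=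
      fun j => hM (hrate _) (hcont _) (hmild _) (hdiv _) _ hm1 _ hm1 _ _
    have hlim0 : Tendsto (fun j => M * (|(-1 : ℝ) - (-1)| + ‖xs (φ (ψ j)) - xinf‖)) atTop (𝓝 0) := by
      have h2 : Tendsto (fun j => xs (φ (ψ j)) - xinf) atTop (𝓝 (xinf - xinf)) := hxlim.sub_const xinf
      have h3 := (h2.norm).const_mul M
      simpa using h3
    exact squeeze_zero_norm' (Eventually.of_forall hbound) hlim0
  have hB : Tendsto (fun j => vs (φ (ψ j)) (-1) xinf) atTop (𝓝 (W (-1) xinf)) := (hpt (-1) (by norm_num) xinf).comp hψ.tendsto_atTop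
  have hA : Tendsto (fun j => vs (φ (ψ j)) (-1) (xs (φ (ψ j)))) atTop (𝓝 (W (-1) xinf)) := by
    have h := hdiff.add hB
    simp only [sub_add_cancel, zero_add] at h
    exact h
  have hge : a ≤ ‖W (-1) xinf‖ := ge_of_tendsto hA.norm (Eventually.of_forall fun j => hanc _)
  rw [hW0 (-1) (by norm_num) xinf, norm_zero] at hge
  exact absurd hge (not_le.2 ha)

theorem nearOne_pinned (hAG : AnisotropicGap) (C B : ℝ) :
    ∃ lamStar : ℝ, 1 < lamStar ∧ ∀ (v : ℝ → E₃ → E₃) (lam : ℝ) (c : E₃),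
      Pinned C v → ‖c‖ ≤ B → 1 < lam → lam < lamStar → IsDssAbout c lam v → False := by
  obtain ⟨δ, hδ, hpin⟩ := pin_lower_bound hAG C
  obtain ⟨lamStar, h1, H⟩ := nearOne_anchor C B δ hδ
  refine ⟨lamStar, h1, fun v lam c hP hc hlam hlt hd => ?_⟩
  have hw : IsTypeIAncientMild C (fun t x => v t (x + c)) := (class_of_pinned hP).comp_add_right c
  refine H (fun t x => v t (x + c)) lam (-c) hw.2.2.2 hw.1.continuousOn (fun s t hst ht x => hw.mild_eq_heatExtension hst ht x) hw.2.1
    (by rwa [norm_neg]) ?_ hlam hlt (isDss_translate_of_isDssAbout hd)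
  show δ ≤ ‖v (-1) (-c + c)‖
  rw [neg_add_cancel]
  exact (hpin v hP).trans (absN_le_norm v)

theorem not_selfSimilar_pinned {C : ℝ} {v : ℝ → E₃ → E₃} {c : E₃}
    (hP : Pinned C v) (hss : ∀ lam : ℝ, 0 < lam → IsDssAbout c lam v) : False := by
  have hw : IsTypeIAncientMild C (fun t x => v t (x + c)) := (class_of_pinned hP).comp_add_right c
  have hsc : ∀ lam : ℝ, 0 < lam → ∀ s < 0, ∀ y,
      lam • (fun t x => v t (x + c)) (lam ^ 2 * s) (lam • y) = (fun t x => v t (x + c)) s y :=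
    fun lam hlam s hs y => ((isDss_translate_of_isDssAbout (hss lam hlam)) s hs y).symm
  have h0 := PoloidalWindowDoorPoloidalWindowRigidityStrata.eq_zero_of_scaleInvariant hw.2.2.2 hw.1.continuousOn
    (fun s t hst ht x => hw.mild_eq_heatExtension hst ht x) hw.2.1 hsc
  have h1 : v (-1) 0 = 0 := by
    have := h0 (-1) (by norm_num) (-c)
    simpa using this
  exact hP.2.2.2.2.2.1 (by rw [h1]; rfl)

/-! ## §28 THE SCALING SYMMETRY GROUP OF A PINNED PROFILE ABOUT ANY CENTRE (PROVED): trivial, or cyclic with least … -/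

theorem scalingGroup_trichotomy (hAG : AnisotropicGap) (C B : ℝ) :
    ∃ lamStar : ℝ, 1 < lamStar ∧ ∀ (v : ℝ → E₃ → E₃) (c : E₃), Pinned C v → ‖c‖ ≤ B →
      (∀ a : ℝ, 0 < a → IsDssAbout c a v → a = 1) ∨
      (∃ a₀ : ℝ, lamStar ≤ a₀ ∧ IsDssAbout c a₀ v ∧ ∀ a : ℝ, 0 < a → IsDssAbout c a v → ∃ k : ℤ, a = a₀ ^ k) := by
  obtain ⟨lamStar, h1, H⟩ := nearOne_pinned hAG C B
  refine ⟨lamStar, h1, fun v c hP hcB => ?_⟩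
  set w : ℝ → E₃ → E₃ := fun t x => v t (x + c) with hwdef
  have hw : IsTypeIAncientMild C w := (class_of_pinned hP).comp_add_right c
  have hiff : ∀ a : ℝ, IsDssAbout c a v ↔ IsDss a w := fun a => isDssAbout_iff_translate
  have hno : ∀ a : ℝ, 1 < a → IsDss a w → lamStar ≤ a := by
    intro a ha hd
    by_contra hlt
    exact H v a c hP hcB ha (not_le.1 hlt) ((hiff a).2 hd)
  set P : Set ℝ := {a | 1 < a ∧ IsDss a w} with hPdef
  by_cases hPe : P = ∅
  · left
    intro a ha hd
    rw [hiff] at hd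
    by_contra hne
    rcases lt_or_gt_of_ne hne with hlt | hgt
    · have hinv : 1 < a⁻¹ := (one_lt_inv₀ ha).2 hlt
      have : a⁻¹ ∈ P := ⟨hinv, hd.inv ha⟩
      rw [hPe] at this
      exact this
    · have : a ∈ P := ⟨hgt, hd⟩
      rw [hPe] at this
      exact this
  · right
    have hPne : P.Nonempty := Set.nonempty_iff_ne_empty.2 hPe
    have hPbdd : BddBelow P := ⟨lamStar, fun a ha => hno a ha.1 ha.2⟩
    set a₀ : ℝ := sInf P with ha₀
    have ha₀ge : lamStar ≤ a₀ := le_csInf hPne fun a ha => hno a ha.1 ha.2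
    have ha₀1 : 1 < a₀ := h1.trans_le ha₀ge
    have ha₀0 : 0 < a₀ := by linarith
    have ha₀P : IsDss a₀ w := by
      have hmem : a₀ ∈ closure P := csInf_mem_closure hPne hPbdd
      obtain ⟨u, huP, hulim⟩ := mem_closure_iff_seq_limit.1 hmem
      exact isDss_of_tendsto hw.1.continuousOn ha₀0 hulim fun n => (huP n).2
    refine ⟨a₀, ha₀ge, (hiff a₀).2 ha₀P, fun a ha hd => ?_⟩
    rw [hiff] at hd
    set L : ℝ := Real.log a₀ with hL
    have hL0 : 0 < L := Real.log_pos ha₀1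
    set k : ℤ := ⌊Real.log a / L⌋ with hk
    have hk1 : (k : ℝ) ≤ Real.log a / L := Int.floor_le _
    have hk2 : Real.log a / L < (k : ℝ) + 1 := Int.lt_floor_add_one _
    have hpowk : 0 < a₀ ^ k := zpow_pos ha₀0 k
    have hlogpow : Real.log (a₀ ^ k) = (k : ℝ) * L := by rw [Real.log_zpow]
    have hle : a₀ ^ k ≤ a := by
      rw [← Real.log_le_log_iff hpowk ha, hlogpow]
      have := (le_div_iff₀ hL0).1 hk1
      linarith
    have hlt' : a < a₀ ^ (k + 1) := by
      rw [← Real.log_lt_log_iff ha (zpow_pos ha₀0 _), Real.log_zpow]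
      have := (div_lt_iff₀ hL0).1 hk2
      push_cast
      linarith
    set r : ℝ := a * (a₀ ^ k)⁻¹ with hr
    have hrd : IsDss r w := hd.mul ha ((ha₀P.zpow ha₀0 k).inv hpowk)
    have hr1 : 1 ≤ r := by
      rw [hr, le_mul_inv_iff₀ hpowk, one_mul]
      exact hle
    have hra₀ : r < a₀ := by
      rw [hr, mul_inv_lt_iff₀ hpowk, mul_comm, ← zpow_add_one₀ ha₀0.ne']
      exact hlt'
    rcases hr1.eq_or_lt with heq | hgt1
    · refine ⟨k, ?_⟩
      have : a * (a₀ ^ k)⁻¹ = 1 := heq.symm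
      rwa [mul_inv_eq_one₀ hpowk.ne'] at this
    · exfalso
      have hrP : r ∈ P := ⟨hgt1, hrd⟩
      have : a₀ ≤ r := csInf_le hPbdd hrP
      linarith

/-! ## §30 The research cells RE-CUT (OPEN): COARSE-WEB and COARSE-SYNDETIC — the residue's objects have NO FINE … -/

/-- **Datum 1 — the near-one floor at constant `C` (PROVED, `nearOneFloorAt_holds`):** … -/
def NearOneFloorAt (C : ℝ) : Prop :=
  ∀ B : ℝ, ∃ lamStar : ℝ, 1 < lamStar ∧ ∀ (w : ℝ → E₃ → E₃) (lam : ℝ) (c : E₃),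
    Pinned C w → ‖c‖ ≤ B → 1 < lam → lam < lamStar → IsDssAbout c lam w → False

/-- **Datum 2 — no self-similar pinned profile at constant `C`, any centre (PROVED, `noSelfSimilarAt_holds`).** -/
def NoSelfSimilarAt (C : ℝ) : Prop :=
  ∀ (w : ℝ → E₃ → E₃) (c : E₃),
    Pinned C w → (∀ lam : ℝ, 0 < lam → IsDssAbout c lam w) → False

/-- **Datum 3 — the scaling symmetry group at constant `C`, any centre in a ball** … -/
def ScalingGroupAt (C : ℝ) : Prop :=
  ∀ B : ℝ, ∃ lamStar : ℝ, 1 < lamStar ∧ ∀ (w : ℝ → E₃ → E₃) (c : E₃), Pinned C w → ‖c‖ ≤ B →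
    (∀ a : ℝ, 0 < a → IsDssAbout c a w → a = 1) ∨
    (∃ a₀ : ℝ, lamStar ≤ a₀ ∧ IsDssAbout c a₀ w ∧ ∀ a : ℝ, 0 < a → IsDssAbout c a w → ∃ k : ℤ, a = a₀ ^ k)

theorem nearOneFloorAt_holds (hAG : AnisotropicGap) (C : ℝ) : NearOneFloorAt C := fun B => nearOne_pinned hAG C B

theorem scalingGroupAt_holds (hAG : AnisotropicGap) (C : ℝ) : ScalingGroupAt C := fun B => scalingGroup_trichotomy hAG C B

theorem noSelfSimilarAt_holds (C : ℝ) : NoSelfSimilarAt C := fun _ _ hP hss => not_selfSimilar_pinned hP hss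

/-- **Research cell COARSE-WEB (OPEN; supersedes LINE 26/27's cell ETERNAL-WEB).** Kill … -/
def CellCoarseWeb : Prop :=
  AnisotropicGap →
  ∀ (C A : ℝ) (v : ℝ → E₃ → E₃) (W : Set (ℝ × E₃)),
    NearOneFloorAt C → NoSelfSimilarAt C → ScalingGroupAt C →
    Pinned C v → ThickWindow v W → Peakless v → LeastPin C v → NoPinLoss C v → PastPin C v → ScaleWindowPin v →
    0 < A → EternallyPinned A C v → False

/-- **Research cell COARSE-SYNDETIC (OPEN; supersedes LINE 27's cell** … -/
def CellCoarseSyndetic : Prop :=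
  AnisotropicGap → VerticalCore →
  ∀ (C : ℝ) (v : ℝ → E₃ → E₃) (W : Set (ℝ × E₃)),
    NearOneFloorAt C → NoSelfSimilarAt C → ScalingGroupAt C →
    Pinned C v → ThickWindow v W → Peakless v → LeastPin C v → NoPinLoss C v → PastPin C v → ScaleWindowPin v →
    SyndeticBreathing v → False

/-! ## §31 Kernels (checked, no sorry): the old cells from the re-cut ones, and the compositions to the crux items BY … -/

theorem cellEternalWeb_of_coarse (h : CellCoarseWeb) : CellEternalWeb :=
  fun hAG C A v W => h hAG C A v W (nearOneFloorAt_holds hAG C) (noSelfSimilarAt_holds C) (scalingGroupAt_holds hAG C)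

theorem cellSyndetic_of_coarse (h : CellCoarseSyndetic) : CellSyndeticBreathing :=
  fun hAG hVC C v W => h hAG hVC C v W (nearOneFloorAt_holds hAG C) (noSelfSimilarAt_holds C) (scalingGroupAt_holds hAG C)

theorem PoloidalWindowRigidity_of_coarseCells (hS0 : S0Statement)
    (hG : Summit.NavierStokesRegularity.NavierStokesRegularity.Theses.LoopPeriodRatchet.FrequencyGrowthExponent)
    (hVC : VerticalCore) (hweb : CellCoarseWeb) (hsb : CellCoarseSyndetic) :
    Summit.NavierStokesRegularity.NavierStokesRegularity.Theses.PoloidalWindowDoor.PoloidalWindowRigidity :=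
  PoloidalWindowRigidity_of_webCells hS0 hG hVC (cellEternalWeb_of_coarse hweb) (cellSyndetic_of_coarse hsb)

theorem LrcModEntire_of_coarseCells (hS0 : S0Statement)
    (hG : Summit.NavierStokesRegularity.NavierStokesRegularity.Theses.LoopPeriodRatchet.FrequencyGrowthExponent)
    (hVC : VerticalCore) (hweb : CellCoarseWeb) (hsb : CellCoarseSyndetic) :
    Summit.NavierStokesRegularity.NavierStokesRegularity.Theses.PoloidalWindowDoor.LrcModEntire :=
  LrcModEntire_of_webCells hS0 hG hVC (cellEternalWeb_of_coarse hweb) (cellSyndetic_of_coarse hsb)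

/-! ## §32 LINE 29 `near_identity` — THE VERTICAL SCREW-SCALING GROUP OF THE COLUMN (NEW objects + algebra) … -/

theorem rotZ_smul' (θ c : ℝ) (x : E₃) : rotZ θ (c • x) = c • rotZ θ x := by
  ext i
  fin_cases i <;> simp <;> ring

theorem rotZ_neg_rotZ' (θ : ℝ) (x : E₃) : rotZ (-θ) (rotZ θ x) = x := by
  rw [← rotZ_add, neg_add_cancel, rotZ_zero]

theorem rotZ_rotZ_neg' (θ : ℝ) (x : E₃) : rotZ θ (rotZ (-θ) x) = x := by
  rw [← rotZ_add, add_neg_cancel, rotZ_zero]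

theorem rotZ_two_pi' (x : E₃) : rotZ (2 * Real.pi) x = x := by
  ext i
  fin_cases i <;> simp

theorem rotZ_neg_two_pi' (x : E₃) : rotZ (-(2 * Real.pi)) x = x := by
  conv_lhs => rw [← rotZ_two_pi' x]
  rw [rotZ_neg_rotZ']

theorem continuous_rotZ_uncurry' : Continuous fun q : ℝ × E₃ => rotZ q.1 q.2 := by
  unfold rotZ
  refine (PiLp.continuous_toLp 2 _).comp ?_
  refine continuous_pi fun i => ?_
  have h0 : Continuous fun q : ℝ × E₃ => q.2 0 := (PiLp.continuous_apply 2 _ 0).comp continuous_snd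
  have h1 : Continuous fun q : ℝ × E₃ => q.2 1 := (PiLp.continuous_apply 2 _ 1).comp continuous_snd
  have h2 : Continuous fun q : ℝ × E₃ => q.2 2 := (PiLp.continuous_apply 2 _ 2).comp continuous_snd
  have hc : Continuous fun q : ℝ × E₃ => Real.cos q.1 := Real.continuous_cos.comp continuous_fst
  have hs : Continuous fun q : ℝ × E₃ => Real.sin q.1 := Real.continuous_sin.comp continuous_fst
  fin_cases i
  · exact ((hc.mul h0).sub (hs.mul h1)).congr fun q => by simp
  · exact ((hs.mul h0).add (hc.mul h1)).congr fun q => by simp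
  · exact h2.congr fun q => by simp

/-- **Vertical screw-scaling invariance about the origin**: `v(t,x) = λ R_{−θ} v(λ² t,` … -/
def IsScrew (θ lam : ℝ) (v : ℝ → E₃ → E₃) : Prop :=
  ∀ t < 0, ∀ x, v t x = lam • rotZ (-θ) (v (lam ^ 2 * t) (lam • rotZ θ x))

/-- Screw-scaling invariance about the vertical axis through the centre `c` (the … -/
def IsScrewAbout (c : E₃) (θ lam : ℝ) (v : ℝ → E₃ → E₃) : Prop :=
  IsScrew θ lam (fun t x => v t (x + c))

theorem isScrew_zero_iff {lam : ℝ} {v : ℝ → E₃ → E₃} : IsScrew 0 lam v ↔ IsDss lam v := by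
  simp only [IsScrew, IsDss, neg_zero, rotZ_zero]

theorem isScrewAbout_zero_iff {c : E₃} {lam : ℝ} {v : ℝ → E₃ → E₃} :
    IsScrewAbout c 0 lam v ↔ IsDssAbout c lam v := by
  rw [IsScrewAbout, isScrew_zero_iff, isDssAbout_iff_translate]

theorem isScrew_refl (v : ℝ → E₃ → E₃) : IsScrew 0 1 v := fun t _ x => by simp

theorem IsScrew.mul {θ₁ θ₂ a b : ℝ} {v : ℝ → E₃ → E₃} (h1 : IsScrew θ₁ a v) (ha : 0 < a)
    (h2 : IsScrew θ₂ b v) : IsScrew (θ₁ + θ₂) (a * b) v := by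
  intro t ht x
  have hat : a ^ 2 * t < 0 := mul_neg_of_pos_of_neg (pow_pos ha 2) ht
  have e1 : b • rotZ θ₂ (a • rotZ θ₁ x) = (a * b) • rotZ (θ₁ + θ₂) x := by
    rw [rotZ_smul', smul_smul, mul_comm b a, add_comm θ₁ θ₂, rotZ_add]
  have e2 : b ^ 2 * (a ^ 2 * t) = (a * b) ^ 2 * t := by ring
  calc v t x = a • rotZ (-θ₁) (v (a ^ 2 * t) (a • rotZ θ₁ x)) := h1 t ht x
    _ = a • rotZ (-θ₁) (b • rotZ (-θ₂) (v (b ^ 2 * (a ^ 2 * t)) (b • rotZ θ₂ (a • rotZ θ₁ x)))) := by rw [h2 (a ^ 2 * t) hat (a • rotZ θ₁ x)]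
    _ = (a * b) • rotZ (-(θ₁ + θ₂)) (v ((a * b) ^ 2 * t) ((a * b) • rotZ (θ₁ + θ₂) x)) := by
        rw [e1, e2, rotZ_smul', smul_smul, neg_add, rotZ_add, rotZ_add]

theorem IsScrew.inv {θ a : ℝ} {v : ℝ → E₃ → E₃} (h : IsScrew θ a v) (ha : 0 < a) : IsScrew (-θ) a⁻¹ v := by
  intro t ht x
  have hat : a⁻¹ ^ 2 * t < 0 := mul_neg_of_pos_of_neg (pow_pos (inv_pos.2 ha) 2) ht
  have key := h (a⁻¹ ^ 2 * t) hat (a⁻¹ • rotZ (-θ) x)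
  have e1 : a ^ 2 * (a⁻¹ ^ 2 * t) = t := by field_simp
  have e2 : a • rotZ θ (a⁻¹ • rotZ (-θ) x) = x := by
    rw [rotZ_smul', smul_smul, mul_inv_cancel₀ ha.ne', one_smul, rotZ_rotZ_neg']
  rw [e1, e2] at key
  rw [key, rotZ_smul', smul_smul, inv_mul_cancel₀ ha.ne', one_smul, neg_neg, rotZ_rotZ_neg']

theorem IsScrew.pow {θ a : ℝ} {v : ℝ → E₃ → E₃} (h : IsScrew θ a v) (ha : 0 < a) :
    ∀ k : ℕ, IsScrew ((k : ℝ) * θ) (a ^ k) v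
  | 0 => by simpa using isScrew_refl v
  | k + 1 => by
      have e : (((k + 1 : ℕ) : ℝ)) * θ = (k : ℝ) * θ + θ := by push_cast; ring
      rw [pow_succ, e]
      exact (IsScrew.pow h ha k).mul (pow_pos ha k) h

theorem IsScrew.zpow {θ a : ℝ} {v : ℝ → E₃ → E₃} (h : IsScrew θ a v) (ha : 0 < a) :
    ∀ k : ℤ, IsScrew ((k : ℝ) * θ) (a ^ k) v
  | (n : ℕ) => by
      rw [zpow_natCast, Int.cast_natCast]
      exact h.pow ha n
  | Int.negSucc n => by
      rw [zpow_negSucc, Int.cast_negSucc, neg_mul]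
      have := (h.pow ha (n + 1)).inv (pow_pos ha _)
      push_cast at this ⊢
      exact this

theorem isAxisymmetric_of_isScrew {U : ℝ → E₃ → E₃} (h : ∀ θ : ℝ, IsScrew θ 1 U) :
    ∀ t < 0, IsAxisymmetric (U t) := by
  intro t ht θ x
  have key := h θ t ht x
  simp only [one_pow, one_mul, one_smul] at key
  rw [key, rotZ_rotZ_neg']

theorem isDss_of_soliton {α : ℝ} {U : ℝ → E₃ → E₃} (hα : α ≠ 0)
    (h : ∀ σ : ℝ, IsScrew (α * σ) (Real.exp σ) U) : IsDss (Real.exp (2 * Real.pi / |α|)) U := by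
  intro t ht x
  rcases lt_or_gt_of_ne hα with hneg | hpos
  · have e : α * (2 * Real.pi / |α|) = -(2 * Real.pi) := by rw [abs_of_neg hneg]; field_simp
    have key := h (2 * Real.pi / |α|) t ht x
    rw [e, neg_neg, rotZ_two_pi', rotZ_neg_two_pi'] at key
    exact key
  · have e : α * (2 * Real.pi / |α|) = 2 * Real.pi := by rw [abs_of_pos hpos]; field_simp
    have key := h (2 * Real.pi / |α|) t ht x
    rw [e, rotZ_two_pi', rotZ_neg_two_pi'] at key
    exact key

/-! ## §33 NEAR-IDENTITY SYMMETRIES INTEGRATE TO A ONE-PARAMETER SYMMETRY OF THE LIMIT (PROVED) — the Chabauty / … -/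

theorem isScrew_of_limit (C : ℝ) {vs : ℕ → ℝ → E₃ → E₃}
    {U : ℝ → E₃ → E₃} {ths' mus : ℕ → ℝ} {Θ mu : ℝ}
    (hrate : ∀ j, HasTypeITimeDecay C (vs j)) (hcont : ∀ j, ContinuousOn (Function.uncurry (vs j)) (Set.Iio (0 : ℝ) ×ˢ Set.univ))
    (hmild : ∀ j, ∀ s t : ℝ, s < t → t < 0 → ∀ x, vs j t x =
      UnboundedOperators.heatExtension (vs j s) (t - s) x - oseenDuhamel 1 s (vs j) (vs j) t x)
    (hdiv : ∀ j, ∀ t < 0, VectorCalculus.IsDivFree (vs j t))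
    (hconv : ∀ t < 0, ∀ x, Tendsto (fun j => vs j t x) atTop (𝓝 (U t x)))
    (hd : ∀ j, IsScrew (ths' j) (mus j) (vs j)) (hθ : Tendsto ths' atTop (𝓝 Θ)) (hmu : Tendsto mus atTop (𝓝 mu)) (hmu0 : 0 < mu) :
    IsScrew Θ mu U := by
  intro t ht x
  have hT0 : mu ^ 2 * t < 0 := mul_neg_of_pos_of_neg (pow_pos hmu0 2) ht
  obtain ⟨R, hR1, hR4T, hRinv⟩ : ∃ R : ℝ, 1 ≤ R ∧ -R ≤ 4 * (mu ^ 2 * t) ∧ mu ^ 2 * t / 4 ≤ -R⁻¹ := by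
    refine ⟨max 1 (max (-(4 * (mu ^ 2 * t))) (4 / (-(mu ^ 2 * t)))), le_max_left _ _, ?_, ?_⟩
    · have h1 := le_max_left (-(4 * (mu ^ 2 * t))) (4 / (-(mu ^ 2 * t)))
      have h2 := le_max_right 1 (max (-(4 * (mu ^ 2 * t))) (4 / (-(mu ^ 2 * t))))
      linarith
    · have h4 : 4 / (-(mu ^ 2 * t)) ≤ max 1 (max (-(4 * (mu ^ 2 * t))) (4 / (-(mu ^ 2 * t)))) :=
        (le_max_right _ _).trans (le_max_right _ _)
      have hR0 : 0 < max 1 (max (-(4 * (mu ^ 2 * t))) (4 / (-(mu ^ 2 * t)))) := lt_of_lt_of_le one_pos (le_max_left _ _)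
      have h5 : (max 1 (max (-(4 * (mu ^ 2 * t))) (4 / (-(mu ^ 2 * t)))))⁻¹ ≤ (-(mu ^ 2 * t)) / 4 := by
        rw [inv_le_comm₀ hR0 (by linarith), inv_div]
        exact h4
      linarith
  obtain ⟨M, hM0, hM⟩ := PoloidalWindowDoorPoloidalWindowRigidityHotHullSlabUniform.exists_uniform_slab_modulus C hR1
  have hTmem : mu ^ 2 * t ∈ Set.Icc (-R) (-R⁻¹) := ⟨by linarith, by linarith⟩
  have hev1 : ∀ᶠ j in atTop, mu / 2 < mus j := hmu.eventually (lt_mem_nhds (by linarith))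
  have hev2 : ∀ᶠ j in atTop, mus j < 2 * mu := hmu.eventually (gt_mem_nhds (by linarith))
  have hmem : ∀ᶠ j in atTop, mus j ^ 2 * t ∈ Set.Icc (-R) (-R⁻¹) := by
    filter_upwards [hev1, hev2] with j hj1 hj2
    have hmj0 : 0 < mus j := by linarith
    have hsq_le : mus j ^ 2 ≤ (2 * mu) ^ 2 := pow_le_pow_left₀ hmj0.le hj2.le 2
    have hsq_ge : (mu / 2) ^ 2 ≤ mus j ^ 2 := pow_le_pow_left₀ (by linarith) hj1.le 2
    constructor
    · nlinarith
    · nlinarith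
  have hrot : Tendsto (fun j => rotZ (ths' j) x) atTop (𝓝 (rotZ Θ x)) := by
    have h1 : Tendsto (fun j => (ths' j, x)) atTop (𝓝 (Θ, x)) := hθ.prodMk_nhds tendsto_const_nhds
    have h2 := (continuous_rotZ_uncurry'.tendsto (Θ, x)).comp h1
    exact h2
  have hyj : Tendsto (fun j => mus j • rotZ (ths' j) x) atTop (𝓝 (mu • rotZ Θ x)) := hmu.smul hrot
  have hAB : Tendsto (fun j => vs j (mus j ^ 2 * t) (mus j • rotZ (ths' j) x) - vs j (mu ^ 2 * t) (mu • rotZ Θ x)) atTop (𝓝 0) := by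
    have hbound : ∀ᶠ j in atTop, ‖vs j (mus j ^ 2 * t) (mus j • rotZ (ths' j) x) - vs j (mu ^ 2 * t) (mu • rotZ Θ x)‖ ≤
        M * (|mus j ^ 2 * t - mu ^ 2 * t| + ‖mus j • rotZ (ths' j) x - mu • rotZ Θ x‖) := by
      filter_upwards [hmem] with j hj
      exact hM (hrate j) (hcont j) (hmild j) (hdiv j) _ hj _ hTmem _ _
    have hlim0 : Tendsto (fun j => M * (|mus j ^ 2 * t - mu ^ 2 * t| + ‖mus j • rotZ (ths' j) x - mu • rotZ Θ x‖)) atTop (𝓝 0) := by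
      have h1 : Tendsto (fun j => mus j ^ 2 * t - mu ^ 2 * t) atTop (𝓝 (mu ^ 2 * t - mu ^ 2 * t)) := ((hmu.pow 2).mul_const t).sub_const _
      have h2 : Tendsto (fun j => mus j • rotZ (ths' j) x - mu • rotZ Θ x) atTop (𝓝 (mu • rotZ Θ x - mu • rotZ Θ x)) := hyj.sub_const _
      have h3 := (h1.abs.add h2.norm).const_mul M
      simpa using h3
    exact squeeze_zero_norm' hbound hlim0
  have hB : Tendsto (fun j => vs j (mu ^ 2 * t) (mu • rotZ Θ x)) atTop (𝓝 (U (mu ^ 2 * t) (mu • rotZ Θ x))) := hconv _ hT0 _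
  have hA : Tendsto (fun j => vs j (mus j ^ 2 * t) (mus j • rotZ (ths' j) x)) atTop (𝓝 (U (mu ^ 2 * t) (mu • rotZ Θ x))) := by
    have h := hAB.add hB
    simp only [sub_add_cancel, zero_add] at h
    exact h
  have hrot' : Tendsto (fun j => rotZ (-ths' j) (vs j (mus j ^ 2 * t) (mus j • rotZ (ths' j) x))) atTop
      (𝓝 (rotZ (-Θ) (U (mu ^ 2 * t) (mu • rotZ Θ x)))) := by
    have h1 : Tendsto (fun j => (-ths' j, vs j (mus j ^ 2 * t) (mus j • rotZ (ths' j) x))) atTop (𝓝 (-Θ, U (mu ^ 2 * t) (mu • rotZ Θ x))) :=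
      hθ.neg.prodMk_nhds hA
    have h2 := (continuous_rotZ_uncurry'.tendsto (-Θ, U (mu ^ 2 * t) (mu • rotZ Θ x))).comp h1
    exact h2
  have h5 : Tendsto (fun j => vs j t x) atTop (𝓝 (mu • rotZ (-Θ) (U (mu ^ 2 * t) (mu • rotZ Θ x)))) := by
    have e : (fun j => vs j t x) = fun j => mus j • rotZ (-ths' j) (vs j (mus j ^ 2 * t) (mus j • rotZ (ths' j) x)) :=
      funext fun j => hd j t ht x
    rw [e]
    exact hmu.smul hrot'
  exact tendsto_nhds_unique (hconv t ht x) h5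

theorem tendsto_floor_mul {eps : ℕ → ℝ} (heps : ∀ j, 0 < eps j) (heps0 : Tendsto eps atTop (𝓝 0)) (τ : ℝ) :
    Tendsto (fun j => ((⌊τ / eps j⌋ : ℤ) : ℝ) * eps j) atTop (𝓝 τ) := by
  have hb : ∀ j, |((⌊τ / eps j⌋ : ℤ) : ℝ) * eps j - τ| ≤ eps j := by
    intro j
    have hε := heps j
    have h1 : ((⌊τ / eps j⌋ : ℤ) : ℝ) ≤ τ / eps j := Int.floor_le _
    have h2 : τ / eps j < ((⌊τ / eps j⌋ : ℤ) : ℝ) + 1 := Int.lt_floor_add_one _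
    rw [le_div_iff₀ hε] at h1
    rw [div_lt_iff₀ hε, add_mul, one_mul] at h2
    rw [abs_le]
    constructor <;> linarith
  have h0 : Tendsto (fun j => ((⌊τ / eps j⌋ : ℤ) : ℝ) * eps j - τ) atTop (𝓝 0) :=
    squeeze_zero_norm (fun j => by rw [Real.norm_eq_abs]; exact hb j) heps0
  have h1 := h0.add_const τ
  simp only [sub_add_cancel, zero_add] at h1
  exact h1

theorem oneParameter_of_limit (C : ℝ) {vs : ℕ → ℝ → E₃ → E₃}
    {U : ℝ → E₃ → E₃} {ths lams eps : ℕ → ℝ} {p q : ℝ}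
    (hrate : ∀ j, HasTypeITimeDecay C (vs j)) (hcont : ∀ j, ContinuousOn (Function.uncurry (vs j)) (Set.Iio (0 : ℝ) ×ˢ Set.univ))
    (hmild : ∀ j, ∀ s t : ℝ, s < t → t < 0 → ∀ x, vs j t x =
      UnboundedOperators.heatExtension (vs j s) (t - s) x - oseenDuhamel 1 s (vs j) (vs j) t x)
    (hdiv : ∀ j, ∀ t < 0, VectorCalculus.IsDivFree (vs j t))
    (hconv : ∀ t < 0, ∀ x, Tendsto (fun j => vs j t x) atTop (𝓝 (U t x)))
    (hscrew : ∀ j, IsScrew (ths j) (lams j) (vs j)) (hl : ∀ j, 0 < lams j)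
    (heps : ∀ j, 0 < eps j) (heps0 : Tendsto eps atTop (𝓝 0))
    (hp : Tendsto (fun j => ths j / eps j) atTop (𝓝 p)) (hq : Tendsto (fun j => Real.log (lams j) / eps j) atTop (𝓝 q)) :
    ∀ τ : ℝ, IsScrew (p * τ) (Real.exp (q * τ)) U := by
  intro τ
  have hkε := tendsto_floor_mul heps heps0 τ
  have hθ : Tendsto (fun j => ((⌊τ / eps j⌋ : ℤ) : ℝ) * ths j) atTop (𝓝 (p * τ)) := by
    have e : (fun j => ((⌊τ / eps j⌋ : ℤ) : ℝ) * ths j) = fun j => ((⌊τ / eps j⌋ : ℤ) : ℝ) * eps j * (ths j / eps j) := by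
      funext j
      rw [mul_assoc, mul_div_assoc', mul_div_cancel_left₀ _ (heps j).ne']
    rw [e, mul_comm p τ]
    exact hkε.mul hp
  have hmu : Tendsto (fun j => lams j ^ (⌊τ / eps j⌋ : ℤ)) atTop (𝓝 (Real.exp (q * τ))) := by
    have e : (fun j => lams j ^ (⌊τ / eps j⌋ : ℤ)) = fun j => Real.exp (((⌊τ / eps j⌋ : ℤ) : ℝ) * eps j * (Real.log (lams j) / eps j)) := by
      funext j
      rw [mul_assoc, mul_div_assoc', mul_div_cancel_left₀ _ (heps j).ne', ← Real.log_zpow, Real.exp_log (zpow_pos (hl j) _)]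
    have h1 : Tendsto (fun j => ((⌊τ / eps j⌋ : ℤ) : ℝ) * eps j * (Real.log (lams j) / eps j)) atTop (𝓝 (q * τ)) := by
      rw [mul_comm q τ]
      exact hkε.mul hq
    have h2 : Tendsto (fun j => Real.exp (((⌊τ / eps j⌋ : ℤ) : ℝ) * eps j * (Real.log (lams j) / eps j))) atTop (𝓝 (Real.exp (q * τ))) :=
      (Real.continuous_exp.tendsto _).comp h1
    rw [e]
    exact h2
  exact isScrew_of_limit C hrate hcont hmild hdiv hconv (fun j => (hscrew j).zpow (hl j) ⌊τ / eps j⌋) hθ hmu (Real.exp_pos _)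

/-! ## §34 THE THREE ENDS OF A ONE-PARAMETER SYMMETRY: axisymmetric (PROVED absurd, tree `AxisymEndLiouville` stubs … -/

theorem axisymmetric_absurd {C : ℝ} {u : ℝ → E₃ → E₃} (hu : IsTypeIAncientMild C u)
    (haxi : ∀ t < 0, IsAxisymmetric (u t)) : ∀ t < 0, ∀ x, u t x = 0 := by
  have hC : 0 ≤ C := hu.nonneg
  obtain ⟨lam, K, hlam, hK, W, hWc, hW2, hW0, hWK, hW1, hWineq⟩ :=
    AxisymEndLiouville.AbsorbingAxisSwirlExtinction.stub_swirlWeightProfile C hC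
  have hsw : ∀ t < 0, HasNoSwirl (u t) := by
    intro t ht y
    refine abs_nonpos_iff.1 (le_of_forall_pos_le_add fun η hη => ?_)
    obtain ⟨t', ht', hle⟩ := exists_past_rpow_mul_le (C * K * W (cylRadius y / Real.sqrt (-t))) hlam ht hη
    have key := AxisymEndLiouville.AbsorbingAxisSwirlExtinction.stub_swirlComparison C lam K W hlam hK hWc hW2 hW0 hWK hW1 hWineq u hu haxi
      t' t ht' ht y
    calc |swirl (u t) y| ≤ C * K * (t / t') ^ lam * W (cylRadius y / Real.sqrt (-t)) := key
      _ = C * K * W (cylRadius y / Real.sqrt (-t)) * (t / t') ^ lam := by ring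
      _ ≤ η := hle
      _ ≤ 0 + η := by rw [zero_add]
  exact AxisymEndLiouville.AbsorbingAxisSwirlExtinction.stub_noSwirlLiouville C u hu haxi hsw

theorem not_axisymmetric_pinned {C : ℝ} {v : ℝ → E₃ → E₃} {c : E₃} (hP : Pinned C v)
    (haxi : ∀ t < 0, IsAxisymmetric (fun x => v t (x + c))) : False := by
  have hw : IsTypeIAncientMild C (fun t x => v t (x + c)) := (class_of_pinned hP).comp_add_right c
  have h0 := axisymmetric_absurd hw haxi (-1) (by norm_num) (-c)
  have h1 : v (-1) 0 = 0 := by simpa using h0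
  exact hP.2.2.2.2.2.1 (by rw [h1]; rfl)

/-! ## §35 HAND H1 (pinned form) and THE NEAR-IDENTITY FLOOR (PROVED from H1 and U3a): no pinned peakless profile has … -/

theorem noPinnedScrewSoliton_fast (hAG : AnisotropicGap) (C B : ℝ) :
    ∃ α₀ : ℝ, 0 < α₀ ∧ ∀ (v : ℝ → E₃ → E₃) (c : E₃) (α : ℝ),
      Pinned C v → ‖c‖ ≤ B → α₀ < |α| → (∀ σ : ℝ, IsScrewAbout c (α * σ) (Real.exp σ) v) → False := by
  obtain ⟨lamStar, h1, H⟩ := nearOne_pinned hAG C B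
  have hlog : 0 < Real.log lamStar := Real.log_pos h1
  refine ⟨2 * Real.pi / Real.log lamStar, by positivity, ?_⟩
  intro v c α hP hc hα hsol
  have hαpos : 0 < |α| := lt_trans (by positivity) hα
  have hα0 : α ≠ 0 := abs_pos.1 hαpos
  have hd : IsDss (Real.exp (2 * Real.pi / |α|)) (fun t x => v t (x + c)) := isDss_of_soliton hα0 hsol
  have hgt : 1 < Real.exp (2 * Real.pi / |α|) := Real.one_lt_exp_iff.2 (by positivity)
  have hlt : Real.exp (2 * Real.pi / |α|) < lamStar := by
    have h2 : 2 * Real.pi / |α| < Real.log lamStar := by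
      rw [div_lt_iff₀ hαpos]
      have h3 := (div_lt_iff₀ hlog).1 hα
      linarith [mul_comm |α| (Real.log lamStar)]
    calc Real.exp (2 * Real.pi / |α|) < Real.exp (Real.log lamStar) := Real.exp_lt_exp.2 h2
      _ = lamStar := Real.exp_log (by linarith)
  exact H v _ c hP hc hgt hlt (isDssAbout_iff_translate.2 hd)

/-- **HAND H1 — NO PINNED ROTATING SCALING SOLITON (research; typed; its FAST half is** … -/
def NoPinnedScrewSoliton : Prop :=
  ∀ (C α : ℝ), α ≠ 0 → ∀ (v : ℝ → E₃ → E₃) (c : E₃),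
    Pinned C v → Peakless v → (∀ σ : ℝ, IsScrewAbout c (α * σ) (Real.exp σ) v) → False

/-- **stub — hand H1** (research; a `sorry` of the file; fast half PROVED). -/
theorem stub_noPinnedScrewSoliton : NoPinnedScrewSoliton := by
  sorry

/-- **H1 ⇐ its CLASS-LEVEL form** (v1.1; annex `Lines/point_group_rss.lean`: `NoScrewSolitonClass` — itself ⇐ the registered OPEN core of the
crux `Theses.SymmetryModuliCount.SymmetricLiouville`, stmt-NavierStokesRegularity-4053, BY NAME; the objects there are the token-identical
`Theorems/…NearIdentityDefs` ones, so the annex's theorems feed `h` by `exact`). -/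
theorem noPinnedScrewSoliton_of_class
    (h : ∀ (C α : ℝ), α ≠ 0 → ∀ (v : ℝ → E₃ → E₃) (c : E₃), IsTypeIAncientMild C v →
      (∀ σ : ℝ, IsScrewAbout c (α * σ) (Real.exp σ) v) → ∀ t < 0, ∀ x, v t x = 0) :
    NoPinnedScrewSoliton :=
  fun C α hα v c hP _ hsol => pinned_absurd_of_zero hP (h C α hα v c (class_of_pinned hP) hsol)

/-- **THE PINNED EXTRACTION (PROVED; LINE 29's proof of `nearIdentity_pinned`, factored** … -/
theorem pinnedExtraction (hAG : AnisotropicGap) (C B : ℝ) {vs : ℕ → ℝ → E₃ → E₃}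
    {ths lams : ℕ → ℝ} {cs : ℕ → E₃} (hP : ∀ n, Pinned C (vs n)) (hK : ∀ n, Peakless (vs n))
    (hcs : ∀ n, ‖cs n‖ ≤ B) (hlam : ∀ n, 0 < lams n) (hsmall : ∀ n, |ths n| + |Real.log (lams n)| < 1 / ((n : ℝ) + 1))
    (hne : ∀ n, ths n ≠ 0 ∨ lams n ≠ 1) (hscr : ∀ n, IsScrewAbout (cs n) (ths n) (lams n) (vs n)) :
    ∃ (P : ℝ → E₃ → E₃) (c : E₃) (p q : ℝ),
      Pinned C P ∧ Peakless P ∧ |p| + |q| = 1 ∧ ((∀ n, lams n = 1) → q = 0) ∧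
      ∀ τ : ℝ, IsScrew (p * τ) (Real.exp (q * τ)) (fun t x => P t (x + c)) := by
  set eps : ℕ → ℝ := fun n => |ths n| + |Real.log (lams n)| with heps_def
  have heps : ∀ n, 0 < eps n := by
    intro n
    rcases hne n with h | h
    · have : 0 < |ths n| := abs_pos.2 h
      have : 0 ≤ |Real.log (lams n)| := abs_nonneg _
      show 0 < |ths n| + |Real.log (lams n)|
      linarith
    · have : 0 < |Real.log (lams n)| := abs_pos.2 (Real.log_ne_zero_of_pos_of_ne_one (hlam n) h)
      have : 0 ≤ |ths n| := abs_nonneg _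
      show 0 < |ths n| + |Real.log (lams n)|
      linarith
  obtain ⟨δ, hδ, hpin⟩ := pin_lower_bound hAG C
  obtain ⟨φ, P, hφ, hPP, hKP, htlu, -⟩ := pinnedCompact C δ vs hδ hP hK (fun k => hpin _ (hP k))
  set f : ℕ → E₃ × (ℝ × ℝ) := fun n =>
    (cs (φ n), (ths (φ n) / eps (φ n), Real.log (lams (φ n)) / eps (φ n))) with hf
  have hKc : IsCompact (Metric.closedBall (0 : E₃) B ×ˢ (Set.Icc (-1 : ℝ) 1 ×ˢ Set.Icc (-1 : ℝ) 1)) :=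
    (isCompact_closedBall _ _).prod (isCompact_Icc.prod isCompact_Icc)
  have hfK : ∀ n, f n ∈ Metric.closedBall (0 : E₃) B ×ˢ (Set.Icc (-1 : ℝ) 1 ×ˢ Set.Icc (-1 : ℝ) 1) := by
    intro n
    refine Set.mk_mem_prod (mem_closedBall_zero_iff.2 (hcs (φ n))) (Set.mk_mem_prod ?_ ?_)
    · have h : |ths (φ n) / eps (φ n)| ≤ 1 := by
        rw [abs_div, abs_of_pos (heps _), div_le_one (heps _)]
        show |ths (φ n)| ≤ |ths (φ n)| + |Real.log (lams (φ n))|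
        linarith [abs_nonneg (Real.log (lams (φ n)))]
      exact abs_le.1 h
    · have h : |Real.log (lams (φ n)) / eps (φ n)| ≤ 1 := by
        rw [abs_div, abs_of_pos (heps _), div_le_one (heps _)]
        show |Real.log (lams (φ n))| ≤ |ths (φ n)| + |Real.log (lams (φ n))|
        linarith [abs_nonneg (ths (φ n))]
      exact abs_le.1 h
  obtain ⟨⟨c, p, q⟩, -, ψ, hψ, hlim⟩ := hKc.tendsto_subseq hfK
  have hclim : Tendsto (fun j => cs (φ (ψ j))) atTop (𝓝 c) := by
    have h := (continuous_fst.tendsto _).comp hlim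
    simpa [hf, Function.comp_def] using h
  have hp : Tendsto (fun j => ths (φ (ψ j)) / eps (φ (ψ j))) atTop (𝓝 p) := by
    have h := ((continuous_fst.comp continuous_snd).tendsto _).comp hlim
    simpa [hf, Function.comp_def] using h
  have hq : Tendsto (fun j => Real.log (lams (φ (ψ j))) / eps (φ (ψ j))) atTop (𝓝 q) := by
    have h := ((continuous_snd.comp continuous_snd).tendsto _).comp hlim
    simpa [hf, Function.comp_def] using h
  have hpq : |p| + |q| = 1 := by
    have h1 : Tendsto (fun j => |ths (φ (ψ j)) / eps (φ (ψ j))| + |Real.log (lams (φ (ψ j))) / eps (φ (ψ j))|) atTop (𝓝 (|p| + |q|)) :=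
      hp.abs.add hq.abs
    have h2 : (fun j => |ths (φ (ψ j)) / eps (φ (ψ j))| + |Real.log (lams (φ (ψ j))) / eps (φ (ψ j))|) = fun _ => (1 : ℝ) := by
      funext j
      rw [abs_div, abs_div, abs_of_pos (heps _), ← add_div, div_eq_one_iff_eq (heps _).ne']
    rw [h2, tendsto_const_nhds_iff] at h1
    exact h1.symm
  have hsub : Tendsto (fun j => φ (ψ j)) atTop atTop := (hφ.comp hψ).tendsto_atTop
  have heps0 : Tendsto (fun j => eps (φ (ψ j))) atTop (𝓝 0) := by
    have h0 : Tendsto (fun j => 1 / (((φ (ψ j) : ℕ) : ℝ) + 1)) atTop (𝓝 0) := tendsto_one_div_add_atTop_nhds_zero_nat.comp hsub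
    exact tendsto_of_tendsto_of_tendsto_of_le_of_le tendsto_const_nhds h0 (fun j => (heps _).le) (fun j => (hsmall _).le)
  have hw : ∀ j, IsTypeIAncientMild C (fun t x => vs (φ (ψ j)) t (x + cs (φ (ψ j)))) :=
    fun j => (class_of_pinned (hP _)).comp_add_right _
  have hconv : ∀ t < 0, ∀ x, Tendsto (fun j => vs (φ (ψ j)) t (x + cs (φ (ψ j)))) atTop (𝓝 (P t (x + c))) := by
    intro t ht x
    obtain ⟨R, hR1, htmem⟩ : ∃ R : ℝ, 1 ≤ R ∧ t ∈ Set.Icc (-R) (-R⁻¹) := by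
      refine ⟨max 1 (max (-t) (-t)⁻¹), le_max_left _ _, ?_, ?_⟩
      · have h1 := le_max_left (-t) (-t)⁻¹; have h2 := le_max_right 1 (max (-t) (-t)⁻¹); linarith
      · have h4 : (-t)⁻¹ ≤ max 1 (max (-t) (-t)⁻¹) := (le_max_right _ _).trans (le_max_right _ _)
        have hR0 : 0 < max 1 (max (-t) (-t)⁻¹) := lt_of_lt_of_le one_pos (le_max_left _ _)
        have h5 : (max 1 (max (-t) (-t)⁻¹))⁻¹ ≤ -t := by
          rw [inv_le_comm₀ hR0 (by linarith)]
          exact h4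
        linarith
    obtain ⟨M, hM0, hM⟩ := PoloidalWindowDoorPoloidalWindowRigidityHotHullSlabUniform.exists_uniform_slab_modulus C hR1
    have hdiff : Tendsto (fun j => vs (φ (ψ j)) t (x + cs (φ (ψ j))) - vs (φ (ψ j)) t (x + c)) atTop (𝓝 0) := by
      have hbound : ∀ j, ‖vs (φ (ψ j)) t (x + cs (φ (ψ j))) - vs (φ (ψ j)) t (x + c)‖ ≤ M * (|t - t| + ‖(x + cs (φ (ψ j))) - (x + c)‖) :=
        fun j => hM (hP _).1 (hP _).2.1 (hP _).2.2.1 (hP _).2.2.2.1 _ htmem _ htmem _ _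
      have hlim0 : Tendsto (fun j => M * (|t - t| + ‖(x + cs (φ (ψ j))) - (x + c)‖)) atTop (𝓝 0) := by
        have h2 : Tendsto (fun j => (x + cs (φ (ψ j))) - (x + c)) atTop (𝓝 ((x + c) - (x + c))) :=
          (tendsto_const_nhds.add hclim).sub_const _
        have h3 := (h2.norm).const_mul M
        simpa using h3
      exact squeeze_zero_norm' (Eventually.of_forall hbound) hlim0
    have hB : Tendsto (fun j => vs (φ (ψ j)) t (x + c)) atTop (𝓝 (P t (x + c))) :=
      (((htlu t ht).tendstoLocallyUniformlyOn (s := Set.univ)).tendsto_at (Set.mem_univ (x + c))).comp hψ.tendsto_atTop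
    have h := hdiff.add hB
    simp only [sub_add_cancel, zero_add] at h
    exact h
  have hop : ∀ τ : ℝ, IsScrew (p * τ) (Real.exp (q * τ)) (fun t x => P t (x + c)) :=
    oneParameter_of_limit C (vs := fun j t x => vs (φ (ψ j)) t (x + cs (φ (ψ j)))) (U := fun t x => P t (x + c))
      (ths := fun j => ths (φ (ψ j))) (lams := fun j => lams (φ (ψ j))) (eps := fun j => eps (φ (ψ j)))
      (fun j => (hw j).2.2.2) (fun j => (hw j).1.continuousOn) (fun j s t hst ht x => (hw j).mild_eq_heatExtension hst ht x) (fun j => (hw j).2.1)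
      hconv (fun j => hscr _) (fun j => hlam _) (fun j => heps _) heps0 hp hq
  refine ⟨P, c, p, q, hPP, hKP, hpq, fun h1 => ?_, hop⟩
  have hz : (fun j => Real.log (lams (φ (ψ j))) / eps (φ (ψ j))) = fun _ => (0 : ℝ) := by
    funext j
    rw [h1, Real.log_one, zero_div]
  rw [hz, tendsto_const_nhds_iff] at hq
  exact hq.symm

/-- **THE NEAR-IDENTITY FLOOR FOR PINNED PEAKLESS PROFILES, ANY CENTRE IN A BALL** … -/
theorem nearIdentity_pinned (hAG : AnisotropicGap) (hH1 : NoPinnedScrewSoliton) (C B : ℝ) :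
    ∃ ρ : ℝ, 0 < ρ ∧ ∀ (v : ℝ → E₃ → E₃) (θ lam : ℝ) (c : E₃),
      Pinned C v → Peakless v → ‖c‖ ≤ B → 0 < lam → |θ| + |Real.log lam| < ρ → (θ ≠ 0 ∨ lam ≠ 1) → IsScrewAbout c θ lam v → False := by
  by_contra hcon
  have hseq : ∀ n : ℕ, ∃ (v : ℝ → E₃ → E₃) (θ lam : ℝ) (c : E₃),
      Pinned C v ∧ Peakless v ∧ ‖c‖ ≤ B ∧ 0 < lam ∧ |θ| + |Real.log lam| < 1 / ((n : ℝ) + 1) ∧ (θ ≠ 0 ∨ lam ≠ 1) ∧ IsScrewAbout c θ lam v := by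
    intro n
    by_contra hn
    push Not at hn
    have hpos : (0 : ℝ) < 1 / ((n : ℝ) + 1) := by positivity
    exact hcon ⟨1 / ((n : ℝ) + 1), hpos, fun v θ lam c h1 h2 h3 h4 h5 h6 h7 => hn v θ lam c h1 h2 h3 h4 h5 h6 h7⟩
  choose vs ths lams cs hP hK hcs hlam hsmall hne hscr using hseq
  obtain ⟨P, c, p, q, hPP, hKP, hpq, -, hop⟩ := pinnedExtraction hAG C B hP hK hcs hlam hsmall hne hscr
  by_cases hq0 : q = 0
  · -- axisymmetric about the vertical axis through `c`
    have hp0 : p ≠ 0 := by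
      intro hp0; rw [hp0, hq0, abs_zero] at hpq; norm_num at hpq
    have hall : ∀ θ : ℝ, IsScrew θ 1 (fun t x => P t (x + c)) := by
      intro θ
      have h := hop (θ / p)
      have e1 : p * (θ / p) = θ := by field_simp
      rwa [e1, hq0, zero_mul, Real.exp_zero] at h
    exact not_axisymmetric_pinned hPP (isAxisymmetric_of_isScrew hall)
  · by_cases hp0 : p = 0
    · -- self-similar about `c`
      have hss : ∀ mu : ℝ, 0 < mu → IsDssAbout c mu P := by
        intro mu hmu
        have h := hop (Real.log mu / q)
        have e1 : q * (Real.log mu / q) = Real.log mu := by field_simp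
        rw [hp0, zero_mul, e1, Real.exp_log hmu] at h
        exact isDssAbout_iff_translate.2 (isScrew_zero_iff.1 h)
      exact not_selfSimilar_pinned hPP hss
    · -- a pinned rotating scaling soliton about `c` with rate `α = p / q ≠ 0`: HAND H1
      have hα : p / q ≠ 0 := div_ne_zero hp0 hq0
      have hsol : ∀ σ : ℝ, IsScrewAbout c (p / q * σ) (Real.exp σ) P := by
        intro σ
        have h := hop (σ / q)
        have e1 : p * (σ / q) = p / q * σ := by ring
        have e2 : q * (σ / q) = σ := by field_simp
        rw [e1, e2] at h
        exact h
      exact hH1 C (p / q) hα P c hPP hKP hsol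

/-! ## §36 The research cells RE-CUT (OPEN): SCREW-WEB and SCREW-SYNDETIC — the residue's objects have NO … -/

/-- **Datum 4 — the near-identity floor at constant `C` for pinned peakless profiles,** … -/
def NearIdentityFloorAt (C : ℝ) : Prop :=
  ∀ B : ℝ, ∃ ρ : ℝ, 0 < ρ ∧ ∀ (w : ℝ → E₃ → E₃) (θ lam : ℝ) (c : E₃),
    Pinned C w → Peakless w → ‖c‖ ≤ B → 0 < lam → |θ| + |Real.log lam| < ρ → (θ ≠ 0 ∨ lam ≠ 1) → IsScrewAbout c θ lam w → False

/-- **Datum 5 — no pinned class-`C` profile is axisymmetric about a vertical axis** … -/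
def NoAxisymmetricAt (C : ℝ) : Prop :=
  ∀ (w : ℝ → E₃ → E₃) (c : E₃),
    Pinned C w → (∀ t < 0, IsAxisymmetric (fun x => w t (x + c))) → False

theorem nearIdentityFloorAt_of_H1 (hAG : AnisotropicGap) (hH1 : NoPinnedScrewSoliton) (C : ℝ) : NearIdentityFloorAt C :=
  fun B => nearIdentity_pinned hAG hH1 C B

theorem noAxisymmetricAt_holds (C : ℝ) : NoAxisymmetricAt C := fun _ _ hP haxi => not_axisymmetric_pinned hP haxi

/-- **Research cell SCREW-WEB (OPEN; supersedes LINE 28's COARSE-WEB).** All of … -/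
def CellScrewWeb : Prop :=
  AnisotropicGap →
  ∀ (C A : ℝ) (v : ℝ → E₃ → E₃) (W : Set (ℝ × E₃)),
    NearOneFloorAt C → NoSelfSimilarAt C → ScalingGroupAt C → NearIdentityFloorAt C → NoAxisymmetricAt C →
    Pinned C v → ThickWindow v W → Peakless v → LeastPin C v → NoPinLoss C v → PastPin C v → ScaleWindowPin v →
    0 < A → EternallyPinned A C v → False

/-- **Research cell SCREW-SYNDETIC (OPEN; supersedes LINE 28's COARSE-SYNDETIC).** All … -/
def CellScrewSyndetic : Prop :=
  AnisotropicGap → VerticalCore →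
  ∀ (C : ℝ) (v : ℝ → E₃ → E₃) (W : Set (ℝ × E₃)),
    NearOneFloorAt C → NoSelfSimilarAt C → ScalingGroupAt C → NearIdentityFloorAt C → NoAxisymmetricAt C →
    Pinned C v → ThickWindow v W → Peakless v → LeastPin C v → NoPinLoss C v → PastPin C v → ScaleWindowPin v →
    SyndeticBreathing v → False

/-! ## §37 Kernels (checked, no sorry): LINE 28's cells from the re-cut ones given H1, and the compositions to the … -/

theorem cellCoarseWeb_of_screw (hH1 : NoPinnedScrewSoliton) (h : CellScrewWeb) : CellCoarseWeb :=
  fun hAG C A v W hF hNS hSG => h hAG C A v W hF hNS hSG (nearIdentityFloorAt_of_H1 hAG hH1 C) (noAxisymmetricAt_holds C)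

theorem cellCoarseSyndetic_of_screw (hH1 : NoPinnedScrewSoliton) (h : CellScrewSyndetic) : CellCoarseSyndetic :=
  fun hAG hVC C v W hF hNS hSG => h hAG hVC C v W hF hNS hSG (nearIdentityFloorAt_of_H1 hAG hH1 C) (noAxisymmetricAt_holds C)

theorem PoloidalWindowRigidity_of_screwCells (hS0 : S0Statement)
    (hG : Summit.NavierStokesRegularity.NavierStokesRegularity.Theses.LoopPeriodRatchet.FrequencyGrowthExponent)
    (hVC : VerticalCore) (hH1 : NoPinnedScrewSoliton) (hweb : CellScrewWeb) (hsb : CellScrewSyndetic) :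
    Summit.NavierStokesRegularity.NavierStokesRegularity.Theses.PoloidalWindowDoor.PoloidalWindowRigidity :=
  PoloidalWindowRigidity_of_coarseCells hS0 hG hVC (cellCoarseWeb_of_screw hH1 hweb) (cellCoarseSyndetic_of_screw hH1 hsb)

theorem LrcModEntire_of_screwCells (hS0 : S0Statement)
    (hG : Summit.NavierStokesRegularity.NavierStokesRegularity.Theses.LoopPeriodRatchet.FrequencyGrowthExponent)
    (hVC : VerticalCore) (hH1 : NoPinnedScrewSoliton) (hweb : CellScrewWeb) (hsb : CellScrewSyndetic) :
    Summit.NavierStokesRegularity.NavierStokesRegularity.Theses.PoloidalWindowDoor.LrcModEntire :=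
  LrcModEntire_of_coarseCells hS0 hG hVC (cellCoarseWeb_of_screw hH1 hweb) (cellCoarseSyndetic_of_screw hH1 hsb)

/-! ## §38 LINE 30 `point_group` — THE FULL VERTICAL SIMILARITY GROUP OF THE COLUMN: helices, affine similarities, full turns, Dirichlet's pigeonhole (NEW objects + algebra) -/

/-- `R_θ` is additive (re-proved; light). -/
theorem rotZ_add_vec' (θ : ℝ) (x y : E₃) : rotZ θ (x + y) = rotZ θ x + rotZ θ y := by
  ext i
  fin_cases i <;> simp <;> ring

/-- `R_θ` respects differences. -/
theorem rotZ_sub_vec' (θ : ℝ) (x y : E₃) : rotZ θ (x - y) = rotZ θ x - rotZ θ y := by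
  ext i
  fin_cases i <;> simp <;> ring

/-- `R_θ` fixes the vertical axis pointwise. -/
theorem rotZ_smul_single_two' (θ h : ℝ) :
    rotZ θ (h • EuclideanSpace.single (2 : Fin 3) (1 : ℝ)) = h • EuclideanSpace.single (2 : Fin 3) (1 : ℝ) := by
  ext i
  fin_cases i <;> simp

/-- Rotations about one axis commute. -/
theorem rotZ_comm' (θ φ : ℝ) (x : E₃) : rotZ θ (rotZ φ x) = rotZ φ (rotZ θ x) := by
  rw [← rotZ_add, add_comm, rotZ_add]

/-- Any whole number of full turns is the identity. -/
theorem rotZ_int_mul_two_pi' (n : ℤ) (x : E₃) : rotZ ((n : ℝ) * (2 * Real.pi)) x = x := by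
  induction n using Int.induction_on with
  | zero => simp [rotZ_zero]
  | succ k ih =>
      have e : (((k : ℤ) + 1 : ℤ) : ℝ) * (2 * Real.pi) = 2 * Real.pi + ((k : ℤ) : ℝ) * (2 * Real.pi) := by push_cast; ring
      rw [e, rotZ_add, ih, rotZ_two_pi']
  | pred k ih =>
      have e : ((-(k : ℤ) - 1 : ℤ) : ℝ) * (2 * Real.pi) = -(2 * Real.pi) + ((-(k : ℤ) : ℤ) : ℝ) * (2 * Real.pi) := by push_cast; ring
      rw [e, rotZ_add, ih, rotZ_neg_two_pi']

/-- Angles are read modulo full turns. -/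
theorem rotZ_add_int_mul_two_pi' (θ : ℝ) (n : ℤ) (x : E₃) : rotZ (θ + (n : ℝ) * (2 * Real.pi)) x = rotZ θ x := by
  rw [rotZ_add, rotZ_int_mul_two_pi']

/-- A screw-scaling symmetry with angle `θ` is one with angle `θ + 2πn`. -/
theorem IsScrew.shift_angle {θ lam : ℝ} {v : ℝ → E₃ → E₃} (h : IsScrew θ lam v) (n : ℤ) :
    IsScrew (θ + (n : ℝ) * (2 * Real.pi)) lam v := by
  intro t ht x
  have e2 : -(θ + (n : ℝ) * (2 * Real.pi)) = -θ + ((-n : ℤ) : ℝ) * (2 * Real.pi) := by push_cast; ring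
  rw [rotZ_add_int_mul_two_pi', e2, rotZ_add_int_mul_two_pi']
  exact h t ht x

/-- **Dirichlet's pigeonhole on the circle:** among `θ, 2θ, …, nθ` one is within `2π/(n+1)` of a whole number of full turns
(Mathlib `Real.exists_int_int_abs_mul_sub_le`).  The lever of §39 and §41: ANY symmetry has a power with a SMALL rotation part. -/
theorem exists_small_multiple (θ : ℝ) {n : ℕ} (hn : 0 < n) :
    ∃ m k : ℤ, 0 < k ∧ k ≤ n ∧ |(k : ℝ) * θ + ((-m : ℤ) : ℝ) * (2 * Real.pi)| ≤ 2 * Real.pi / ((n : ℝ) + 1) := by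
  obtain ⟨m, k, hk0, hkle, happrox⟩ := Real.exists_int_int_abs_mul_sub_le (θ / (2 * Real.pi)) hn
  refine ⟨m, k, hk0, hkle, ?_⟩
  have h2π : 0 < 2 * Real.pi := by positivity
  have e : (k : ℝ) * θ + ((-m : ℤ) : ℝ) * (2 * Real.pi) = (2 * Real.pi) * ((k : ℝ) * (θ / (2 * Real.pi)) - (m : ℝ)) := by
    push_cast
    field_simp
    ring
  rw [e, abs_mul, abs_of_pos h2π]
  calc 2 * Real.pi * |(k : ℝ) * (θ / (2 * Real.pi)) - (m : ℝ)| ≤ 2 * Real.pi * (1 / ((n : ℝ) + 1)) := by gcongr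
    _ = 2 * Real.pi / ((n : ℝ) + 1) := by ring

/-- **Helical (screw-displacement) invariance about the vertical axis through the origin**: `v(t,x) = R_{−θ} v(t, R_θ x + h e₂)` for all `t < 0` — the NS
symmetry `u ↦ Qᵀ u(·, Q · + h e₂)`, `Q = R_θ`, WITHOUT scaling.  `h = 0` is a pure rotational symmetry, `θ ∈ 2πℤ` a pure vertical period. -/
def IsHelix (θ h : ℝ) (v : ℝ → E₃ → E₃) : Prop :=
  ∀ t < 0, ∀ x, v t x = rotZ (-θ) (v t (rotZ θ x + h • EuclideanSpace.single (2 : Fin 3) (1 : ℝ)))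

/-- Helical invariance about the vertical axis through the centre `c`. -/
def IsHelixAbout (c : E₃) (θ h : ℝ) (v : ℝ → E₃ → E₃) : Prop :=
  IsHelix θ h (fun t x => v t (x + c))

/-- The identity element. -/
theorem isHelix_refl (v : ℝ → E₃ → E₃) : IsHelix 0 0 v := fun t _ x => by
  simp [rotZ_zero]

/-- Group law of the vertical screw-displacement group: `(θ₁, a) · (θ₂, b) = (θ₁ + θ₂, a + b)`. -/
theorem IsHelix.mul {θ₁ θ₂ a b : ℝ} {v : ℝ → E₃ → E₃} (h1 : IsHelix θ₁ a v) (h2 : IsHelix θ₂ b v) :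
    IsHelix (θ₁ + θ₂) (a + b) v := by
  intro t ht x
  have e1 : rotZ θ₂ (rotZ θ₁ x + a • EuclideanSpace.single (2 : Fin 3) (1 : ℝ)) + b • EuclideanSpace.single (2 : Fin 3) (1 : ℝ)
      = rotZ (θ₁ + θ₂) x + (a + b) • EuclideanSpace.single (2 : Fin 3) (1 : ℝ) := by
    rw [rotZ_add_vec', rotZ_smul_single_two', add_comm θ₁ θ₂, rotZ_add, add_smul, ← add_assoc]
  calc v t x = rotZ (-θ₁) (v t (rotZ θ₁ x + a • EuclideanSpace.single (2 : Fin 3) (1 : ℝ))) := h1 t ht x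
    _ = rotZ (-θ₁) (rotZ (-θ₂) (v t (rotZ θ₂ (rotZ θ₁ x + a • EuclideanSpace.single (2 : Fin 3) (1 : ℝ)) +
          b • EuclideanSpace.single (2 : Fin 3) (1 : ℝ)))) := by
        rw [← h2 t ht (rotZ θ₁ x + a • EuclideanSpace.single (2 : Fin 3) (1 : ℝ))]
    _ = rotZ (-(θ₁ + θ₂)) (v t (rotZ (θ₁ + θ₂) x + (a + b) • EuclideanSpace.single (2 : Fin 3) (1 : ℝ))) := by
        rw [e1, neg_add, rotZ_add (-θ₁) (-θ₂)]

/-- Inverses: `(θ, a)⁻¹ = (−θ, −a)`. -/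
theorem IsHelix.inv {θ a : ℝ} {v : ℝ → E₃ → E₃} (h : IsHelix θ a v) : IsHelix (-θ) (-a) v := by
  intro t ht x
  have key := h t ht (rotZ (-θ) x + (-a) • EuclideanSpace.single (2 : Fin 3) (1 : ℝ))
  have e : rotZ θ (rotZ (-θ) x + (-a) • EuclideanSpace.single (2 : Fin 3) (1 : ℝ)) + a • EuclideanSpace.single (2 : Fin 3) (1 : ℝ) = x := by
    rw [rotZ_add_vec', rotZ_rotZ_neg', rotZ_smul_single_two', neg_smul, add_assoc, neg_add_cancel, add_zero]
  rw [e] at key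
  rw [key, neg_neg, rotZ_rotZ_neg']

/-- Natural powers. -/
theorem IsHelix.pow {θ a : ℝ} {v : ℝ → E₃ → E₃} (h : IsHelix θ a v) :
    ∀ k : ℕ, IsHelix ((k : ℝ) * θ) ((k : ℝ) * a) v
  | 0 => by simpa using isHelix_refl v
  | k + 1 => by
      have e1 : (((k + 1 : ℕ) : ℝ)) * θ = (k : ℝ) * θ + θ := by push_cast; ring
      have e2 : (((k + 1 : ℕ) : ℝ)) * a = (k : ℝ) * a + a := by push_cast; ring
      rw [e1, e2]
      exact (IsHelix.pow h k).mul h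

/-- Integer powers. -/
theorem IsHelix.zpow {θ a : ℝ} {v : ℝ → E₃ → E₃} (h : IsHelix θ a v) :
    ∀ k : ℤ, IsHelix ((k : ℝ) * θ) ((k : ℝ) * a) v
  | (n : ℕ) => by
      rw [Int.cast_natCast]
      exact h.pow n
  | Int.negSucc n => by
      have h1 := (h.pow (n + 1)).inv
      rw [Int.cast_negSucc, neg_mul, neg_mul]
      push_cast at h1 ⊢
      exact h1

/-- Angles modulo full turns. -/
theorem IsHelix.shift_angle {θ a : ℝ} {v : ℝ → E₃ → E₃} (h : IsHelix θ a v) (n : ℤ) :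
    IsHelix (θ + (n : ℝ) * (2 * Real.pi)) a v := by
  intro t ht x
  have e2 : -(θ + (n : ℝ) * (2 * Real.pi)) = -θ + ((-n : ℤ) : ℝ) * (2 * Real.pi) := by push_cast; ring
  rw [rotZ_add_int_mul_two_pi', e2, rotZ_add_int_mul_two_pi']
  exact h t ht x

/-- Rotational invariance by every angle (no displacement) is axisymmetry. -/
theorem isAxisymmetric_of_isHelix {U : ℝ → E₃ → E₃} (h : ∀ θ : ℝ, IsHelix θ 0 U) :
    ∀ t < 0, IsAxisymmetric (U t) := by
  intro t ht θ x
  have key := h θ t ht x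
  rw [zero_smul, add_zero] at key
  rw [key, rotZ_rotZ_neg']

/-- Angle zero is a pure vertical period. -/
theorem translate_of_isHelix_zero {s : ℝ} {U : ℝ → E₃ → E₃} (h : IsHelix 0 s U) :
    ∀ t < 0, ∀ y, U t (y + s • EuclideanSpace.single (2 : Fin 3) (1 : ℝ)) = U t y := by
  intro t ht y
  have key := h t ht y
  rw [neg_zero, rotZ_zero, rotZ_zero] at key
  exact key.symm

/-- Blow-downs about the origin transport a helical symmetry: axis `c/с'`, shift `h/c'`, same angle. -/
theorem IsHelixAbout.nsRescale {c₀ : E₃} {θ h : ℝ} {v : ℝ → E₃ → E₃}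
    (hx : IsHelixAbout c₀ θ h v) {c : ℝ} (hc : 0 < c) : IsHelixAbout (c⁻¹ • c₀) θ (h / c) (nsRescale c v) := by
  intro t ht x
  show Literature.Analysis.FluidPDE.nsRescale c v t (x + c⁻¹ • c₀) = rotZ (-θ)
    (Literature.Analysis.FluidPDE.nsRescale c v t (rotZ θ x + (h / c) • EuclideanSpace.single (2 : Fin 3) (1 : ℝ) + c⁻¹ • c₀))
  rw [nsRescale_apply, nsRescale_apply]
  have hct : c ^ 2 * t < 0 := mul_neg_of_pos_of_neg (pow_pos hc 2) ht
  have e3 : c * (h / c) = h := by field_simp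
  have e1 : c • (x + c⁻¹ • c₀) = c • x + c₀ := by rw [smul_add, smul_smul, mul_inv_cancel₀ hc.ne', one_smul]
  have e2 : c • (rotZ θ x + (h / c) • EuclideanSpace.single (2 : Fin 3) (1 : ℝ) + c⁻¹ • c₀) =
      rotZ θ (c • x) + h • EuclideanSpace.single (2 : Fin 3) (1 : ℝ) + c₀ := by
    rw [smul_add, smul_add, smul_smul, smul_smul, mul_inv_cancel₀ hc.ne', one_smul, e3, rotZ_smul']
  have key := hx (c ^ 2 * t) hct (c • x)
  simp only at key
  rw [e1, e2, key]
  simp only [rotZ_smul']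

/-! ## §39 NO HELICAL SYMMETRY (PROVED, unconditional): a pinned peakless profile with NO-PIN-LOSS is not invariant under any vertical screw DISPLACEMENT
`x ↦ c + R_θ(x − c) + h e₂`, `h ≠ 0`, rational OR IRRATIONAL angle — blow-down (`nearPinnedBlowDownLimit`), Dirichlet powers, one-parameter extraction,
then the tree's periodic stratum / the axisymmetric end -/

/-- **Closedness of helical symmetry under class limits with MOVING data (PROVED):** axes `aⱼ → a`, angles `θⱼ → Θ`, shifts `hⱼ → H`; the relation passes
to pointwise limits by the class-uniform joint modulus (`…HotHullSlabUniform.exists_uniform_slab_modulus`) and the joint continuity of `(θ, x) ↦ R_θ x`. -/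
theorem isHelixAbout_of_limit (C : ℝ) {vs : ℕ → ℝ → E₃ → E₃}
    {U : ℝ → E₃ → E₃} {as : ℕ → E₃} {ths hs : ℕ → ℝ}
    {a : E₃} {Θ H : ℝ}
    (hrate : ∀ j, HasTypeITimeDecay C (vs j)) (hcont : ∀ j, ContinuousOn (Function.uncurry (vs j)) (Set.Iio (0 : ℝ) ×ˢ Set.univ))
    (hmild : ∀ j, ∀ s t : ℝ, s < t → t < 0 → ∀ x, vs j t x =
      UnboundedOperators.heatExtension (vs j s) (t - s) x - oseenDuhamel 1 s (vs j) (vs j) t x)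
    (hdiv : ∀ j, ∀ t < 0, VectorCalculus.IsDivFree (vs j t))
    (hconv : ∀ t < 0, ∀ x, Tendsto (fun j => vs j t x) atTop (𝓝 (U t x)))
    (hd : ∀ j, IsHelixAbout (as j) (ths j) (hs j) (vs j)) (ha : Tendsto as atTop (𝓝 a)) (hθ : Tendsto ths atTop (𝓝 Θ))
    (hh : Tendsto hs atTop (𝓝 H)) : IsHelixAbout a Θ H U := by
  intro t ht x
  show U t (x + a) = rotZ (-Θ) (U t (rotZ Θ x + H • EuclideanSpace.single (2 : Fin 3) (1 : ℝ) + a))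
  obtain ⟨R, hR1, htmem⟩ : ∃ R : ℝ, 1 ≤ R ∧ t ∈ Set.Icc (-R) (-R⁻¹) := by
    refine ⟨max 1 (max (-t) (-t)⁻¹), le_max_left _ _, ?_, ?_⟩
    · have h1 := le_max_left (-t) (-t)⁻¹; have h2 := le_max_right 1 (max (-t) (-t)⁻¹); linarith
    · have h4 : (-t)⁻¹ ≤ max 1 (max (-t) (-t)⁻¹) := (le_max_right _ _).trans (le_max_right _ _)
      have hR0 : 0 < max 1 (max (-t) (-t)⁻¹) := lt_of_lt_of_le one_pos (le_max_left _ _)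
      have h5 : (max 1 (max (-t) (-t)⁻¹))⁻¹ ≤ -t := by
        rw [inv_le_comm₀ hR0 (by linarith)]
        exact h4
      linarith
  obtain ⟨M, hM0, hM⟩ := PoloidalWindowDoorPoloidalWindowRigidityHotHullSlabUniform.exists_uniform_slab_modulus C hR1
  -- moving evaluation points are harmless: `ys j → y` gives `vs j t (ys j) → U t y`
  have hgen : ∀ (ys : ℕ → E₃) (y : E₃), Tendsto ys atTop (𝓝 y) →
      Tendsto (fun j => vs j t (ys j)) atTop (𝓝 (U t y)) := by
    intro ys y hys
    have hdiff : Tendsto (fun j => vs j t (ys j) - vs j t y) atTop (𝓝 0) := by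
      have hbound : ∀ j, ‖vs j t (ys j) - vs j t y‖ ≤ M * (|t - t| + ‖ys j - y‖) :=
        fun j => hM (hrate j) (hcont j) (hmild j) (hdiv j) _ htmem _ htmem _ _
      have hlim0 : Tendsto (fun j => M * (|t - t| + ‖ys j - y‖)) atTop (𝓝 0) := by
        have h2 : Tendsto (fun j => ys j - y) atTop (𝓝 (y - y)) := hys.sub_const _
        have h3 := (h2.norm).const_mul M
        simpa using h3
      exact squeeze_zero_norm' (Eventually.of_forall hbound) hlim0
    have h := hdiff.add (hconv t ht y)
    simp only [sub_add_cancel, zero_add] at h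
    exact h
  have hrot : Tendsto (fun j => rotZ (ths j) x) atTop (𝓝 (rotZ Θ x)) := by
    have h1 : Tendsto (fun j => (ths j, x)) atTop (𝓝 (Θ, x)) := hθ.prodMk_nhds tendsto_const_nhds
    have h2 := (continuous_rotZ_uncurry'.tendsto (Θ, x)).comp h1
    exact h2
  have hQ : Tendsto (fun j => rotZ (ths j) x + hs j • EuclideanSpace.single (2 : Fin 3) (1 : ℝ) + as j) atTop
      (𝓝 (rotZ Θ x + H • EuclideanSpace.single (2 : Fin 3) (1 : ℝ) + a)) := (hrot.add (hh.smul_const _)).add ha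
  have hA := hgen _ _ (tendsto_const_nhds.add ha : Tendsto (fun j => x + as j) atTop (𝓝 (x + a)))
  have hB := hgen _ _ hQ
  have hrot' : Tendsto (fun j => rotZ (-ths j) (vs j t (rotZ (ths j) x + hs j • EuclideanSpace.single (2 : Fin 3) (1 : ℝ) + as j))) atTop
      (𝓝 (rotZ (-Θ) (U t (rotZ Θ x + H • EuclideanSpace.single (2 : Fin 3) (1 : ℝ) + a)))) := by
    have h1 : Tendsto (fun j => (-ths j, vs j t (rotZ (ths j) x + hs j • EuclideanSpace.single (2 : Fin 3) (1 : ℝ) + as j))) atTop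
        (𝓝 (-Θ, U t (rotZ Θ x + H • EuclideanSpace.single (2 : Fin 3) (1 : ℝ) + a))) := hθ.neg.prodMk_nhds hB
    have h2 := (continuous_rotZ_uncurry'.tendsto (-Θ, U t (rotZ Θ x + H • EuclideanSpace.single (2 : Fin 3) (1 : ℝ) + a))).comp h1
    exact h2
  have e : (fun j => vs j t (x + as j)) =
      fun j => rotZ (-ths j) (vs j t (rotZ (ths j) x + hs j • EuclideanSpace.single (2 : Fin 3) (1 : ℝ) + as j)) :=
    funext fun j => hd j t ht x
  rw [e] at hA
  exact tendsto_nhds_unique hA hrot'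

/-- **One-parameter helical symmetry of the limit (PROVED):** elements `(θⱼ, hⱼ) → (0,0)`, `≠ (0,0)`, with `(θⱼ, hⱼ)/εⱼ → (p, q)` integrate, through the
powers `⌊τ/εⱼ⌋`, to invariance of the limit under the whole one-parameter group `τ ↦ (pτ, qτ)` about the limit axis. -/
theorem helixOneParameter_of_limit (C : ℝ) {vs : ℕ → ℝ → E₃ → E₃}
    {U : ℝ → E₃ → E₃} {as : ℕ → E₃} {ths hs eps : ℕ → ℝ}
    {a : E₃} {p q : ℝ}
    (hrate : ∀ j, HasTypeITimeDecay C (vs j)) (hcont : ∀ j, ContinuousOn (Function.uncurry (vs j)) (Set.Iio (0 : ℝ) ×ˢ Set.univ))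
    (hmild : ∀ j, ∀ s t : ℝ, s < t → t < 0 → ∀ x, vs j t x =
      UnboundedOperators.heatExtension (vs j s) (t - s) x - oseenDuhamel 1 s (vs j) (vs j) t x)
    (hdiv : ∀ j, ∀ t < 0, VectorCalculus.IsDivFree (vs j t))
    (hconv : ∀ t < 0, ∀ x, Tendsto (fun j => vs j t x) atTop (𝓝 (U t x)))
    (hd : ∀ j, IsHelixAbout (as j) (ths j) (hs j) (vs j)) (ha : Tendsto as atTop (𝓝 a))
    (heps : ∀ j, 0 < eps j) (heps0 : Tendsto eps atTop (𝓝 0))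
    (hp : Tendsto (fun j => ths j / eps j) atTop (𝓝 p)) (hq : Tendsto (fun j => hs j / eps j) atTop (𝓝 q)) :
    ∀ τ : ℝ, IsHelixAbout a (p * τ) (q * τ) U := by
  intro τ
  have hkε := tendsto_floor_mul heps heps0 τ
  have hlin : ∀ (g : ℕ → ℝ) (r : ℝ), Tendsto (fun j => g j / eps j) atTop (𝓝 r) →
      Tendsto (fun j => ((⌊τ / eps j⌋ : ℤ) : ℝ) * g j) atTop (𝓝 (r * τ)) := by
    intro g r hg
    have e : (fun j => ((⌊τ / eps j⌋ : ℤ) : ℝ) * g j) = fun j => ((⌊τ / eps j⌋ : ℤ) : ℝ) * eps j * (g j / eps j) := by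
      funext j
      rw [mul_assoc, mul_div_assoc', mul_div_cancel_left₀ _ (heps j).ne']
    rw [e, mul_comm r τ]
    exact hkε.mul hg
  exact isHelixAbout_of_limit C hrate hcont hmild hdiv hconv (fun j => (hd j).zpow ⌊τ / eps j⌋) ha (hlin ths p hp) (hlin hs q hq)

/-- **NO HELICAL SYMMETRY (PROVED, unconditional).**  A pinned peakless class-`C` profile obeying NO-PIN-LOSS is invariant under NO vertical screw displacement
`x ↦ c + R_θ(x − c) + h e₂` with `h ≠ 0` — for EVERY angle `θ`, rational or not.  Proof: the blow-downs `v_j = nsRescale cⱼ v` about the origin converge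
(`nearPinnedBlowDownLimit`, from U3b's NoPinLoss) to a NONTRIVIAL class profile `V`; `v_j` is helical about `c/cⱼ` with shift `h/cⱼ`; DIRICHLET's pigeonhole
gives powers `kⱼ ≤ Qⱼ` whose angle `kⱼθ` is within `2π/(Qⱼ+1)` of a full turn count, so with `Qⱼ → ∞`, `Qⱼ/cⱼ → 0`, the elements `gⱼ = (ψⱼ, ηⱼ) → (0,0)`,
`ηⱼ ≠ 0`; the extraction `helixOneParameter_of_limit` makes `V` invariant under a one-parameter group `(pτ, qτ)_τ`, `|p| + |q| = 1`: `q = 0` ⇒ `V` axisymmetric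
⇒ `V ≡ 0` (`axisymmetric_absurd`, tree `AxisymEndLiouville`); `q ≠ 0` ⇒ one full turn (or `p = 0`) is a PURE VERTICAL PERIOD ⇒ `V ≡ 0` (tree
`…Periodic.eq_zero_of_spatiallyPeriodic`) — both contradict the near-pin of `V`.  The tree's periodic stratum settles only RATIONAL helices (finite-order twist,
`eq_zero_of_twistedPeriodic`); the pin + Dirichlet settle all of them. -/
theorem not_helical_pinned {C : ℝ} {v : ℝ → E₃ → E₃} (hP : Pinned C v) (hK : Peakless v)
    (hNPL : NoPinLoss C v) {c₀ : E₃} {θ h : ℝ} (hh : h ≠ 0) (hx : IsHelixAbout c₀ θ h v) : False := by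
  have hN : 0 < |v (-1) 0 2| := abs_pos.2 hP.2.2.2.2.2.1
  obtain ⟨Λ, hΛ, V, hV, hVpol, hVK, hdom, ⟨y, hy, hnear⟩, cs, hcs1, hcs, hconv⟩ :=
    nearPinnedBlowDownLimit hP hK hNPL (|v (-1) 0 2| / 2) (by positivity)
  have hVne : ¬ ∀ t < 0, ∀ x, V t x = 0 := by
    intro h0
    have h1 := h0 (-1) (by norm_num) y
    rw [h1] at hnear
    simp at hnear
    linarith
  have hc0 : ∀ j, 0 < cs j := fun j => lt_of_lt_of_le one_pos (hcs1 j)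
  have hwcl : ∀ j, IsTypeIAncientMild C (nsRescale (cs j) v) := fun j => isTypeIAncientMild_nsRescale (class_of_pinned hP) (hc0 j)
  have hwx : ∀ j, IsHelixAbout ((cs j)⁻¹ • c₀) θ (h / cs j) (nsRescale (cs j) v) := fun j => hx.nsRescale (hc0 j)
  -- far indices `J n ≥ n` with large scale `cs (J n) ≥ (n+1)²`
  have hJ : ∀ n : ℕ, ∃ j : ℕ, n ≤ j ∧ ((n : ℝ) + 1) ^ 2 ≤ cs j := by
    intro n
    obtain ⟨j, hj1, hj2⟩ := ((hcs.eventually_ge_atTop (((n : ℝ) + 1) ^ 2)).and (eventually_ge_atTop n)).exists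
    exact ⟨j, hj2, hj1⟩
  choose J hJn hJc using hJ
  have hJtop : Tendsto J atTop atTop := tendsto_atTop_mono hJn tendsto_id
  -- Dirichlet at level `n` with `Q = n + 1`
  have hD : ∀ n : ℕ, ∃ m k : ℤ, 0 < k ∧ k ≤ (n + 1 : ℕ) ∧
      |(k : ℝ) * θ + ((-m : ℤ) : ℝ) * (2 * Real.pi)| ≤ 2 * Real.pi / (((n + 1 : ℕ) : ℝ) + 1) :=
    fun n => exists_small_multiple θ (Nat.succ_pos n)
  choose ms ks hk0 hkle hkapprox using hD
  -- the near-identity helical elements of the blow-downs `nsRescale (cs (J n)) v`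
  set ψ : ℕ → ℝ := fun n => (ks n : ℝ) * θ + ((-ms n : ℤ) : ℝ) * (2 * Real.pi) with hψ_def
  set η : ℕ → ℝ := fun n => (ks n : ℝ) * (h / cs (J n)) with hη_def
  have helem : ∀ n, IsHelixAbout ((cs (J n))⁻¹ • c₀) (ψ n) (η n) (nsRescale (cs (J n)) v) :=
    fun n => ((hwx (J n)).zpow (ks n)).shift_angle (-ms n)
  have hn1 : ∀ n : ℕ, (0 : ℝ) < (n : ℝ) + 1 := fun n => by positivity
  have hψbound : ∀ n, |ψ n| ≤ 2 * Real.pi * (1 / ((n : ℝ) + 1)) := by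
    intro n
    have h1 := hkapprox n
    have h2 : 2 * Real.pi / (((n + 1 : ℕ) : ℝ) + 1) ≤ 2 * Real.pi * (1 / ((n : ℝ) + 1)) := by
      rw [mul_one_div]
      push_cast
      exact div_le_div_of_nonneg_left (by positivity) (hn1 n) (by linarith)
    exact h1.trans h2
  have hηpos : ∀ n, 0 < |η n| := by
    intro n
    show 0 < |(ks n : ℝ) * (h / cs (J n))|
    exact abs_pos.2 (mul_ne_zero (Int.cast_ne_zero.2 (hk0 n).ne') (div_ne_zero hh (hc0 _).ne'))
  have hηbound : ∀ n, |η n| ≤ |h| * (1 / ((n : ℝ) + 1)) := by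
    intro n
    show |(ks n : ℝ) * (h / cs (J n))| ≤ _
    rw [abs_mul, abs_div, abs_of_pos (hc0 _), abs_of_pos (Int.cast_pos.2 (hk0 n)), mul_one_div, mul_div_assoc',
      div_le_div_iff₀ (hc0 _) (hn1 n)]
    have hk : (ks n : ℝ) ≤ (n : ℝ) + 1 := by
      have := hkle n
      push_cast at this
      exact_mod_cast this
    calc (ks n : ℝ) * |h| * ((n : ℝ) + 1) ≤ ((n : ℝ) + 1) * |h| * ((n : ℝ) + 1) := by gcongr
      _ = |h| * ((n : ℝ) + 1) ^ 2 := by ring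
      _ ≤ |h| * cs (J n) := by gcongr; exact hJc n
  -- sizes and directions
  set eps : ℕ → ℝ := fun n => |ψ n| + |η n| with heps_def
  have heps : ∀ n, 0 < eps n := fun n => by
    show 0 < |ψ n| + |η n|
    linarith [abs_nonneg (ψ n), hηpos n]
  have heps0 : Tendsto eps atTop (𝓝 0) := by
    have h1 : Tendsto (fun n : ℕ => (2 * Real.pi + |h|) * (1 / ((n : ℝ) + 1))) atTop (𝓝 0) := by
      simpa using (tendsto_one_div_add_atTop_nhds_zero_nat (𝕜 := ℝ)).const_mul (2 * Real.pi + |h|)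
    refine tendsto_of_tendsto_of_tendsto_of_le_of_le tendsto_const_nhds h1 (fun n => (heps n).le) (fun n => ?_)
    show |ψ n| + |η n| ≤ (2 * Real.pi + |h|) * (1 / ((n : ℝ) + 1))
    have := add_le_add (hψbound n) (hηbound n)
    linarith
  have hKc : IsCompact (Set.Icc (-1 : ℝ) 1 ×ˢ Set.Icc (-1 : ℝ) 1) := isCompact_Icc.prod isCompact_Icc
  set f : ℕ → ℝ × ℝ := fun n => (ψ n / eps n, η n / eps n) with hf
  have hfK : ∀ n, f n ∈ Set.Icc (-1 : ℝ) 1 ×ˢ Set.Icc (-1 : ℝ) 1 := by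
    intro n
    refine Set.mk_mem_prod ?_ ?_
    · have h1 : |ψ n / eps n| ≤ 1 := by
        rw [abs_div, abs_of_pos (heps _), div_le_one (heps _)]
        show |ψ n| ≤ |ψ n| + |η n|
        linarith [abs_nonneg (η n)]
      exact abs_le.1 h1
    · have h1 : |η n / eps n| ≤ 1 := by
        rw [abs_div, abs_of_pos (heps _), div_le_one (heps _)]
        show |η n| ≤ |ψ n| + |η n|
        linarith [abs_nonneg (ψ n)]
      exact abs_le.1 h1
  obtain ⟨⟨p, q⟩, -, φ, hφ, hlim⟩ := hKc.tendsto_subseq hfK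
  have hp : Tendsto (fun j => ψ (φ j) / eps (φ j)) atTop (𝓝 p) := by
    have h1 := (continuous_fst.tendsto _).comp hlim
    simpa [hf, Function.comp_def] using h1
  have hq : Tendsto (fun j => η (φ j) / eps (φ j)) atTop (𝓝 q) := by
    have h1 := (continuous_snd.tendsto _).comp hlim
    simpa [hf, Function.comp_def] using h1
  have hpq : |p| + |q| = 1 := by
    have h1 : Tendsto (fun j => |ψ (φ j) / eps (φ j)| + |η (φ j) / eps (φ j)|) atTop (𝓝 (|p| + |q|)) := hp.abs.add hq.abs
    have h2 : (fun j => |ψ (φ j) / eps (φ j)| + |η (φ j) / eps (φ j)|) = fun _ => (1 : ℝ) := by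
      funext j
      rw [abs_div, abs_div, abs_of_pos (heps _), ← add_div, div_eq_one_iff_eq (heps _).ne']
    rw [h2, tendsto_const_nhds_iff] at h1
    exact h1.symm
  -- the extraction along the subsequence: `V` is invariant under the one-parameter helical group `(pτ, qτ)` about the origin
  have hsubJ : Tendsto (fun j => J (φ j)) atTop atTop := hJtop.comp hφ.tendsto_atTop
  have ha : Tendsto (fun j => (cs (J (φ j)))⁻¹ • c₀) atTop (𝓝 (0 : E₃)) := by
    have h1 : Tendsto (fun j => (cs (J (φ j)))⁻¹) atTop (𝓝 0) := tendsto_inv_atTop_zero.comp (hcs.comp hsubJ)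
    simpa using h1.smul_const c₀
  have hop : ∀ τ : ℝ, IsHelixAbout (0 : E₃) (p * τ) (q * τ) V :=
    helixOneParameter_of_limit C (vs := fun j => nsRescale (cs (J (φ j))) v) (U := V) (as := fun j => (cs (J (φ j)))⁻¹ • c₀)
      (ths := fun j => ψ (φ j)) (hs := fun j => η (φ j)) (eps := fun j => eps (φ j))
      (fun j => (hwcl _).2.2.2) (fun j => (hwcl _).1.continuousOn) (fun j s t hst ht x => (hwcl _).mild_eq_heatExtension hst ht x)
      (fun j => (hwcl _).2.1) (fun t ht x => (hconv t ht x).comp hsubJ) (fun j => helem (φ j)) ha (fun j => heps _)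
      (heps0.comp hφ.tendsto_atTop) hp hq
  have hop' : ∀ τ : ℝ, IsHelix (p * τ) (q * τ) V := by
    intro τ t ht x
    have key := hop τ t ht x
    simpa only [add_zero] using key
  -- the two ends
  by_cases hq0 : q = 0
  · have hp0 : p ≠ 0 := by
      intro hp0; rw [hp0, hq0, abs_zero] at hpq; norm_num at hpq
    have hall : ∀ θ' : ℝ, IsHelix θ' 0 V := by
      intro θ'
      have h1 := hop' (θ' / p)
      have e1 : p * (θ' / p) = θ' := by field_simp
      rwa [e1, hq0, zero_mul] at h1
    exact hVne (axisymmetric_absurd hV (isAxisymmetric_of_isHelix hall))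
  · obtain ⟨s, hs0, hper⟩ : ∃ s : ℝ, s ≠ 0 ∧ IsHelix 0 s V := by
      by_cases hp0 : p = 0
      · refine ⟨q, hq0, ?_⟩
        have h1 := hop' 1
        rwa [hp0, zero_mul, mul_one] at h1
      · refine ⟨q * (2 * Real.pi / p), mul_ne_zero hq0 (div_ne_zero (by positivity) hp0), ?_⟩
        have h1 := (hop' (2 * Real.pi / p)).shift_angle (-1)
        have e1 : p * (2 * Real.pi / p) + ((-1 : ℤ) : ℝ) * (2 * Real.pi) = 0 := by push_cast; field_simp; ring
        rwa [e1] at h1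
    have hℓ : s • EuclideanSpace.single (2 : Fin 3) (1 : ℝ) ≠ 0 := by
      intro h0
      have h1 := congrArg (fun w : E₃ => w 2) h0
      simp at h1
      exact hs0 h1
    exact hVne (PoloidalWindowDoorPoloidalWindowRigidityPeriodic.eq_zero_of_spatiallyPeriodic hV.2.2.2 hV.1.continuousOn
      (fun s t hst ht x => hV.mild_eq_heatExtension hst ht x) hV.2.1 hℓ (translate_of_isHelix_zero hper))

/-! ## §40 FINITE ROTATION ORDER, class-uniform (PROVED, unconditional + U3a): a rotational symmetry of a pinned peakless profile about a bounded vertical axis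
has RATIONAL angle `2πk/n` with `|n| ≤ M(C,B)` — small angles integrate to axisymmetry (extraction), irrational ones are dense (Mathlib `AddSubgroup.dense_or_cyclic`) -/

/-- **THE ROTATION FLOOR (PROVED, H1-free):** for every `C, B` there is `ρ(C,B) > 0` such that no pinned peakless class-`C` profile has a pure rotational
symmetry by an angle `θ ∈ (0, ρ)` about a vertical axis `‖c‖ ≤ B` — the pure-rotation slice of the pinned extraction (`pinnedExtraction`, λₙ = 1 ⇒ `q = 0`): the limit is AXISYMMETRIC, hand H1 is never met. -/
theorem rotationFloor_pinned (hAG : AnisotropicGap) (C B : ℝ) :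
    ∃ ρ : ℝ, 0 < ρ ∧ ∀ (v : ℝ → E₃ → E₃) (θ : ℝ) (c : E₃),
      Pinned C v → Peakless v → ‖c‖ ≤ B → 0 < θ → θ < ρ → IsScrewAbout c θ 1 v → False := by
  by_contra hcon
  have hseq : ∀ n : ℕ, ∃ (v : ℝ → E₃ → E₃) (θ : ℝ) (c : E₃),
      Pinned C v ∧ Peakless v ∧ ‖c‖ ≤ B ∧ 0 < θ ∧ θ < 1 / ((n : ℝ) + 1) ∧ IsScrewAbout c θ 1 v := by
    intro n
    by_contra hn
    push Not at hn
    exact hcon ⟨1 / ((n : ℝ) + 1), by positivity, fun v θ c a1 a2 a3 a4 a5 a6 => hn v θ c a1 a2 a3 a4 a5 a6⟩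
  choose vs ths cs hP hK hcs hpos hsmall hscr using hseq
  obtain ⟨P, c, p, q, hPP, -, hpq, hq1, hop⟩ := pinnedExtraction hAG C B (lams := fun _ => (1 : ℝ)) hP hK hcs (fun _ => one_pos)
    (fun n => by rw [Real.log_one, abs_zero, add_zero, abs_of_pos (hpos n)]; exact hsmall n) (fun n => Or.inl (hpos n).ne') hscr
  have hq0 : q = 0 := hq1 fun _ => rfl
  have hp0 : p ≠ 0 := by
    intro hp0; rw [hp0, hq0, abs_zero] at hpq; norm_num at hpq
  have hall : ∀ θ : ℝ, IsScrew θ 1 (fun t x => P t (x + c)) := by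
    intro θ
    have h := hop (θ / p)
    have e1 : p * (θ / p) = θ := by field_simp
    rwa [e1, hq0, zero_mul, Real.exp_zero] at h
  exact not_axisymmetric_pinned hPP (isAxisymmetric_of_isScrew hall)

/-- **FINITE ROTATION ORDER, class-uniformly bounded (PROVED, unconditional + U3a).**  For every `C, B` there is `M(C,B)` such that every rotational symmetry
`θ` of a pinned peakless class-`C` profile about a vertical axis `‖c‖ ≤ B` is a RATIONAL part of a full turn with bounded denominator: `θ·n = 2π·k`, `0 < |n| ≤ M`.
Proof: the additive subgroup `ℤθ + 2πℤ ⊂ ℝ` consists of symmetry angles (full turns are free); it meets `(−ρ, ρ)` only in `0` (`rotationFloor_pinned` and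
inversion), so it is not dense, hence cyclic (`AddSubgroup.dense_or_cyclic`) with a generator `|a| ≥ ρ`, and `2π = n a`, `θ = k a`, `|n| = 2π/|a| ≤ 2π/ρ`.
IRRATIONAL rotational symmetries, in particular, do not occur. -/
theorem rotation_rational_pinned (hAG : AnisotropicGap) (C B : ℝ) :
    ∃ M : ℝ, ∀ (v : ℝ → E₃ → E₃) (θ : ℝ) (c : E₃),
      Pinned C v → Peakless v → ‖c‖ ≤ B → IsScrewAbout c θ 1 v → ∃ n k : ℤ, n ≠ 0 ∧ |(n : ℝ)| ≤ M ∧ θ * n = 2 * Real.pi * k := by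
  obtain ⟨ρ, hρ, H⟩ := rotationFloor_pinned hAG C B
  refine ⟨2 * Real.pi / ρ, fun v θ c hP hK hc hx => ?_⟩
  -- every element of `ℤθ + 2πℤ` is a symmetry angle
  have hsym : ∀ s ∈ AddSubgroup.closure ({θ, 2 * Real.pi} : Set ℝ), IsScrewAbout c s 1 v := by
    intro s hs
    obtain ⟨m, n, hmn⟩ := AddSubgroup.mem_closure_pair.1 hs
    have h1 := (hx.zpow one_pos m).shift_angle n
    rw [one_zpow] at h1
    have e : (m : ℝ) * θ + (n : ℝ) * (2 * Real.pi) = s := by rw [← hmn, zsmul_eq_mul, zsmul_eq_mul]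
    rwa [e] at h1
  -- … and none of them lies in `(−ρ, ρ) ∖ {0}`
  have hgap : ∀ s ∈ AddSubgroup.closure ({θ, 2 * Real.pi} : Set ℝ), |s| < ρ → s = 0 := by
    intro s hs hsρ
    by_contra hs0
    rcases lt_or_gt_of_ne hs0 with hneg | hpos
    · exact H v (-s) c hP hK hc (neg_pos.2 hneg) (by rw [abs_of_neg hneg] at hsρ; exact hsρ) (hsym (-s) (AddSubgroup.neg_mem _ hs))
    · exact H v s c hP hK hc hpos (by rw [abs_of_pos hpos] at hsρ; exact hsρ) (hsym s hs)
  rcases AddSubgroup.dense_or_cyclic (AddSubgroup.closure ({θ, 2 * Real.pi} : Set ℝ)) with hd | ⟨a, ha⟩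
  · exfalso
    obtain ⟨s, hs, hsI⟩ := hd.exists_mem_open isOpen_Ioo (⟨ρ / 2, by constructor <;> linarith⟩ : (Set.Ioo (0 : ℝ) ρ).Nonempty)
    exact hsI.1.ne' (hgap s hs (by rw [abs_of_pos hsI.1]; exact hsI.2))
  · have h2π : (2 * Real.pi) ∈ AddSubgroup.closure ({θ, 2 * Real.pi} : Set ℝ) := AddSubgroup.subset_closure (by simp)
    have hθ : θ ∈ AddSubgroup.closure ({θ, 2 * Real.pi} : Set ℝ) := AddSubgroup.subset_closure (by simp)
    have haS : a ∈ AddSubgroup.closure ({θ, 2 * Real.pi} : Set ℝ) := by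
      rw [ha]; exact AddSubgroup.subset_closure (Set.mem_singleton a)
    rw [ha] at h2π hθ
    obtain ⟨n, hn⟩ := AddSubgroup.mem_closure_singleton.1 h2π
    obtain ⟨k, hk⟩ := AddSubgroup.mem_closure_singleton.1 hθ
    rw [zsmul_eq_mul] at hn hk
    have ha0 : a ≠ 0 := by
      intro h0; rw [h0, mul_zero] at hn; linarith [Real.pi_pos]
    have hn0 : (n : ℝ) ≠ 0 := by
      intro h0; rw [h0, zero_mul] at hn; linarith [Real.pi_pos]
    have haρ : ρ ≤ |a| := by
      by_contra hlt
      push Not at hlt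
      exact ha0 (hgap a haS hlt)
    refine ⟨n, k, by exact_mod_cast hn0, ?_, ?_⟩
    · have e : |(n : ℝ)| = 2 * Real.pi / |a| := by
        rw [eq_div_iff (abs_ne_zero.2 ha0), ← abs_mul, hn, abs_of_pos (by positivity)]
      rw [e]
      exact div_le_div_of_nonneg_left (by positivity) hρ haρ
    · rw [← hk, ← hn]; ring

/-! ## §41 THE ROTATED NEAR-ONE FLOOR (PROVED from H1 + U3a by Dirichlet): no pinned peakless profile is screw-scaling invariant with a factor `λ ≠ 1`,
`|log λ| < ρ′(C,B)`, about a bounded centre — for ANY rotation angle (LINE 28 had `θ = 0`, LINE 29 `|θ|` small) -/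

/-- **THE ROTATED NEAR-ONE FLOOR, any angle (PROVED from H1 and U3a).**  For every `C, B` there is `ρ′(C,B) > 0` such that no pinned peakless class-`C` profile
is invariant under a vertical screw-scaling `(θ, λ)` about `‖c‖ ≤ B` with `λ ≠ 1`, `|log λ| < ρ′` — WHATEVER the angle `θ`: by Dirichlet's pigeonhole a power
`g^k`, `k ≤ Q`, has rotation part within `2π/(Q+1)` of a full turn count and scaling part `|k log λ| ≤ Q|log λ|`, so for `Q ≈ 4π/ρ` and `|log λ| < ρ/(2Q+2)` the
power is a NEAR-IDENTITY element `≠ e` ↯ `nearIdentity_pinned`.  Pineau–Vicol's RDSS exclusion (Thm 1.7, WITH decay, `|α| ≪ 1`) thus holds in the pinned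
non-decaying class for near-one factors at every angle, modulo the research hand H1 (slow rotating scaling solitons). -/
theorem rotatedNearOne_pinned (hAG : AnisotropicGap) (hH1 : NoPinnedScrewSoliton) (C B : ℝ) :
    ∃ ρ' : ℝ, 0 < ρ' ∧ ∀ (v : ℝ → E₃ → E₃) (θ lam : ℝ) (c : E₃),
      Pinned C v → Peakless v → ‖c‖ ≤ B → 0 < lam → lam ≠ 1 → |Real.log lam| < ρ' → IsScrewAbout c θ lam v → False := by
  obtain ⟨ρ, hρ, H⟩ := nearIdentity_pinned hAG hH1 C B
  obtain ⟨N, hN⟩ := exists_nat_gt (4 * Real.pi / ρ)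
  have hN1 : (0 : ℝ) < (N : ℝ) + 1 := by positivity
  refine ⟨ρ / (2 * ((N : ℝ) + 1)), by positivity, ?_⟩
  intro v θ lam c hP hK hc hlam hlam1 hlog hx
  obtain ⟨m, k, hk0, hkle, happrox⟩ := exists_small_multiple θ (Nat.succ_pos N)
  have h1 := (hx.zpow hlam k).shift_angle (-m)
  -- the rotation part of `g^k` (mod full turns) is small …
  have hψ : |(k : ℝ) * θ + ((-m : ℤ) : ℝ) * (2 * Real.pi)| < ρ / 2 := by
    have h2 : 2 * Real.pi / (((N + 1 : ℕ) : ℝ) + 1) < ρ / 2 := by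
      push_cast
      rw [div_lt_div_iff₀ (by positivity) (by norm_num)]
      have h3 : 4 * Real.pi < ρ * (N : ℝ) := by
        have := (div_lt_iff₀ hρ).1 hN
        linarith [mul_comm ρ (N : ℝ)]
      nlinarith [Real.pi_pos, hρ]
    exact happrox.trans_lt h2
  -- … and so is its scaling part
  have hlogk : |Real.log (lam ^ k)| < ρ / 2 := by
    rw [Real.log_zpow, abs_mul]
    have hkR : |(k : ℝ)| ≤ (N : ℝ) + 1 := by
      rw [abs_of_pos (Int.cast_pos.2 hk0)]
      have := hkle
      push_cast at this
      exact_mod_cast this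
    calc |(k : ℝ)| * |Real.log lam| ≤ ((N : ℝ) + 1) * |Real.log lam| := by gcongr
      _ < ((N : ℝ) + 1) * (ρ / (2 * ((N : ℝ) + 1))) := by gcongr
      _ = ρ / 2 := by field_simp
  have hne : (k : ℝ) * θ + ((-m : ℤ) : ℝ) * (2 * Real.pi) ≠ 0 ∨ lam ^ k ≠ 1 := Or.inr (fun h1' => by
    have hz : Real.log (lam ^ k) = 0 := by rw [h1', Real.log_one]
    rw [Real.log_zpow] at hz
    exact mul_ne_zero (Int.cast_ne_zero.2 hk0.ne') (Real.log_ne_zero_of_pos_of_ne_one hlam hlam1) hz)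
  exact H v _ (lam ^ k) c hP hK hc (zpow_pos hlam k) (by linarith) hne h1

/-! ## §42 The research cells RE-CUT (OPEN): POINT-WEB and POINT-SYNDETIC — the residue's objects carry, besides LINE 28/29's data, NO helical symmetry,
rotational symmetries of BOUNDED FINITE ORDER, and (mod H1) no rotated scaling with a near-one factor at any angle -/

/-- **Datum 6 — no helical symmetry (PROVED, `noHelixAt_holds`).** -/
def NoHelixAt (C : ℝ) : Prop :=
  ∀ (w : ℝ → E₃ → E₃) (c : E₃) (θ h : ℝ),
    Pinned C w → Peakless w → NoPinLoss C w → h ≠ 0 → IsHelixAbout c θ h w → False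

/-- **Datum 7 — rotational symmetries have rational angles with class-uniformly bounded denominator (PROVED from U3a, `rotationOrderAt_of`).** -/
def RotationOrderAt (C : ℝ) : Prop :=
  ∀ B : ℝ, ∃ M : ℝ, ∀ (w : ℝ → E₃ → E₃) (θ : ℝ) (c : E₃),
    Pinned C w → Peakless w → ‖c‖ ≤ B → IsScrewAbout c θ 1 w → ∃ n k : ℤ, n ≠ 0 ∧ |(n : ℝ)| ≤ M ∧ θ * n = 2 * Real.pi * k

/-- **Datum 8 — the rotated near-one floor, any angle (PROVED from H1 and U3a, `rotatedNearOneAt_of_H1`).** -/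
def RotatedNearOneAt (C : ℝ) : Prop :=
  ∀ B : ℝ, ∃ ρ' : ℝ, 0 < ρ' ∧ ∀ (w : ℝ → E₃ → E₃) (θ lam : ℝ) (c : E₃),
    Pinned C w → Peakless w → ‖c‖ ≤ B → 0 < lam → lam ≠ 1 → |Real.log lam| < ρ' → IsScrewAbout c θ lam w → False

theorem noHelixAt_holds (C : ℝ) : NoHelixAt C := fun _ _ _ _ hP hK hN hh hx => not_helical_pinned hP hK hN hh hx

theorem rotationOrderAt_of (hAG : AnisotropicGap) (C : ℝ) : RotationOrderAt C := fun B => rotation_rational_pinned hAG C B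

theorem rotatedNearOneAt_of_H1 (hAG : AnisotropicGap) (hH1 : NoPinnedScrewSoliton) (C : ℝ) : RotatedNearOneAt C :=
  fun B => rotatedNearOne_pinned hAG hH1 C B

/-- **Research cell POINT-WEB (OPEN; supersedes LINE 29's SCREW-WEB).**  SCREW-WEB's binders VERBATIM plus the four symmetry data of this line.  What remains
for the cell: profiles whose full vertical similarity group is a FINITE rotation group of order `≤ M(C,B)` about one axis, possibly extended by ONE coarse
screw-scaling generator `(θ₀, λ₀)`, `λ₀ ≥ λ_*` (one centre: annex `Lines/point_group_centre.lean`) — or trivial; slow solitons (H1); and the symmetry-free breathers. -/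
def CellPointWeb : Prop :=
  AnisotropicGap →
  ∀ (C A : ℝ) (v : ℝ → E₃ → E₃) (W : Set (ℝ × E₃)),
    NearOneFloorAt C → NoSelfSimilarAt C → ScalingGroupAt C → NearIdentityFloorAt C → NoAxisymmetricAt C →
    NoHelixAt C → RotationOrderAt C → RotatedNearOneAt C →
    Pinned C v → ThickWindow v W → Peakless v → LeastPin C v → NoPinLoss C v → PastPin C v → ScaleWindowPin v →
    0 < A → EternallyPinned A C v → False

/-- **stub — research cell POINT-WEB** (OPEN; a `sorry` of the file). -/
theorem stub_cellPointWeb : CellPointWeb := by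
  sorry

/-- **Research cell POINT-SYNDETIC (OPEN; supersedes LINE 29's SCREW-SYNDETIC).**  SCREW-SYNDETIC's binders VERBATIM plus the four symmetry data. -/
def CellPointSyndetic : Prop :=
  AnisotropicGap → VerticalCore →
  ∀ (C : ℝ) (v : ℝ → E₃ → E₃) (W : Set (ℝ × E₃)),
    NearOneFloorAt C → NoSelfSimilarAt C → ScalingGroupAt C → NearIdentityFloorAt C → NoAxisymmetricAt C →
    NoHelixAt C → RotationOrderAt C → RotatedNearOneAt C →
    Pinned C v → ThickWindow v W → Peakless v → LeastPin C v → NoPinLoss C v → PastPin C v → ScaleWindowPin v →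
    SyndeticBreathing v → False

/-- **stub — research cell POINT-SYNDETIC** (OPEN; a `sorry` of the file). -/
theorem stub_cellPointSyndetic : CellPointSyndetic := by
  sorry

/-! ## §43 Kernels (checked, no sorry): LINE 29's cells from the re-cut ones given H1 and U3a, and the compositions to the crux items BY NAME -/

/-- **KERNEL (PROVED): SCREW-WEB ⇐ H1 ∧ POINT-WEB.** -/
theorem cellScrewWeb_of_point (hH1 : NoPinnedScrewSoliton) (h : CellPointWeb) : CellScrewWeb :=
  fun hAG C A v W hF hNS hSG hNI hNA => h hAG C A v W hF hNS hSG hNI hNA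
    (noHelixAt_holds C) (rotationOrderAt_of hAG C) (rotatedNearOneAt_of_H1 hAG hH1 C)

/-- **KERNEL (PROVED): SCREW-SYNDETIC ⇐ H1 ∧ POINT-SYNDETIC.** -/
theorem cellScrewSyndetic_of_point (hH1 : NoPinnedScrewSoliton) (h : CellPointSyndetic) : CellScrewSyndetic :=
  fun hAG hVC C v W hF hNS hSG hNI hNA => h hAG hVC C v W hF hNS hSG hNI hNA
    (noHelixAt_holds C) (rotationOrderAt_of hAG C) (rotatedNearOneAt_of_H1 hAG hH1 C)

/-- **The crux `PoloidalWindowRigidity` (K2, stmt-NavierStokesRegularity-19708) BY NAME ⇐ S0 ∧ ⟨27893⟩ ∧ U4b ∧ H1 ∧ POINT-WEB ∧ POINT-SYNDETIC.**  CONDITIONAL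
(no summit and no crux is proved: `hS0`, `hG` are the column's shared hypotheses, H1 is a research hand, the two cells are OPEN). -/
theorem PoloidalWindowRigidity_of_pointCells (hS0 : S0Statement)
    (hG : Summit.NavierStokesRegularity.NavierStokesRegularity.Theses.LoopPeriodRatchet.FrequencyGrowthExponent)
    (hVC : VerticalCore) (hH1 : NoPinnedScrewSoliton) (hweb : CellPointWeb) (hsb : CellPointSyndetic) :
    Summit.NavierStokesRegularity.NavierStokesRegularity.Theses.PoloidalWindowDoor.PoloidalWindowRigidity :=
  PoloidalWindowRigidity_of_screwCells hS0 hG hVC hH1 (cellScrewWeb_of_point hH1 hweb) (cellScrewSyndetic_of_point hH1 hsb)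

/-- **The item `LrcModEntire` (stmt-NavierStokesRegularity-20428) BY NAME ⇐ S0 ∧ ⟨27893⟩ ∧ U4b ∧ H1 ∧ POINT-WEB ∧ POINT-SYNDETIC.**  CONDITIONAL. -/
theorem LrcModEntire_of_pointCells (hS0 : S0Statement)
    (hG : Summit.NavierStokesRegularity.NavierStokesRegularity.Theses.LoopPeriodRatchet.FrequencyGrowthExponent)
    (hVC : VerticalCore) (hH1 : NoPinnedScrewSoliton) (hweb : CellPointWeb) (hsb : CellPointSyndetic) :
    Summit.NavierStokesRegularity.NavierStokesRegularity.Theses.PoloidalWindowDoor.LrcModEntire :=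
  LrcModEntire_of_screwCells hS0 hG hVC hH1 (cellScrewWeb_of_point hH1 hweb) (cellScrewSyndetic_of_point hH1 hsb)

/-- With the hand and the two research cells taken from their stubs — the shape the lead consumes (the ONLY sorries behind this theorem are
`stub_noPinnedScrewSoliton` (H1, research; fast half PROVED) and the two research cells; U3a, U3b, U2b, U4b wired by name; everything else PROVED in-file). -/
theorem PoloidalWindowRigidity_of_pointCellStubs (hS0 : S0Statement)
    (hG : Summit.NavierStokesRegularity.NavierStokesRegularity.Theses.LoopPeriodRatchet.FrequencyGrowthExponent) :
    Summit.NavierStokesRegularity.NavierStokesRegularity.Theses.PoloidalWindowDoor.PoloidalWindowRigidity :=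
  PoloidalWindowRigidity_of_pointCells hS0 hG stub_verticalCore stub_noPinnedScrewSoliton stub_cellPointWeb stub_cellPointSyndetic

theorem LrcModEntire_of_pointCellStubs (hS0 : S0Statement)
    (hG : Summit.NavierStokesRegularity.NavierStokesRegularity.Theses.LoopPeriodRatchet.FrequencyGrowthExponent) :
    Summit.NavierStokesRegularity.NavierStokesRegularity.Theses.PoloidalWindowDoor.LrcModEntire :=
  LrcModEntire_of_pointCells hS0 hG stub_verticalCore stub_noPinnedScrewSoliton stub_cellPointWeb stub_cellPointSyndetic

end Summit.NavierStokesRegularity.NavierStokesRegularity.Cruxes.PoloidalWindowRigidity.PointGroup
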